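import Literature.Probability.RandomPlanarGeometry.YangBaxterSAWExcursionJordan
import Literature.Probability.RandomPlanarGeometry.YangBaxterSAWYBE
import Literature.Probability.RandomPlanarGeometry.HopfClosed
import HarnessLib

/-!
# Barrier catalogue (SAWScalingLimit): the sign law of wound excursions at an ARBITRARY plaquette, the TURNING
RIGIDITY of the prefix (Hopf's Umlaufsatz, twice), and the FAR-CELL LAW of a hole root

Companion of `PlaquetteWalkHoleRootFarCellRoutes` (this catalogue; the algebra `phase(WP)·backBracket = −v(θ)` of the
two routes to the far cell and the rigidity (R1) «a wound walk enters a hole-adjacent plaquette from a LATERAL side»),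
of `PlaquetteWalkRootPlaquetteDefectLaw` (the sign law and the defect law at the ROOT'S OWN plaquette) and of
`YangBaxterSAWUnwoundPlaquette` / `YangBaxterSAWExcursionJordan` (topic `RandomPlanarGeometry`: Glazman–Manolescu's
Lemma-2.1 defect of any non-interior root `a` at any rhombus `r` is `rootphase · i · Σ_{B2a(r)} classTerm`,
`classTerm = extWeight · phase(WP) · sin((5/8)(WE − excursionWinding)) · backBracket(θ; z₀, z₁, z₂, z₃)`; the winding
laws `WE = excursionWinding ± 2·AJ`; the sign rule `AJ(midPt(r.side σ)) ∈ {0, 2π·ε(σ; z₁, z₂)}`), using the tree's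
discrete Umlaufsatz `SAW.Hopf.hopf_closed` (`HopfClosed.lean`) and the walk polyline of `YangBaxterSAWBoundaryWinding`
(`YBWalk.vtx`, `YBWalk.subtended`, `YBWalk.sum_ext_angles_eq_winding`).

* Part A (every finite face domain, every non-interior root, EVERY rooted rhombus `r`):
  `ΩG.WE_sub_excursionWinding_eq_two_mul`, ★★ `ΩG.sign_law` — for a class-`B2a` walk with first side `z₀`, exit `z₁`,
  return `z₂`: EITHER `WE = excursionWinding(θ; z₀, z₁, z₂)` (group sign `0`: unwound) OR
  `WE − excursionWinding = 4π·ε(z₀; z₁, z₂)` and the group sign `sin((5/8)(WE − excursionWinding))` IS the chord sign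
  `ε(z₀; z₁, z₂)` of the FIRST side (the tree's `sign_law_root` is the case `z₀ = σ` of the root's own plaquette; here the
  swept angle is transported from the root to the midpoint of the first side along the prefix,
  `ΩG.AJ_midPt_firstSide_eq_AJ_root`, where the sign rule `ΩG.AJ_midPt_side_eq` evaluates it); ★ `ΩG.classTerm_dichotomy`
  (the SIGNED class term at an arbitrary plaquette: `0`, or `extWeight · phase(WP) · ε(z₀; z₁, z₂) · backBracket`),
  `ΩG.AJ_ne_zero_or_rev_of_wound` (a wound walk has a wound orientation witness), `ΩG.chordSign_mul_backBracket_swap`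
  (a walk and its reversed companion carry the same signed term), `ΩG.exit_return_doors`.
* Part B (the FAR CELL `f = (w.1 − 2, w.2)` of the hole root `a = w.side W`, hole `h = (w.1 − 1, w.2) ∉ D`, `f ∈ D` —
  the `W`-root frame): `ΩG.firstSide_eq_N_or_S_of_wound` ((R1) of the companion file, assembled: a wound walk at `f`
  entered from `N` or from `S`); the algebra `farCellW_termN` / `farCellW_termS`; the turning statement
  `FarCellTurningW D w θ` (the lane's (R2): a wound walk entering `f` from `N` has prefix turning `π + θ` — over the hole —,
  from `S` turning `θ − 2π` — under it) and, in CONDITIONAL form, ★★ `ΩG.classTerm_farCellW`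
  (`classTerm = v(θ)·(routeMass_N − routeMass_S)` walk by walk), `ΩG.sum_classTerm_farCellW`,
  `PlaquetteWalk.vertexFunctional_printed_farCellW_eq_of_turning` and its corollaries.
* § Turning — (R2) IS A THEOREM (`ΩG.farCellTurningW_holds`). Tools: `dsq`, `two_mul_sdot` (polarization
  `2·sdot A B v = |A − v|² + |B − v|² − |A − B|²`), ★ `hopf_cyclic_int` (a CYCLIC form of `hopf_closed` for integer polygons:
  base point moved to a lowest vertex inside), ★ `ΩG.dsq_vtx_succ_le` (consecutive vertices of any walk polyline are at
  squared distance `≤ 4`), `four_le_dsq_innerPt` / `nine_le_dsq_innerPt` (inner points of faces other than `f` and its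
  `E`-neighbour stay away from the closing points in `f ∪ h`). THE PREFIX POLYGON `C` (`ΩG.pre` = `ω.2.take firstHitG`,
  `ΩG.cycC`: the prefix polyline closed by `midPt(f.side z₀) → ctr f → midPt(f.side E) → ctr h → midPt(w.side W)`):
  `cycC_injective`, `cycC_subtended` (walk against walk by `YBWalk.subtended`, everything else by distances),
  `sum_extAng_cycC` (`= WP(π/2) ± π/2`), ★★ `ΩG.WP_pi_div_two_mem`: **the prefix turns by `3π/2` or `−5π/2` (first side
  `N`), by `5π/2` or `−3π/2` (first side `S`)**. THE WHOLE-WALK POLYGON `Π` (`ΩG.cycP`: the whole walk closed by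
  `midPt(f.side z₂) → f.base + (3,2) + z₀.nIn → midPt(f.side E) → ctr h → midPt(w.side W)`, for the corner patterns
  `(z₀, z₁, z₂) ∈ {(N, W, S), (S, W, N)}`): `winding_eq_WP_add` (`winding = WP + arcTurn(z₀ → z₁) + WE`), `cycP_injective`,
  `cycP_subtended` (a finite master table `dsq_cycP_closing`), `sum_extAng_cycP` (`= winding(π/2) ∓ π/2`),
  ★★ `ΩG.WP_pi_div_two_eq_corner`: for a WOUND walk the sign law gives `WE(π/2) = excursionWinding(π/2) ∓ 4π`, Hopf for
  `Π` leaves `WP ∈ {3π/2, 11π/2}` (resp. `{−3π/2, −11π/2}`), and intersecting with `C`'s two values pins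
  **`WP(π/2) = 3π/2` (first side `N`) resp. `−3π/2` (first side `S`)** — no orientation or winding-number input is
  needed. ★★★ `ΩG.WP_pi_div_two_eq_of_wound` (straight patterns by reversal: `WP`, the first side and woundness are
  reversal invariant), `ΩG.WP_const_eq` (`WP(θ) = WP(π/2) + (θ − π/2)` by the tree's slant potential),
  ★★★ `ΩG.farCellTurningW_holds`.
* § The far-cell law, UNCONDITIONAL: ★★★★ `PlaquetteWalk.vertexFunctional_printed_farCellW_eq`:
  **`VF_D(w.side W, f) = i · v(θ) · (M_N − M_S)`** for every `θ ∈ [π/3, 2π/3]`, every finite face list with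
  `h ∉ D ∋ f` (`M_N, M_S ≥ 0` the total exterior weights of the wound class-`B2a` walks at `f` entering over resp. under
  the hole); ★★★ `…_re_eq_zero` — THE FAR-CELL HALF LAW (H1): the component of Glazman–Manolescu's vertex relation along
  the dead side's coefficient `c_E = 1` SURVIVES at the far cell of every hole root; `…_eq_zero_iff` (`VF(f) = 0 ⟺
  M_N = M_S`: the mechanism of the lane's (R-9′) mirror zeros at `θ = π/2`, where a mirror symmetry of the domain
  exchanges the two routes with equal masses — the mirror statement itself is not in this file); ★★★
  `…_ne_zero_of_over` (open range, all weights positive: no wound under-route walk and some wound over-route walk ⇒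
  `VF(f) ≠ 0` — a SUFFICIENT-half instance of the lane's encircling criterion at a plaquette other than the root's own).
* § The honeycomb point (edition 6): at `θ = π/3` the printed weights are `(x_c, x_c², x_c², x_c², 0)` — the
  hexagonal-lattice self-avoiding walk at `x_c = 1/√(2+√2)` — and the law reads ★★★
  `PlaquetteWalk.vertexFunctional_printed_farCellW_pi_div_three_eq`: **`VF(f) = i · x_c² · (Σ_over x_c^ℓ − Σ_under x_c^ℓ)`**
  over the `w₂`-free wound walks (`ℓ` = honeycomb edges off `f`; `YBWalk.W2FreeOff`, `YBWalk.hexEdgesOff`,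
  `ΩG.hexRouteMassW`); ★★ ROUTE KILL (`…_pi_div_three_ne_zero_of_under_killed` / `_of_over_killed`: every wound walk of
  one route carries a double co-corner rhombus, some wound walk of the other does not ⇒ `VF(π/3) ≠ 0` with BOTH routes
  wound); ★★ HONEYCOMB ZERO (`…_pi_div_three_eq_zero_of_killed`: no `w₂`-free wound walk ⇒ `VF(π/3) = 0`); the dual point
  `θ = 2π/3` (`w₁ = 0`) twins; and the one-route twin `…_ne_zero_of_under`.

Data (venture lane «pcv-sawmu», seat b-step0 gen 17, HOME `code/step0/g17/turning/`): exact enumeration of the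
15 776 class-`B2a` walks at the far cell of five hole-rooted domains (19–26 faces), 1 632 of them wound: (R1) and (R2)
hold for every wound walk (0 violations, as they must); «long-way» prefixes (turning `2π + θ` into `S`) occur only
for unwound walks (800 cases) — so (R2) is genuinely a statement about wound walks.

References, as printed: A. Glazman, I. Manolescu, arXiv:1708.00395v3, Lemma 2.1 (p. 6, stated «in the form given in
[Gl]») [GlazmanManolescu2019]; A. Glazman, Electron. Commun. Probab. 20 (2015) no. 86, Lemma 3.1 and its proof
pp. 6–7 (the classes of walks through a rhombus; eq. (1): the weights) [Glazman2015WeightedSAW]; H. Duminil-Copin,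
S. Smirnov, Ann. of Math. 175 (2012), Lemma 1, proof («In order to evaluate the winding of γ₁ between p and q above, we
used the fact that a is on the boundary and Ω is simply connected») [DuminilCopinSmirnov2012]; H. Hopf, Compositio
Math. 2 (1935) 50–62, Nr. 2 (Umlaufsatz, p. 53) and Nr. 4 eq. (22) (curves with corners, pp. 60–61) [Hopf1935].
Status: Part A = lane lemma (consolidation of the tree's winding laws and sign rule, new only in generality: first side
instead of root side); § Turning and the far-cell law = lane theorems, not located in print (hole roots are outside the
printed simply-connected setting; the turning rigidity is the discrete Umlaufsatz applied to two explicit lattice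
polygons). Written for the venture lane «pcv-sawmu» (Tier B, b-step0 gen 17; the far-cell law was conjectured, its
algebra proved and the rigidities (R1)–(R3) formulated by seat b-engine-1 gen 16).
-/

/-! ## Private twins of the companion leaf `PlaquetteWalkHoleRootFarCellRoutes` (CLASS-S edition)

This edition imports only modules whose oleans are built; the companion leaf's results used below (its two route
identities, the transport of the swept angle to the first side, and the chord-rule chain to (R1)
`firstSide_lateral_of_wound`) are carried as PRIVATE twins with the suffix `FR` — the companion leaf remains their
citable home. -/

noncomputable section

namespace Literature.Probability.RandomPlanarGeometry.SAW.YangBaxter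

open Real Complex

/-- (Duplicated from `PlaquetteWalkHoleRootFarCellRoutes` for build reasons; that leaf is the citable home of (R1) and of the route algebra.) Two phases multiply by adding the angles. [cite: Glazman2015WeightedSAW, Lemma 3.1 (proof: the phase factors e^{−iσ·winding})] -/
private theorem exp_mul_I_mul_exp_mul_IFR (a b : ℝ) :
    Complex.exp (((a : ℝ) : ℂ) * Complex.I) * Complex.exp (((b : ℝ) : ℂ) * Complex.I) =
      Complex.exp ((((a + b : ℝ)) : ℂ) * Complex.I) := by
  rw [← Complex.exp_add]; congr 1; push_cast; ring

/-- (Duplicated from `PlaquetteWalkHoleRootFarCellRoutes` for build reasons; that leaf is the citable home of (R1) and of the route algebra.) ★ **Over-route**: the prefix that passes over the hole and enters the far cell from `N` has total turning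
`π + θ`; with the tree's `backBracket_N_W_S_E` the product `phase(WP) · backBracket` is the REAL number
`−v(θ)`. [cite: Glazman2015WeightedSAW, Lemma 3.1, eq. (1) (the weight v(θ))] [cite: GlazmanManolescu2019, Lemma 2.1 (proof: [Gl])] -/
private theorem phase_over_mul_backBracket_N_W_S_EFR (θ : ℝ) :
    phase (π + θ) * backBracket θ .N .W .S .E = -(weightV θ : ℂ) := by
  rw [backBracket_N_W_S_E, phase]
  rw [show Complex.exp ((((-(5 / 8 * (π + θ))) : ℝ) : ℂ) * Complex.I) *
      (-(weightV θ : ℂ) * Complex.exp (((5 * θ / 8 + 5 * π / 8 : ℝ) : ℂ) * Complex.I)) =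
      -(weightV θ : ℂ) * (Complex.exp ((((-(5 / 8 * (π + θ))) : ℝ) : ℂ) * Complex.I) *
        Complex.exp (((5 * θ / 8 + 5 * π / 8 : ℝ) : ℂ) * Complex.I)) by ring,
    exp_mul_I_mul_exp_mul_IFR, show (-(5 / 8 * (π + θ)) + (5 * θ / 8 + 5 * π / 8) : ℝ) = 0 by ring]
  simp

/-- (Duplicated from `PlaquetteWalkHoleRootFarCellRoutes` for build reasons; that leaf is the citable home of (R1) and of the route algebra.) ★ **Under-route**: the prefix that passes under the hole and enters the far cell from `S` has total
turning `θ − 2π`; with `backBracket_S_W_N_E` the product is the same real number `−v(θ)`.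
[cite: Glazman2015WeightedSAW, Lemma 3.1, eq. (1) (the weight v(θ))] [cite: GlazmanManolescu2019, Lemma 2.1 (proof: [Gl])] -/
private theorem phase_under_mul_backBracket_S_W_N_EFR (θ : ℝ) :
    phase (θ - 2 * π) * backBracket θ .S .W .N .E = -(weightV θ : ℂ) := by
  rw [backBracket_S_W_N_E, phase]
  rw [show Complex.exp ((((-(5 / 8 * (θ - 2 * π))) : ℝ) : ℂ) * Complex.I) *
      (-(weightV θ : ℂ) * Complex.exp (((5 * θ / 8 - 5 * π / 4 : ℝ) : ℂ) * Complex.I)) =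
      -(weightV θ : ℂ) * (Complex.exp ((((-(5 / 8 * (θ - 2 * π))) : ℝ) : ℂ) * Complex.I) *
        Complex.exp (((5 * θ / 8 - 5 * π / 4 : ℝ) : ℂ) * Complex.I)) by ring,
    exp_mul_I_mul_exp_mul_IFR, show (-(5 / 8 * (θ - 2 * π)) + (5 * θ / 8 - 5 * π / 4) : ℝ) = 0 by ring]
  simp

/-- (Duplicated from `PlaquetteWalkHoleRootFarCellRoutes` for build reasons; that leaf is the citable home of (R1) and of the route algebra.) **The two routes agree**: `phase(π + θ) · backBracket θ N W S E = phase(θ − 2π) · backBracket θ S W N E` —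
the over- and under-route wound groups at the far cell point the same (real) way, so they can cancel only by
mass (the lane's (R-9′) mirror zeros). [cite: GlazmanManolescu2019, Lemma 2.1 (proof: [Gl])] -/
private theorem farCell_routes_agreeFR (θ : ℝ) :
    phase (π + θ) * backBracket θ .N .W .S .E = phase (θ - 2 * π) * backBracket θ .S .W .N .E := by
  rw [phase_over_mul_backBracket_N_W_S_EFR, phase_under_mul_backBracket_S_W_N_EFR]

/-! ## The chord rule at a plaquette adjacent to the root's exterior face (the combinatorial input (R1))

For a class-`B2a` walk at a rhombus `r` one of whose sides `σ` is a side of the exterior face `g ∉ D` that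
carries the root `a` (a plaquette adjacent to the root's hole, `σ` its dead side): the winding angle of the
excursion polygon `J` is the same at the midpoint of the root, at the midpoint of the first side `z₀` (transport
along the prefix, parent file) and at the midpoint of the dead side `σ` (transport through `g`, below). The sign
rule of `YangBaxterSAWExcursionJordan` evaluates both as `0` or `2π · chordSign(·; z₁, z₂)`; so for a WOUND walk the
first side and the dead side lie on the same side of the chord: `chordSign(z₀; z₁, z₂) = chordSign(σ; z₁, z₂)`, and in
particular `z₀` is never the side opposite to `σ` — at the far cell no wound excursion belongs to a walk that first
reached the cell from the far side. -/

open private far_ctr far_midPt sdot_pJpt_of_far AJ_eq_AJ_of_sdot pJpt_cases' sdot_midPt_ctr_pos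
  from Literature.Probability.RandomPlanarGeometry.YangBaxterSAWGeneralDomain

/-- (Duplicated from `PlaquetteWalkHoleRootFarCellRoutes` for build reasons; that leaf is the citable home of (R1) and of the route algebra.) `x² + y² ≥ 5` from coordinate bounds. [cite: GlazmanManolescu2019, §1 (the lattice of rhombi and its mid-edges)] -/
private theorem five_le_sq_add_sqFR {x y : ℤ}
    (h : (x ≤ -3 ∨ 3 ≤ x) ∨ (y ≤ -3 ∨ 3 ≤ y) ∨ ((x ≤ -2 ∨ 2 ≤ x) ∧ (y ≤ -1 ∨ 1 ≤ y)) ∨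
      ((y ≤ -2 ∨ 2 ≤ y) ∧ (x ≤ -1 ∨ 1 ≤ x))) : 5 ≤ x ^ 2 + y ^ 2 := by
  rcases h with (h | h) | (h | h) | ⟨h1 | h1, h2 | h2⟩ | ⟨h1 | h1, h2 | h2⟩ <;> nlinarith [sq_nonneg x, sq_nonneg y]

/-- (Duplicated from `PlaquetteWalkHoleRootFarCellRoutes` for build reasons; that leaf is the citable home of (R1) and of the route algebra.) An inner point of a face is at squared distance `≥ 5` from the midpoint of every edge other than the side it
sits next to. [cite: GlazmanManolescu2019, §1 (the lattice of rhombi and its mid-edges)] -/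
private theorem five_le_distSq_innerPt_midPt_of_neFR {g : Face} {z : Side} {e : MidEdge} (h : g.side z ≠ e) :
    5 ≤ ((innerPt g z).1 - (midPt e).1) ^ 2 + ((innerPt g z).2 - (midPt e).2) ^ 2 := by
  obtain ⟨k, j⟩ := g
  refine five_le_sq_add_sqFR ?_
  rcases e with ⟨k', j'⟩ | ⟨k', j'⟩ <;> cases z <;>
    simp [innerPt, Face.base, Side.inOff, Side.offset, Side.nIn, midPt, Face.side] at h ⊢ <;> omega

variable {D : Set Face} {a : MidEdge} {r : Face}

namespace YBWalk

/-- (Duplicated from `PlaquetteWalkHoleRootFarCellRoutes` for build reasons; that leaf is the citable home of (R1) and of the route algebra.) The `i`-th arc read through `nth`. [cite: GlazmanManolescu2019, §1 (the lattice of rhombi and its mid-edges)] -/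
private theorem arcFace_nth_eq_some_fcFR {z : MidEdge} (γ : YBWalk D a z) {i : ℕ} (hi : i < γ.arcs.length) :
    arcFace (γ.nth i, γ.nth (i + 1)) = some (γ.fc i) := by
  have h1 := (YBWalk.arcFace_arcAt (γ := γ) hi).1
  have hl := γ.length_eq
  rwa [YBWalk.arcAt_eq hi, ← γ.nth_eq_getElem (by omega), ← γ.nth_eq_getElem (by omega)] at h1

end YBWalk

namespace ΩG

variable {ω : ΩG D a r} (hr : RootedFace D a r)

/-- (Duplicated from `PlaquetteWalkHoleRootFarCellRoutes` for build reasons; that leaf is the citable home of (R1) and of the route algebra.) **`J` stays `≥ 5` (squared) away from the midpoint of a dead side**: if the side `σ` of `r` is neither the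
exit nor the return side and its other face `g` lies outside the domain, every vertex of the excursion polygon is
at squared distance `≥ 5` from `midPt (r.side σ)` (the vertices are inner points of excursion faces — in `D`,
not `r`, hence not faces of that edge — or the two chord ends `innerPt r z₁`, `innerPt r z₂`).
[cite: Glazman2015WeightedSAW, Lemma 3.1 (proof: the winding of the grouped walks)] -/
private theorem five_le_distSq_pJpt_midPt_deadFR (h : ω.IsB2a) {σ : Side} (hσ1 : σ ≠ ω.z1 hr h) (hσ2 : σ ≠ ω.1)
    {g : Face} (hg : g ∉ D) (hgr : g ≠ r) {s : Side} (hgs : g.side s = r.side σ) {k : ℕ} (hk : k ≤ 2 * ω.Mv) :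
    5 ≤ ((ω.pJpt hr h k).1 - (midPt (r.side σ)).1) ^ 2 + ((ω.pJpt hr h k).2 - (midPt (r.side σ)).2) ^ 2 := by
  -- the two faces of the edge `r.side σ` are `r` and `g`
  have faces_of_edge : ∀ f : Face, (∃ t, f.side t = r.side σ) → f = r ∨ f = g := by
    intro f hf
    have hr' := (Face.exists_side_eq_iff r (r.side σ)).1 ⟨σ, rfl⟩
    have hg' := (Face.exists_side_eq_iff g (r.side σ)).1 ⟨s, hgs⟩
    have hf' := (Face.exists_side_eq_iff f (r.side σ)).1 hf
    rcases hf' with e | e <;> rcases hr' with e1 | e1 <;> rcases hg' with e2 | e2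
    all_goals first
      | exact Or.inl (e.trans e1.symm)
      | exact Or.inr (e.trans e2.symm)
      | exact absurd (e1.trans e2.symm) hgr.symm
  rcases pJpt_cases' (ω := ω) (hr := hr) h hk with ⟨i, hi1, hi2, e | e⟩ | e | e
  · rw [e]
    refine five_le_distSq_innerPt_midPt_of_neFR fun hh => ?_
    have hD := (YBWalk.arcFace_arcAt (γ := ω.2) hi2).2
    rcases faces_of_edge _ ⟨_, hh⟩ with e1 | e1
    · exact YBWalk.arcFace_ne_of_excursionG (γ := ω.2) hr h.1 hi1 (by rw [h.2]; exact hi2)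
        (by rw [ω.2.arcFace_nth_eq_some_fcFR hi2, e1])
    · exact hg (e1 ▸ hD)
  · rw [e]
    refine five_le_distSq_innerPt_midPt_of_neFR fun hh => ?_
    have hD := (YBWalk.arcFace_arcAt (γ := ω.2) hi2).2
    rcases faces_of_edge _ ⟨_, hh⟩ with e1 | e1
    · exact YBWalk.arcFace_ne_of_excursionG (γ := ω.2) hr h.1 hi1 (by rw [h.2]; exact hi2)
        (by rw [ω.2.arcFace_nth_eq_some_fcFR hi2, e1])
    · exact hg (e1 ▸ hD)
  · rw [e]; exact five_le_distSq_innerPt_midPt_of_neFR fun hh => hσ1 (Face.side_injective r hh).symm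
  · rw [e]; exact five_le_distSq_innerPt_midPt_of_neFR fun hh => hσ2 (Face.side_injective r hh).symm

/-- (Duplicated from `PlaquetteWalkHoleRootFarCellRoutes` for build reasons; that leaf is the citable home of (R1) and of the route algebra.) **Transport from the midpoint of a dead side to the centre of the exterior face behind it.**
[cite: Glazman2015WeightedSAW, Lemma 3.1 (proof: the winding of the grouped walks)] -/
private theorem AJ_midPt_dead_eq_AJ_ctrFR (h : ω.IsB2a) {σ : Side} (hσ1 : σ ≠ ω.z1 hr h) (hσ2 : σ ≠ ω.1)
    {g : Face} (hg : g ∉ D) {s : Side} (hgs : g.side s = r.side σ) :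
    ω.AJ hr h (toC (midPt (r.side σ))) = ω.AJ hr h (toC (Face.ctr g)) := by
  have hgr : g ≠ r := fun e => hg (e ▸ hr.mem)
  refine AJ_eq_AJ_of_sdot (ω := ω) (hr := hr) h _ _ (fun k hk => ?_) (fun k hk => ?_) (fun k hk => ?_)
  · exact sdot_pJpt_of_far (ω := ω) (hr := hr) h _
      (fun k' hk' => five_le_distSq_pJpt_midPt_deadFR hr h hσ1 hσ2 hg hgr hgs hk') hk
  · exact sdot_pJpt_of_far (ω := ω) (hr := hr) h _
      (fun k' hk' => le_trans (by norm_num) (far_ctr (ω := ω) (hr := hr) h hg hk')) hk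
  · have hz := sdot_midPt_ctr_pos g s (far_ctr (ω := ω) (hr := hr) h hg hk) (far_midPt (ω := ω) (hr := hr) h (g.side s) hk)
    rw [hgs] at hz
    exact hz

/-- (Duplicated from `PlaquetteWalkHoleRootFarCellRoutes` for build reasons; that leaf is the citable home of (R1) and of the route algebra.) The winding of `J` at the midpoint of the first side equals its winding at the root (the parent file's
transport along the prefix, in `midPt` form). [cite: Glazman2015WeightedSAW, Lemma 3.1 (proof: the winding of the grouped walks)] -/
private theorem AJ_midPt_firstSide_eq_AJ_rootFR (h : ω.IsB2a) :
    ω.AJ hr h (toC (midPt (r.side ω.2.firstSideG))) = ω.AJ hr h (toC (midPt a)) := by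
  rw [← ω.AJ_qQ_zero_eq_AJ_root (hr := hr) (h := h), ΩG.qQ, ω.Qp_zero (hr := hr) h, midPt_side]

/-- (Duplicated from `PlaquetteWalkHoleRootFarCellRoutes` for build reasons; that leaf is the citable home of (R1) and of the route algebra.) ★★ **The chord rule at a plaquette adjacent to the root's hole.** If the dead side `σ` of `r` (neither exit
nor return side) is a side of an exterior face `g ∉ D` that also carries the root `a`, then for every WOUND walk of
class `B2a` at `r` the first side `z₀` and the dead side `σ` lie on the same side of the chord:
`chordSign(z₀; z₁, z₂) = chordSign(σ; z₁, z₂)`. [cite: GlazmanManolescu2019, Lemma 2.1 (proof: [Gl])]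
[cite: Glazman2015WeightedSAW, Lemma 3.1 (proof, pp. 6–7: the classes of walks through a rhombus)]
[cite: DuminilCopinSmirnov2012, proof of Lemma 1 (the winding bookkeeping)] -/
private theorem chordSign_firstSide_eq_chordSign_deadFR (h : ω.IsB2a) {σ : Side} (hσ1 : σ ≠ ω.z1 hr h) (hσ2 : σ ≠ ω.1)
    {g : Face} (hg : g ∉ D) {s s' : Side} (hgs : g.side s = r.side σ) (hga : g.side s' = a)
    (hw : ω.AJ hr h (toC (midPt a)) ≠ 0) :
    chordSign ω.2.firstSideG (ω.z1 hr h) ω.1 = chordSign σ (ω.z1 hr h) ω.1 := by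
  have hd := ω.2.sides_distinctG hr h.1
  rw [ω.returnSide_of_isB2a h] at hd
  have hz01 : ω.2.firstSideG ≠ ω.z1 hr h := by unfold ΩG.z1; exact fun e => hd.1 e.symm
  have hz02 : ω.2.firstSideG ≠ ω.1 := fun e => hd.2.1 e.symm
  -- the winding at the first side is the winding at the root
  have h0 := ω.AJ_midPt_firstSide_eq_AJ_rootFR hr h
  -- the winding at the dead side is the winding at the root (through `g`)
  have hσ := (ω.AJ_midPt_dead_eq_AJ_ctrFR hr h hσ1 hσ2 hg hgs).trans (ω.AJ_root_eq_AJ_ctr (hr := hr) h hg hga).symm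
  -- the sign rule at both midpoints
  rcases ω.AJ_midPt_side_eq (hr := hr) h hz01 hz02 with e0 | e0
  · exact absurd (h0 ▸ e0) hw
  rcases ω.AJ_midPt_side_eq (hr := hr) h hσ1 hσ2 with e1 | e1
  · exact absurd (hσ ▸ e1) hw
  have key : (2 * Real.pi * (chordSign ω.2.firstSideG (ω.z1 hr h) ω.1 : ℝ)) =
      2 * Real.pi * (chordSign σ (ω.z1 hr h) ω.1 : ℝ) := by
    rw [← e0, ← e1, h0, hσ]
  have h2 : (2 * Real.pi : ℝ) ≠ 0 := mul_ne_zero two_ne_zero Real.pi_ne_zero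
  exact_mod_cast mul_left_cancel₀ h2 key

/-- (Duplicated from `PlaquetteWalkHoleRootFarCellRoutes` for build reasons; that leaf is the citable home of (R1) and of the route algebra.) Opposite sides lie on opposite sides of the chord joining the inner points of the two remaining sides.
[cite: GlazmanManolescu2019, §1 (the lattice of rhombi and its mid-edges)] -/
private theorem chordSign_opp_neFR : ∀ σ z₁ z₂ : Side, z₁ ≠ σ → z₁ ≠ σ.opp → z₂ ≠ σ → z₂ ≠ σ.opp → z₁ ≠ z₂ →
    chordSign σ.opp z₁ z₂ ≠ chordSign σ z₁ z₂ := by decide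

/-- (Duplicated from `PlaquetteWalkHoleRootFarCellRoutes` for build reasons; that leaf is the citable home of (R1) and of the route algebra.) ★★ **No wound excursion after a far-side entry**: in the situation of the chord rule the walk did not first
reach `r` through the side opposite to the dead side. At the far cell of a hole root (dead side towards the hole)
this is the lane's rigidity (R1): a wound class-`B2a` walk enters the far cell from a lateral side, never from
the far side. [cite: GlazmanManolescu2019, Lemma 2.1 (proof: [Gl])]
[cite: Glazman2015WeightedSAW, Lemma 3.1 (proof, pp. 6–7: the classes of walks through a rhombus)] -/
private theorem firstSide_ne_opp_of_woundFR (h : ω.IsB2a) {σ : Side} (hσ1 : σ ≠ ω.z1 hr h) (hσ2 : σ ≠ ω.1)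
    {g : Face} (hg : g ∉ D) {s s' : Side} (hgs : g.side s = r.side σ) (hga : g.side s' = a)
    (hw : ω.AJ hr h (toC (midPt a)) ≠ 0) : ω.2.firstSideG ≠ σ.opp := by
  intro hopp
  have hd := ω.2.sides_distinctG hr h.1
  rw [ω.returnSide_of_isB2a h] at hd
  have hz1 : ω.z1 hr h ≠ σ.opp := by unfold ΩG.z1; rw [← hopp]; exact hd.1
  have hz2 : ω.1 ≠ σ.opp := by rw [← hopp]; exact hd.2.1
  have hz12 : ω.z1 hr h ≠ ω.1 := by unfold ΩG.z1; exact fun e => hd.2.2 e.symm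
  have key := ω.chordSign_firstSide_eq_chordSign_deadFR hr h hσ1 hσ2 hg hgs hga hw
  rw [hopp] at key
  exact chordSign_opp_neFR σ (ω.z1 hr h) ω.1 (Ne.symm hσ1) hz1 (Ne.symm hσ2) hz2 hz12 key

/-- (Duplicated from `PlaquetteWalkHoleRootFarCellRoutes` for build reasons; that leaf is the citable home of (R1) and of the route algebra.) Two distinct faces of the domain with a common side make that side a door (both its faces in `D`).
[cite: GlazmanManolescu2019, §1 (the lattice of rhombi and its mid-edges)] -/
private theorem door_of_two_facesFR {e : MidEdge} {f f' : Face} (hf : ∃ s, f.side s = e) (hf' : ∃ s, f'.side s = e)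
    (hne : f ≠ f') (hD : f ∈ D) (hD' : f' ∈ D) : e.faces.1 ∈ D ∧ e.faces.2 ∈ D := by
  rcases (Face.exists_side_eq_iff f e).1 hf with h1 | h1 <;> rcases (Face.exists_side_eq_iff f' e).1 hf' with h2 | h2
  · exact absurd (h1.trans h2.symm) hne
  · exact ⟨h1 ▸ hD, h2 ▸ hD'⟩
  · exact ⟨h2 ▸ hD', h1 ▸ hD⟩
  · exact absurd (h1.trans h2.symm) hne

/-- (Duplicated from `PlaquetteWalkHoleRootFarCellRoutes` for build reasons; that leaf is the citable home of (R1) and of the route algebra.) ★ **The first side is never the dead side** (unless the root itself is a side of `r`): the first hit of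
`∂r` by a class-`B2a` walk is a crossed mid-edge — the exit of the previous arc (in a face of `D` other than `r`)
and the entry of the arc inside `r` — hence a door, whereas the dead side `σ` has the exterior face `g ∉ D`
behind it. [cite: Glazman2015WeightedSAW, Lemma 3.1 (proof, pp. 6–7: the classes of walks through a rhombus)] -/
private theorem firstSide_ne_deadFR (hr : RootedFace D a r) (h : ω.IsB2a) {σ : Side} {g : Face} (hg : g ∉ D) {s : Side}
    (hgs : g.side s = r.side σ) (hra : ∀ t : Side, r.side t ≠ a) : ω.2.firstSideG ≠ σ := by
  intro hz
  set γ := ω.2 with hγ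
  have hfh : γ.firstHitG < γ.arcs.length := ω.fh_lt h
  have hnth := γ.nth_firstHitG
  rw [hz] at hnth
  rcases Nat.eq_zero_or_pos γ.firstHitG with h0 | hpos
  · rw [h0, γ.nth_zero] at hnth
    exact hra σ hnth.symm
  · -- the arc before the first hit lies in a face of `D` other than `r`, the arc at the first hit in `r`
    have hl := γ.length_eq
    obtain ⟨-, hout, -⟩ := YBWalk.side_sIn (γ := γ) (i := γ.firstHitG - 1) (by omega)
    rw [← γ.nth_eq_getElem (by omega), show γ.firstHitG - 1 + 1 = γ.firstHitG by omega, hnth] at hout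
    have hDprev := (YBWalk.arcFace_arcAt (γ := γ) (i := γ.firstHitG - 1) (by omega)).2
    have hne : γ.fc (γ.firstHitG - 1) ≠ r := by
      intro e
      have h1 := γ.arcFace_nth_eq_some_fcFR (i := γ.firstHitG - 1) (by omega)
      rw [e] at h1
      exact YBWalk.arcFace_ne_of_lt_firstHitG (γ := γ) (i := γ.firstHitG - 1) (by omega) (by omega) h1
    have hdoor := door_of_two_facesFR (D := D) ⟨_, hout⟩ ⟨σ, rfl⟩ hne hDprev hr.mem
    -- but `g ∉ D` is a face of that edge
    rcases (Face.exists_side_eq_iff g (r.side σ)).1 ⟨s, hgs⟩ with e | e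
    · exact hg (e ▸ hdoor.1)
    · exact hg (e ▸ hdoor.2)

/-- (Duplicated from `PlaquetteWalkHoleRootFarCellRoutes` for build reasons; that leaf is the citable home of (R1) and of the route algebra.) ★★ **At a hole-adjacent plaquette a wound excursion belongs to a walk that entered through a LATERAL side**:
the first side is neither the dead side nor the side opposite to it. (At the far cell of a hole root: `z₀ ∈ {N, S}`
in the `W`-root normalisation — the lane's two routes, over and under the hole.)
[cite: GlazmanManolescu2019, Lemma 2.1 (proof: [Gl])] [cite: Glazman2015WeightedSAW, Lemma 3.1 (proof, pp. 6–7)] -/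
private theorem firstSide_lateral_of_woundFR (h : ω.IsB2a) {σ : Side} (hσ1 : σ ≠ ω.z1 hr h) (hσ2 : σ ≠ ω.1)
    {g : Face} (hg : g ∉ D) {s s' : Side} (hgs : g.side s = r.side σ) (hga : g.side s' = a)
    (hra : ∀ t : Side, r.side t ≠ a) (hw : ω.AJ hr h (toC (midPt a)) ≠ 0) :
    ω.2.firstSideG ≠ σ ∧ ω.2.firstSideG ≠ σ.opp :=
  ⟨ω.firstSide_ne_deadFR hr h hg hgs hra, ω.firstSide_ne_opp_of_woundFR hr h hσ1 hσ2 hg hgs hga hw⟩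

end ΩG

end Literature.Probability.RandomPlanarGeometry.SAW.YangBaxter

end

noncomputable section

namespace Literature.Probability.RandomPlanarGeometry.SAW.YangBaxter

open Real Complex

namespace ΩG

variable {D : Set Face} {a : MidEdge} {r : Face}

/-- `sin((5/8)·4π ε) = ε` for a chord sign `ε = ±1`. [folklore] -/
private theorem sin_five_eighths_four_pi_chordSign' (σ z₁ z₂ : Side) :
    Real.sin (5 / 8 * (4 * π * chordSign σ z₁ z₂)) = chordSign σ z₁ z₂ := by
  rcases chordSign_eq_or σ z₁ z₂ with e | e <;> rw [e] <;> push_cast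
  · rw [show (5 : ℝ) / 8 * (4 * π * 1) = π / 2 + 2 * π by ring, Real.sin_add_two_pi, Real.sin_pi_div_two]
  · rw [show (5 : ℝ) / 8 * (4 * π * -1) = -(π / 2 + 2 * π) by ring, Real.sin_neg, Real.sin_add_two_pi,
      Real.sin_pi_div_two]

/-- The three sides of a class-`B2a` walk (first side `z₀`, exit side `z₁`, return side `z₂`) are pairwise
distinct, in the order needed below. [cite: Glazman2015WeightedSAW, Lemma 3.1 (proof, pp. 6–7: the classes of walks through a rhombus)] -/
theorem firstSide_exit_return_distinct (ω : ΩG D a r) (hr : RootedFace D a r) (h : ω.IsB2a) :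
    ω.2.firstSideG ≠ ω.z1 hr h ∧ ω.2.firstSideG ≠ ω.1 ∧ ω.z1 hr h ≠ ω.1 := by
  have hd := ω.2.sides_distinctG hr h.1
  rw [ω.returnSide_of_isB2a h] at hd
  unfold ΩG.z1
  exact ⟨fun e => hd.1 e.symm, fun e => hd.2.1 e.symm, fun e => hd.2.2 e.symm⟩

/-- ★★ **The winding law seen from the first side, with the sign rule.** For every class-`B2a` walk at ANY rooted
rhombus `r` (first side `z₀`, exit `z₁`, return `z₂`) there is a real number `A` — the swept angle of the excursion
polygon at the midpoint of the root, for the walk itself (canonical orientation) or minus that of its reversed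
companion — with `WE − excursionWinding(θ; z₀, z₁, z₂) = 2A` and `A ∈ {0, 2π·chordSign(z₀; z₁, z₂)}`: the polygon's
swept angle is one number at the root and at the midpoint of the first side (transport along the prefix,
`ΩG.AJ_midPt_firstSide_eq_AJ_root`), where the sign rule `ΩG.AJ_midPt_side_eq` evaluates it.
[cite: GlazmanManolescu2019, Lemma 2.1 (statement, "in the form given in [Gl]")] [cite: Glazman2015WeightedSAW, Lemma 3.1 (proof, pp. 6–7: the classes of walks through a rhombus)]
[cite: DuminilCopinSmirnov2012, proof of Lemma 1 (the winding bookkeeping)] -/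
theorem WE_sub_excursionWinding_eq_two_mul (ω : ΩG D a r) (hr : RootedFace D a r) (h : ω.IsB2a) (θ : ℝ) :
    ∃ A : ℝ, (A = ω.AJ hr h (toC (midPt a)) ∨ A = -(ω.rev hr).AJ hr (ω.rev_isB2a hr h) (toC (midPt a))) ∧
      ω.WE (fun _ => θ) - excursionWinding θ ω.2.firstSideG (ω.z1 hr h) ω.1 = 2 * A ∧
      (A = 0 ∨ A = 2 * π * chordSign ω.2.firstSideG (ω.z1 hr h) ω.1) := by
  obtain ⟨hz01, hz02, hz12⟩ := ω.firstSide_exit_return_distinct hr h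
  rcases canon_or_swap hz01 hz02 hz12 with hc | hc
  · -- canonical orientation: `WE = excursionWinding + 2·AJ`
    have e : ω.WE (fun _ => θ) = excursionWinding θ ω.2.firstSideG (ω.z1 hr h) ω.1 + 2 * ω.AJ hr h (toC (midPt a)) :=
      ω.WE_eq_excursionWinding_add_two_AJ hr hc (fun _ => θ)
    have ht := ω.AJ_midPt_firstSide_eq_AJ_rootFR hr h
    refine ⟨ω.AJ hr h (toC (midPt a)), Or.inl rfl, by rw [e]; ring, ?_⟩
    rcases ω.AJ_midPt_side_eq (hr := hr) h hz01 hz02 with hA | hA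
    · exact Or.inl (ht ▸ hA)
    · exact Or.inr (ht ▸ hA)
  · -- swapped orientation: the reversed companion is canonical, `WE = excursionWinding − 2·AJ_rev`
    have h'' := ω.rev_isB2a hr h
    have hz1 : (ω.rev hr).z1 hr h'' = ω.1 := by unfold ΩG.z1; exact ω.rev_exitSide hr h
    have hfst : (ω.rev hr).1 = ω.z1 hr h := ω.rev_fst hr h
    have hfs : (ω.rev hr).2.firstSideG = ω.2.firstSideG := ω.rev_firstSide hr h
    have hc' : Canon (ω.rev hr).2.firstSideG ((ω.rev hr).z1 hr h'') (ω.rev hr).1 := by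
      rw [hfs, hz1, hfst]; exact hc
    have e : ω.WE (fun _ => θ) = excursionWinding θ ω.2.firstSideG (ω.z1 hr h) ω.1 -
        2 * (ω.rev hr).AJ hr h'' (toC (midPt a)) :=
      ω.WE_eq_excursionWinding_sub_two_AJ_rev hr (h := h) hc' (fun _ => θ)
    have ht := (ω.rev hr).AJ_midPt_firstSide_eq_AJ_rootFR hr h''
    rw [hfs] at ht
    refine ⟨-(ω.rev hr).AJ hr h'' (toC (midPt a)), Or.inr rfl, by rw [e]; ring, ?_⟩
    rcases (ω.rev hr).AJ_midPt_side_eq (hr := hr) h'' (σ := ω.2.firstSideG) (by rw [hz1]; exact hz02)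
        (by rw [hfst]; exact hz01) with hA | hA
    · left; rw [← ht, hA, neg_zero]
    · right
      rw [hz1, hfst, chordSign_swap _ _ _ hz01 hz02 hz12] at hA
      rw [← ht, hA]; push_cast; ring

/-- ★★ **THE SIGN LAW AT AN ARBITRARY PLAQUETTE.** For a class-`B2a` walk at any rooted rhombus (first side `z₀`,
exit `z₁`, return `z₂`): EITHER `WE = excursionWinding(θ; z₀, z₁, z₂)` (the group sign
`sin((5/8)(WE − excursionWinding))` is `0`: unwound) OR `WE − excursionWinding = 4π·ε(z₀; z₁, z₂)` and the group
sign equals the chord sign `ε(z₀; z₁, z₂)` (wound). The tree's `sign_law_root` is the case of the root's own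
plaquette (`z₀ = σ`, empty prefix). [cite: GlazmanManolescu2019, Lemma 2.1 (statement, "in the form given in [Gl]")]
[cite: Glazman2015WeightedSAW, Lemma 3.1 (proof, pp. 6–7: the classes of walks through a rhombus)]
[cite: DuminilCopinSmirnov2012, proof of Lemma 1 (the winding bookkeeping)] -/
theorem sign_law (ω : ΩG D a r) (hr : RootedFace D a r) (h : ω.IsB2a) (θ : ℝ) :
    (ω.WE (fun _ => θ) = excursionWinding θ ω.2.firstSideG (ω.z1 hr h) ω.1 ∧
        Real.sin (5 / 8 * (ω.WE (fun _ => θ) - excursionWinding θ ω.2.firstSideG (ω.z1 hr h) ω.1)) = 0) ∨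
      (ω.WE (fun _ => θ) - excursionWinding θ ω.2.firstSideG (ω.z1 hr h) ω.1 =
          4 * π * chordSign ω.2.firstSideG (ω.z1 hr h) ω.1 ∧
        Real.sin (5 / 8 * (ω.WE (fun _ => θ) - excursionWinding θ ω.2.firstSideG (ω.z1 hr h) ω.1)) =
          chordSign ω.2.firstSideG (ω.z1 hr h) ω.1) := by
  obtain ⟨A, -, hWE, hA | hA⟩ := ω.WE_sub_excursionWinding_eq_two_mul hr h θ
  · left
    have e : ω.WE (fun _ => θ) = excursionWinding θ ω.2.firstSideG (ω.z1 hr h) ω.1 := by linarith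
    exact ⟨e, by rw [e, sub_self, mul_zero, Real.sin_zero]⟩
  · right
    have e : ω.WE (fun _ => θ) - excursionWinding θ ω.2.firstSideG (ω.z1 hr h) ω.1 =
        4 * π * chordSign ω.2.firstSideG (ω.z1 hr h) ω.1 := by rw [hWE, hA]; ring
    exact ⟨e, by rw [e, sin_five_eighths_four_pi_chordSign']⟩

/-- ★ **A wound walk has a wound orientation witness**: if the group sign of a class-`B2a` walk is not `0`, then its
excursion polygon, or that of its reversed companion, has non-zero swept angle at the midpoint of the root.
[cite: GlazmanManolescu2019, Lemma 2.1 (statement, "in the form given in [Gl]")] [cite: Glazman2015WeightedSAW, Lemma 3.1 (proof, pp. 6–7)] -/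
theorem AJ_ne_zero_or_rev_of_wound (ω : ΩG D a r) (hr : RootedFace D a r) (h : ω.IsB2a) (θ : ℝ)
    (hw : ω.WE (fun _ => θ) ≠ excursionWinding θ ω.2.firstSideG (ω.z1 hr h) ω.1) :
    ω.AJ hr h (toC (midPt a)) ≠ 0 ∨ (ω.rev hr).AJ hr (ω.rev_isB2a hr h) (toC (midPt a)) ≠ 0 := by
  obtain ⟨A, hor, hWE, -⟩ := ω.WE_sub_excursionWinding_eq_two_mul hr h θ
  have hA0 : A ≠ 0 := by
    intro h0; apply hw; rw [h0, mul_zero, sub_eq_zero] at hWE; exact hWE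
  rcases hor with e | e
  · exact Or.inl (e ▸ hA0)
  · right; intro h0; apply hA0; rw [e, h0, neg_zero]

/-- **The signed class term, unfolded** (for a class-`B2a` walk). [cite: GlazmanManolescu2019, Lemma 2.1 (statement, "in the form given in [Gl]")]
[cite: Glazman2015WeightedSAW, Lemma 3.1 (proof)] -/
theorem classTerm_of_isB2a (ω : ΩG D a r) (Θ : ℤ → ℝ) (hr : RootedFace D a r) (h : ω.IsB2a) :
    ω.classTerm Θ hr = (ω.2.extWeight Θ r : ℂ) * phase (ω.WP Θ) *
      (Real.sin (5 / 8 * (ω.WE Θ - excursionWinding (Θ r.1) ω.2.firstSideG (ω.z1 hr h) ω.1)) : ℂ) *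
        backBracket (Θ r.1) ω.2.firstSideG (ω.z1 hr h) ω.1 (ω.z₃ hr h) := by
  rw [classTerm, dif_pos h]; rfl

/-- ★ **THE SIGNED CLASS TERM AT AN ARBITRARY PLAQUETTE**: for a class-`B2a` walk, either the class term vanishes
(unwound) or it equals `extWeight · phase(WP) · ε(z₀; z₁, z₂) · backBracket(θ; z₀, z₁, z₂, z₃)` (wound) — a
non-negative mass, the prefix phase, the chord sign of the FIRST side, one explicit direction.
[cite: GlazmanManolescu2019, Lemma 2.1 (statement, "in the form given in [Gl]")] [cite: Glazman2015WeightedSAW, Lemma 3.1 (proof, pp. 6–7)] -/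
theorem classTerm_dichotomy (ω : ΩG D a r) (hr : RootedFace D a r) (h : ω.IsB2a) (θ : ℝ) :
    (ω.WE (fun _ => θ) = excursionWinding θ ω.2.firstSideG (ω.z1 hr h) ω.1 ∧ ω.classTerm (fun _ => θ) hr = 0) ∨
      (ω.WE (fun _ => θ) ≠ excursionWinding θ ω.2.firstSideG (ω.z1 hr h) ω.1 ∧
        ω.classTerm (fun _ => θ) hr = (ω.2.extWeight (fun _ => θ) r : ℂ) * phase (ω.WP fun _ => θ) *
          (chordSign ω.2.firstSideG (ω.z1 hr h) ω.1 : ℂ) *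
            backBracket θ ω.2.firstSideG (ω.z1 hr h) ω.1 (ω.z₃ hr h)) := by
  rw [ω.classTerm_of_isB2a (fun _ => θ) hr h]
  rcases ω.sign_law hr h θ with ⟨hWE, hs⟩ | ⟨hWE, hs⟩
  · left; exact ⟨hWE, by rw [hs]; simp⟩
  · right
    refine ⟨fun e => ?_, by rw [hs]; norm_cast⟩
    rw [e, sub_self] at hWE
    have hπ : (4 : ℝ) * π * chordSign ω.2.firstSideG (ω.z1 hr h) ω.1 ≠ 0 := by
      rcases chordSign_eq_or ω.2.firstSideG (ω.z1 hr h) ω.1 with e' | e' <;> rw [e'] <;> push_cast <;>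
        nlinarith [Real.pi_pos]
    exact hπ hWE.symm

/-- Reversing the excursion negates the backward half-bracket (twin of the catalogue's `backBracket_swap` in
`PlaquetteWalkRootPlaquetteDefectLaw`, re-derived here to keep this leaf independent of that module).
[cite: GlazmanManolescu2019, Lemma 2.1 (statement, "in the form given in [Gl]")] [cite: Glazman2015WeightedSAW, Lemma 3.1 (proof, p. 6)] -/
private theorem backBracket_swap' (θ : ℝ) {z₀ z₁ z₂ z₃ : Side} (h01 : z₀ ≠ z₁) (h02 : z₀ ≠ z₂) (h03 : z₀ ≠ z₃)
    (h12 : z₁ ≠ z₂) (h13 : z₁ ≠ z₃) (h23 : z₂ ≠ z₃) :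
    backBracket θ z₀ z₂ z₁ z₃ = -backBracket θ z₀ z₁ z₂ z₃ := by
  have h0 := groupTwo_gen θ z₀ z₁ z₂ z₃ h01 h02 h03 h12 h13 h23
  unfold bracket at h0
  unfold backBracket
  rw [excursionWinding_swap θ z₀ z₁ z₂, sub_neg_eq_add]
  linear_combination h0

/-- **Orientation invariance of the signed direction**: `ε(z₀; z₂, z₁)·backBracket(θ; z₀, z₂, z₁, z₃) =
ε(z₀; z₁, z₂)·backBracket(θ; z₀, z₁, z₂, z₃)` — a walk and its reversed companion carry the same signed class term.
[cite: GlazmanManolescu2019, Lemma 2.1 (statement, "in the form given in [Gl]")] [cite: Glazman2015WeightedSAW, Lemma 3.1 (proof)] -/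
theorem chordSign_mul_backBracket_swap (θ : ℝ) {z₀ z₁ z₂ z₃ : Side} (h01 : z₀ ≠ z₁) (h02 : z₀ ≠ z₂) (h03 : z₀ ≠ z₃)
    (h12 : z₁ ≠ z₂) (h13 : z₁ ≠ z₃) (h23 : z₂ ≠ z₃) :
    (chordSign z₀ z₂ z₁ : ℂ) * backBracket θ z₀ z₂ z₁ z₃ = (chordSign z₀ z₁ z₂ : ℂ) * backBracket θ z₀ z₁ z₂ z₃ := by
  rw [backBracket_swap' θ h01 h02 h03 h12 h13 h23, chordSign_swap _ _ _ h01 h02 h12]; push_cast; ring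

end ΩG

end Literature.Probability.RandomPlanarGeometry.SAW.YangBaxter


namespace Literature.Probability.RandomPlanarGeometry.SAW.YangBaxter

open Real Complex

/-! ## Doors: the exit and return sides of a class-`B2a` walk are interior edges -/

namespace ΩG

variable {D : Set Face} {a : MidEdge} {r : Face}

/-- **The exit side and the return side of a class-`B2a` walk are doors** (both faces of those mid-edges lie in the
domain): the arc after the exit and the arc before the return lie in faces of `D` other than `r`.
[cite: Glazman2015WeightedSAW, Lemma 3.1 (proof, pp. 6–7: the classes of walks through a rhombus)] -/
theorem exit_return_doors (ω : ΩG D a r) (hr : RootedFace D a r) (h : ω.IsB2a) :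
    ((r.side (ω.z1 hr h)).faces.1 ∈ D ∧ (r.side (ω.z1 hr h)).faces.2 ∈ D) ∧
      ((r.side ω.1).faces.1 ∈ D ∧ (r.side ω.1).faces.2 ∈ D) := by
  have hB2 : ω.2.firstHitG + 1 < ω.2.arcs.length := h.1
  have hret : ω.2.returnHitG hB2 = ω.2.arcs.length := h.2
  have h3 := ω.2.firstHit_add_three_le_returnHitG hr hB2
  -- an arc of the domain through `r.side z` in a plaquette other than `r` makes `r.side z` an interior edge
  have door : ∀ {i : ℕ} {z : Side} (hi : i < ω.2.arcs.length),
      (ω.2.nth i = r.side z ∨ ω.2.nth (i + 1) = r.side z) → arcFace (ω.2.nth i, ω.2.nth (i + 1)) ≠ some r →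
      ((r.side z).faces.1 ∈ D ∧ (r.side z).faces.2 ∈ D) := by
    intro i z hi hz hne
    obtain ⟨f, hfD, hf⟩ := ω.2.arc_nth hi
    obtain ⟨-, h1, h2⟩ := MidEdge.commonFace_eq_some hf
    have hfr : f ≠ r := fun e => hne (e ▸ hf)
    have hf' : f = (r.side z).faces.1 ∨ f = (r.side z).faces.2 := by
      rcases hz with hz | hz
      · rw [← hz]; exact h1
      · rw [← hz]; exact h2
    have hr' : r = (r.side z).faces.1 ∨ r = (r.side z).faces.2 := (Face.exists_side_eq_iff r (r.side z)).1 ⟨z, rfl⟩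
    rcases hf' with e | e <;> rcases hr' with e' | e'
    · exact absurd (e.trans e'.symm) hfr
    · exact ⟨e ▸ hfD, e' ▸ hr.1⟩
    · exact ⟨e' ▸ hr.1, e ▸ hfD⟩
    · exact absurd (e.trans e'.symm) hfr
  refine ⟨?_, ?_⟩
  · exact door (i := ω.2.firstHitG + 1) (by omega) (Or.inl (ω.2.exitSide_specG hr (by omega)).1)
      (ω.2.arcFace_ne_of_excursionG hr hB2 (by omega) (by rw [hret]; omega))
  · exact door (i := ω.2.arcs.length - 1) (by omega)
      (Or.inr (by rw [show ω.2.arcs.length - 1 + 1 = ω.2.arcs.length from by omega, ω.2.nth_length]))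
      (ω.2.arcFace_ne_of_excursionG hr hB2 (i := ω.2.arcs.length - 1) (by omega) (by rw [hret]; omega))

end ΩG

/-! ## The far cell of a hole root — `W`-root frame

The root plaquette `w`, the root `a = w.side W` (a vertical mid-edge; the walk starts eastwards), the hole
`h = (w.1 - 1, w.2) ∉ D` behind the root, and the FAR CELL `f = (w.1 - 2, w.2) ∈ D` across the hole: its side `E`
(= `h.side W`) is dead, its first sides for wound walks are the LATERAL sides `N`, `S` (the tree's rigidity (R1)),
and — the lane's rigidity (R2), HYPOTHESIS `FarCellTurningW` below — the prefix of a wound walk turns by `π + θ`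
if it enters from `N` (over the hole) and by `θ − 2π` if it enters from `S` (under it). -/

/-- The hole face behind the root `w.side W`. [cite: GlazmanManolescu2019, §1 (the lattice of rhombi and its mid-edges)] -/
def holeFaceW (w : Face) : Face := (w.1 - 1, w.2)

/-- The far cell of the root `w.side W`: the face across the hole from the root plaquette.
[cite: GlazmanManolescu2019, §1 (the lattice of rhombi and its mid-edges)] -/
def farW (w : Face) : Face := (w.1 - 2, w.2)

/-- The root is the `E` side of the hole. [cite: GlazmanManolescu2019, §1 (the lattice of rhombi and its mid-edges)] -/
theorem holeFaceW_side_E (w : Face) : (holeFaceW w).side .E = w.side .W := by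
  obtain ⟨k, j⟩ := w; simp [holeFaceW, Face.side]

/-- The dead side of the far cell is the `W` side of the hole. [cite: GlazmanManolescu2019, §1 (the lattice of rhombi and its mid-edges)] -/
theorem holeFaceW_side_W (w : Face) : (holeFaceW w).side .W = (farW w).side .E := by
  obtain ⟨k, j⟩ := w; simp [holeFaceW, farW, Face.side]; ring

/-- The root is not a side of the far cell. [cite: GlazmanManolescu2019, §1 (the lattice of rhombi and its mid-edges)] -/
theorem farW_side_ne_root (w : Face) (t : Side) : (farW w).side t ≠ w.side .W := by
  obtain ⟨k, j⟩ := w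
  intro h
  cases t <;> simp only [farW, Face.side, MidEdge.vert.injEq, reduceCtorEq] at h <;> omega

/-- The two faces of the dead side of the far cell are the far cell and the hole.
[cite: GlazmanManolescu2019, §1 (the lattice of rhombi and its mid-edges)] -/
theorem farW_side_E_faces (w : Face) : ((farW w).side .E).faces = (farW w, holeFaceW w) := by
  obtain ⟨k, j⟩ := w
  simp [farW, holeFaceW, Face.side, MidEdge.faces]
  omega

/-- The two faces of the root are the hole and the root plaquette.
[cite: GlazmanManolescu2019, §1 (the lattice of rhombi and its mid-edges)] -/
theorem root_faces_W (w : Face) : (w.side .W).faces = (holeFaceW w, w) := by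
  obtain ⟨k, j⟩ := w; simp [holeFaceW, Face.side, MidEdge.faces]

/-- The far cell seen from the hole root is a rooted face as soon as it lies in the domain and the hole does not.
[cite: GlazmanManolescu2019, §2.1 (walks start on the boundary of the domain)] -/
theorem rootedFace_farW {D : Set Face} {w : Face} (hf : farW w ∈ D) (hh : holeFaceW w ∉ D) :
    RootedFace D (w.side .W) (farW w) :=
  ⟨hf, fun hb => hh (by rw [root_faces_W] at hb; exact hb.1)⟩

section Algebra

/-- ★ **The far-cell algebra, entry from `N`** (over the hole): with the turning `π + θ`, for both orders of the exit
and return sides `{z₁, z₂} = {W, S}` (fourth side `E`), `phase(π + θ)·ε(N; z₁, z₂)·backBracket(θ; N, z₁, z₂, E) =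
+v(θ)` (the tree's `phase_over_mul_backBracket_N_W_S_E`, the chord-sign table and orientation invariance).
[cite: Glazman2015WeightedSAW, Lemma 3.1, eq. (1) (the weight v(θ))] [cite: GlazmanManolescu2019, Lemma 2.1 (proof: [Gl])] -/
theorem farCellW_termN (θ : ℝ) {z₁ z₂ z₃ : Side} (h1N : Side.N ≠ z₁) (h2N : Side.N ≠ z₂) (h12 : z₁ ≠ z₂)
    (h1E : z₁ ≠ .E) (h2E : z₂ ≠ .E) (h3 : z₃ ≠ .N ∧ z₃ ≠ z₁ ∧ z₃ ≠ z₂) :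
    phase (π + θ) * ((chordSign .N z₁ z₂ : ℂ) * backBracket θ .N z₁ z₂ z₃) = (weightV θ : ℂ) := by
  obtain ⟨h3a, h3b, h3c⟩ := h3
  obtain rfl | rfl : z₁ = .W ∨ z₁ = .S := by
    revert h1N h1E; cases z₁ <;> simp
  · obtain rfl : z₂ = .S := by revert h2N h2E h12; cases z₂ <;> simp
    obtain rfl : z₃ = .E := by revert h3a h3b h3c; cases z₃ <;> simp
    rw [show (chordSign .N .W .S : ℤ) = -1 by decide]; push_cast
    rw [show phase (π + θ) * ((-1 : ℂ) * backBracket θ .N .W .S .E) = -(phase (π + θ) * backBracket θ .N .W .S .E) by ring,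
      phase_over_mul_backBracket_N_W_S_EFR, neg_neg]
  · obtain rfl : z₂ = .W := by revert h2N h2E h12; cases z₂ <;> simp
    obtain rfl : z₃ = .E := by revert h3a h3b h3c; cases z₃ <;> simp
    rw [ΩG.chordSign_mul_backBracket_swap θ (z₀ := .N) (z₁ := .W) (z₂ := .S) (z₃ := .E) (by decide) (by decide)
      (by decide) (by decide) (by decide) (by decide), show (chordSign .N .W .S : ℤ) = -1 by decide]
    push_cast
    rw [show phase (π + θ) * ((-1 : ℂ) * backBracket θ .N .W .S .E) = -(phase (π + θ) * backBracket θ .N .W .S .E) by ring,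
      phase_over_mul_backBracket_N_W_S_EFR, neg_neg]

/-- ★ **The far-cell algebra, entry from `S`** (under the hole): with the turning `θ − 2π`, for both orders of the exit
and return sides `{z₁, z₂} = {W, N}`, `phase(θ − 2π)·ε(S; z₁, z₂)·backBracket(θ; S, z₁, z₂, E) = −v(θ)`.
[cite: Glazman2015WeightedSAW, Lemma 3.1, eq. (1) (the weight v(θ))] [cite: GlazmanManolescu2019, Lemma 2.1 (proof: [Gl])] -/
theorem farCellW_termS (θ : ℝ) {z₁ z₂ z₃ : Side} (h1S : Side.S ≠ z₁) (h2S : Side.S ≠ z₂) (h12 : z₁ ≠ z₂)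
    (h1E : z₁ ≠ .E) (h2E : z₂ ≠ .E) (h3 : z₃ ≠ .S ∧ z₃ ≠ z₁ ∧ z₃ ≠ z₂) :
    phase (θ - 2 * π) * ((chordSign .S z₁ z₂ : ℂ) * backBracket θ .S z₁ z₂ z₃) = -(weightV θ : ℂ) := by
  obtain ⟨h3a, h3b, h3c⟩ := h3
  obtain rfl | rfl : z₁ = .W ∨ z₁ = .N := by
    revert h1S h1E; cases z₁ <;> simp
  · obtain rfl : z₂ = .N := by revert h2S h2E h12; cases z₂ <;> simp
    obtain rfl : z₃ = .E := by revert h3a h3b h3c; cases z₃ <;> simp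
    rw [show (chordSign .S .W .N : ℤ) = 1 by decide]; push_cast
    rw [one_mul, phase_under_mul_backBracket_S_W_N_EFR]
  · obtain rfl : z₂ = .W := by revert h2S h2E h12; cases z₂ <;> simp
    obtain rfl : z₃ = .E := by revert h3a h3b h3c; cases z₃ <;> simp
    rw [ΩG.chordSign_mul_backBracket_swap θ (z₀ := .S) (z₁ := .W) (z₂ := .N) (z₃ := .E) (by decide) (by decide)
      (by decide) (by decide) (by decide) (by decide), show (chordSign .S .W .N : ℤ) = 1 by decide]
    push_cast
    rw [one_mul, phase_under_mul_backBracket_S_W_N_EFR]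

end Algebra

/-- On the OPEN range every local weight of a walk is positive (twin of the catalogue's
`YBWalk.localWeight_kindsIn_pos` in `PlaquetteWalkRootPlaquetteDefectLaw`, re-derived to keep this leaf independent of
that module). [cite: GlazmanManolescu2019, §1, eq. (1) and Fig. 1] -/
private theorem YBWalk.localWeight_kindsIn_pos' {θ : ℝ} (hθ : θ ∈ Set.Ioo (π / 3) (2 * π / 3)) {D : Set Face}
    {a z : MidEdge} (γ : YBWalk D a z) (f : Face) : 0 < localWeight θ (γ.kindsIn f) := by
  have hθ' : θ ∈ Set.Ioo 0 π := ⟨by linarith [hθ.1, Real.pi_pos], by linarith [hθ.2, Real.pi_pos]⟩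
  have e : γ.kindsIn f = Literature.Barriers.CriticalPhenomena.PlaquetteWalk.kindsL γ.mids f := rfl
  rw [e]
  rcases Literature.Barriers.CriticalPhenomena.PlaquetteWalk.kindsL_shape γ f with h | h | h | h | h | h <;> rw [h] <;>
    simp only [localWeight]
  · exact one_pos
  · exact weightU1_pos_of_mem_Ioo hθ'
  · exact weightU2_pos_of_mem_Ioo hθ'
  · exact weightV_pos_of_mem_Ioo hθ'
  · rw [weightW1_eq_weightU1_mul]
    refine mul_pos (weightU1_pos_of_mem_Ioo hθ') (sub_pos.2 ?_)
    rw [← Real.sin_pi_div_two_sub]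
    exact Real.sin_lt_sin_of_lt_of_le_pi_div_two (by linarith [hθ.1, Real.pi_pos]) (by linarith [hθ.1, Real.pi_pos])
      (by linarith [hθ.2])
  · rw [weightW2_eq_sqrt_two_mul]
    refine mul_pos (mul_pos (Real.sqrt_pos.2 (by norm_num)) (weightU2_pos_of_mem_Ioo hθ')) ?_
    exact Real.sin_pos_of_pos_of_lt_pi (by linarith [hθ.1]) (by linarith [hθ.2, Real.pi_pos])

/-- **THE TURNING RIGIDITY OF THE PREFIX (the lane's (R2)) as a hypothesis.** For every WOUND class-`B2a` walk at the
far cell of the hole root `w.side W` (`WE ≠ excursionWinding(θ; z₀, z₁, z₂)`: by the sign law its excursion polygon, or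
that of its reversed companion, has non-zero swept angle at the root's midpoint): if it first
enters the far cell from `N` its prefix has total turning `π + θ` (it passed OVER the hole: the lattice directions
`E, N, W, S` of the rhombic tiling are `θ, π − θ, θ, π − θ` apart), and if from `S` the turning is `θ − 2π` (UNDER the
hole). It is PROVED below (`ΩG.farCellTurningW_holds`, § Turning: Hopf's Umlaufsatz for the prefix closed through
the far cell and the hole, and for the whole walk closed the same way, whose turnings differ by the excursion winding that
the sign law fixes for wound walks); the statements of Part B carry it as an explicit hypothesis and are discharged in the
last section. (Venture lane «pcv-sawmu»: exact enumeration, 0 violations among 1 632 wound walks on five domains.) [cite: Hopf1935, Nr. 2 (Umlaufsatz, p. 53) and Nr. 4 eq. (22) (curves with corners, pp. 60–61)] [cite: GlazmanManolescu2019, Lemma 2.1 (proof: [Gl])]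
[cite: DuminilCopinSmirnov2012, proof of Lemma 1 («we used the fact that a is on the boundary and Ω is simply connected»)] -/
def FarCellTurningW (D : Set Face) (w : Face) (θ : ℝ) : Prop :=
  ∀ (hr : RootedFace D (w.side .W) (farW w)) (ω : ΩG D (w.side .W) (farW w)) (h : ω.IsB2a),
    ω.WE (fun _ => θ) ≠ excursionWinding θ ω.2.firstSideG (ω.z1 hr h) ω.1 →
      (ω.2.firstSideG = .N → ω.WP (fun _ => θ) = π + θ) ∧ (ω.2.firstSideG = .S → ω.WP (fun _ => θ) = θ - 2 * π)

namespace ΩG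

variable {D : Set Face} {w : Face}

/-- ★ **(R1) at the far cell**: a wound class-`B2a` walk at the far cell first entered it from `N` or from `S`
(the tree's `firstSide_lateral_of_wound`, dead side `E`). [cite: GlazmanManolescu2019, Lemma 2.1 (proof: [Gl])]
[cite: Glazman2015WeightedSAW, Lemma 3.1 (proof, pp. 6–7: the classes of walks through a rhombus)] -/
theorem firstSide_eq_N_or_S_of_wound (hh : holeFaceW w ∉ D) (ω : ΩG D (w.side .W) (farW w))
    (hr : RootedFace D (w.side .W) (farW w)) (h : ω.IsB2a) (hw : ω.AJ hr h (toC (midPt (w.side .W))) ≠ 0) :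
    ω.2.firstSideG = .N ∨ ω.2.firstSideG = .S := by
  have hdoors := ω.exit_return_doors hr h
  have hE1 : Side.E ≠ ω.z1 hr h := by
    intro e; rw [← e, farW_side_E_faces] at hdoors; exact hh hdoors.1.2
  have hE2 : Side.E ≠ ω.1 := by
    intro e; rw [← e, farW_side_E_faces] at hdoors; exact hh hdoors.2.2
  obtain ⟨h1, h2⟩ := ω.firstSide_lateral_of_woundFR hr h hE1 hE2 hh (s := .W) (s' := .E) (holeFaceW_side_W w)
    (holeFaceW_side_E w) (farW_side_ne_root w) hw
  revert h1 h2
  generalize ω.2.firstSideG = z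
  intro h1 h2
  cases z
  · exact absurd rfl h2
  · exact absurd rfl h1
  · exact Or.inr rfl
  · exact Or.inl rfl

open Classical in
/-- **The route mass of a walk at the far cell**: its exterior weight if it is of class `B2a`, WOUND
(`WE ≠ excursionWinding(θ; z₀, z₁, z₂)`) and first entered the far cell from the side `s`; else `0`.
[cite: GlazmanManolescu2019, Lemma 2.1 (statement, "in the form given in [Gl]")] [cite: Glazman2015WeightedSAW, Lemma 3.1 (proof, pp. 6–7)] -/
noncomputable def routeMassW (θ : ℝ) (hr : RootedFace D (w.side .W) (farW w)) (s : Side)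
    (ω : ΩG D (w.side .W) (farW w)) : ℝ :=
  if h : ω.IsB2a then
    (if ω.2.firstSideG = s ∧ ω.WE (fun _ => θ) ≠ excursionWinding θ ω.2.firstSideG (ω.z1 hr h) ω.1 then
      ω.2.extWeight (fun _ => θ) (farW w) else 0)
  else 0

/-- Route masses are non-negative on `[π/3, 2π/3]`. [cite: GlazmanManolescu2019, eq. (1) (the weights are non-negative)] -/
theorem routeMassW_nonneg {θ : ℝ} (hθ : θ ∈ Set.Icc (π / 3) (2 * π / 3)) (hr : RootedFace D (w.side .W) (farW w))
    (s : Side) (ω : ΩG D (w.side .W) (farW w)) : 0 ≤ routeMassW θ hr s ω := by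
  unfold routeMassW
  split_ifs
  · exact Finset.prod_nonneg fun _ _ => localWeight_nonneg hθ _
  · exact le_rfl
  · exact le_rfl

/-- ★★ **THE CLASS TERM AT THE FAR CELL** (modulo the turning rigidity): for a class-`B2a` walk at the far cell of
the hole root `w.side W`, `classTerm = v(θ)·(routeMass_N − routeMass_S)` — `+v(θ)·extWeight` for a wound walk that
entered from `N`, `−v(θ)·extWeight` for one that entered from `S`, `0` for an unwound walk.
[cite: GlazmanManolescu2019, Lemma 2.1 (statement, "in the form given in [Gl]")] [cite: Glazman2015WeightedSAW, Lemma 3.1 (proof, pp. 6–7)] -/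
theorem classTerm_farCellW (hh : holeFaceW w ∉ D) {θ : ℝ} (hT : FarCellTurningW D w θ)
    (ω : ΩG D (w.side .W) (farW w)) (hr : RootedFace D (w.side .W) (farW w)) (h : ω.IsB2a) :
    ω.classTerm (fun _ => θ) hr =
      (weightV θ : ℂ) * ((routeMassW θ hr .N ω - routeMassW θ hr .S ω : ℝ) : ℂ) := by
  rcases ω.classTerm_dichotomy hr h θ with ⟨hWE, h0⟩ | ⟨hWE, hct⟩
  · rw [h0, routeMassW, routeMassW, dif_pos h, dif_pos h, if_neg (fun H => H.2 hWE), if_neg (fun H => H.2 hWE)]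
    simp
  · obtain ⟨hz01, hz02, hz12⟩ := ω.firstSide_exit_return_distinct hr h
    have h3 := ω.z₃_spec hr h
    have hdoors := ω.exit_return_doors hr h
    have hE1 : ω.z1 hr h ≠ .E := by
      intro e; rw [e, farW_side_E_faces] at hdoors; exact hh hdoors.1.2
    have hE2 : ω.1 ≠ .E := by
      intro e; rw [e, farW_side_E_faces] at hdoors; exact hh hdoors.2.2
    -- a wound orientation witness gives (R1) and the turning (R2) for `ω` itself
    have hNS : ω.2.firstSideG = .N ∨ ω.2.firstSideG = .S := by
      rcases ω.AJ_ne_zero_or_rev_of_wound hr h θ hWE with hA | hA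
      · exact firstSide_eq_N_or_S_of_wound hh ω hr h hA
      · have h'' := ω.rev_isB2a hr h
        have hNS := firstSide_eq_N_or_S_of_wound hh (ω.rev hr) hr h'' hA
        rwa [ω.rev_firstSide hr h] at hNS
    obtain ⟨hN, hS⟩ := hT hr ω h hWE
    rw [hct, routeMassW, routeMassW, dif_pos h, dif_pos h]
    rcases hNS with hz0 | hz0
    · rw [if_pos ⟨hz0, hWE⟩, if_neg (fun H => by rw [hz0] at H; exact absurd H.1 (by decide)), hN hz0, sub_zero]
      rw [hz0] at hz01 hz02 h3
      rw [hz0, show (ω.2.extWeight (fun _ => θ) (farW w) : ℂ) * phase (π + θ) * (chordSign Side.N (ω.z1 hr h) ω.1 : ℂ) *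
          backBracket θ .N (ω.z1 hr h) ω.1 (ω.z₃ hr h) =
          (ω.2.extWeight (fun _ => θ) (farW w) : ℂ) * (phase (π + θ) * ((chordSign Side.N (ω.z1 hr h) ω.1 : ℂ) *
            backBracket θ .N (ω.z1 hr h) ω.1 (ω.z₃ hr h))) by ring,
        farCellW_termN θ hz01 hz02 hz12 hE1 hE2 ⟨h3.1, h3.2.1, h3.2.2⟩]
      ring
    · rw [if_neg (fun H => by rw [hz0] at H; exact absurd H.1 (by decide)), if_pos ⟨hz0, hWE⟩, hS hz0, zero_sub]
      rw [hz0] at hz01 hz02 h3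
      rw [hz0, show (ω.2.extWeight (fun _ => θ) (farW w) : ℂ) * phase (θ - 2 * π) * (chordSign Side.S (ω.z1 hr h) ω.1 : ℂ) *
          backBracket θ .S (ω.z1 hr h) ω.1 (ω.z₃ hr h) =
          (ω.2.extWeight (fun _ => θ) (farW w) : ℂ) * (phase (θ - 2 * π) * ((chordSign Side.S (ω.z1 hr h) ω.1 : ℂ) *
            backBracket θ .S (ω.z1 hr h) ω.1 (ω.z₃ hr h))) by ring,
        farCellW_termS θ hz01 hz02 hz12 hE1 hE2 ⟨h3.1, h3.2.1, h3.2.2⟩]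
      push_cast; ring

variable [Finite D]

/-- ★★ **The grouped sum at the far cell**: `Σ_{B2a(f)} classTerm = v(θ)·(M_N − M_S)`, `M_s` the total route mass of
the wound walks entering from `s`. [cite: GlazmanManolescu2019, Lemma 2.1 (statement, "in the form given in [Gl]")]
[cite: Glazman2015WeightedSAW, Lemma 3.1 (proof, pp. 6–7)] -/
theorem sum_classTerm_farCellW (hh : holeFaceW w ∉ D) {θ : ℝ} (hT : FarCellTurningW D w θ)
    (hr : RootedFace D (w.side .W) (farW w)) :
    ∑ ω ∈ setB2a D (w.side .W) (farW w), ω.classTerm (fun _ => θ) hr =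
      (weightV θ : ℂ) * (((∑ ω ∈ setB2a D (w.side .W) (farW w), routeMassW θ hr .N ω) -
        ∑ ω ∈ setB2a D (w.side .W) (farW w), routeMassW θ hr .S ω : ℝ) : ℂ) := by
  push_cast
  rw [← Finset.sum_sub_distrib, Finset.mul_sum]
  refine Finset.sum_congr rfl fun ω hω => ?_
  simp only [setB2a, Finset.mem_filter, Finset.mem_univ, true_and] at hω
  have h : ω.IsB2a := hω
  rw [ω.classTerm_farCellW hh hT hr h]; push_cast; ring

end ΩG

end Literature.Probability.RandomPlanarGeometry.SAW.YangBaxter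

namespace Literature.Barriers.CriticalPhenomena.PlaquetteWalk

open Literature.Probability.RandomPlanarGeometry.SAW.YangBaxter
open Real Complex

/-- ★★★ **THE FAR-CELL LAW (modulo the turning rigidity of the prefix).** For every `θ ∈ [π/3, 2π/3]`, every finite
face list `Dl`, every plaquette `w` whose `W`-neighbour (the hole) is not in the domain while the face beyond it (the
far cell `f`) is: IF the prefixes of the wound class-`B2a` walks at `f` turn as in `FarCellTurningW`, THEN the
Yang–Baxter vertex functional of the hole root `w.side W` at the far cell is PURELY IMAGINARY and equal to
`i·v(θ)·(M_N − M_S)`, where `M_N`, `M_S ≥ 0` are the total exterior weights of the wound walks entering `f` over resp.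
under the hole. (The venture lane's far-cell half law (H1) «`VF(f) ∈ i·c_E·ℝ`», with the two route masses and their
signs; its mirror corollary: a domain symmetric in the root's axis has `M_N = M_S` at `θ = π/2`, where the printed
weights are mirror-invariant — the lane's (R-9′) far-cell zeros.) [cite: GlazmanManolescu2019, Lemma 2.1 (statement, "in the form given in [Gl]")]
[cite: Glazman2015WeightedSAW, Lemma 3.1 (proof, pp. 6–7: the classes of walks through a rhombus)] [cite: DuminilCopinSmirnov2012, proof of Lemma 1] -/
theorem vertexFunctional_printed_farCellW_eq_of_turning {θ : ℝ} (hθ : θ ∈ Set.Icc (π / 3) (2 * π / 3))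
    (Dl : List Face) (w : Face) (hf : farW w ∈ Dl) (hh : holeFaceW w ∉ dom Dl) (hT : FarCellTurningW (dom Dl) w θ)
    (hr : RootedFace (dom Dl) (w.side .W) (farW w)) :
    vertexFunctional (printedWeights θ) tFiveEighths (ybCoeff θ) Dl (w.side .W) (farW w) =
      Complex.I * (weightV θ : ℂ) *
        (((∑ ω ∈ ΩG.setB2a (dom Dl) (w.side .W) (farW w), ΩG.routeMassW θ hr .N ω) -
          ∑ ω ∈ ΩG.setB2a (dom Dl) (w.side .W) (farW w), ΩG.routeMassW θ hr .S ω : ℝ) : ℂ) := by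
  have _ := hf
  rw [vertexFunctional_printed_eq_phase_mul_lem21Defect, ← ΩG.sum_g_eq_lem21Defect,
    ΩG.sum_g_eq_I_mul_sum_classTerm (fun _ => θ) hr (fun _ => hθ), ΩG.sum_classTerm_farCellW hh hT hr, slantPot_sideW]
  have e0 : Complex.exp (((-(5 / 8 * (0 : ℝ)) : ℝ) : ℂ) * Complex.I) = 1 := by simp
  rw [e0, one_mul, mul_assoc]

/-- ★★ **THE FAR-CELL HALF LAW (H1), modulo the turning rigidity**: the vertex functional of a hole root at its far
cell has ZERO REAL PART — the component of Glazman–Manolescu's relation along the dead side's coefficient `c_E = 1`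
survives at the far cell, for every `θ ∈ [π/3, 2π/3]` and every finite face domain.
[cite: GlazmanManolescu2019, Lemma 2.1 (statement, "in the form given in [Gl]")] [cite: Glazman2015WeightedSAW, Lemma 3.1 (proof, pp. 6–7)] -/
theorem vertexFunctional_printed_farCellW_re_eq_zero_of_turning {θ : ℝ} (hθ : θ ∈ Set.Icc (π / 3) (2 * π / 3))
    (Dl : List Face) (w : Face) (hf : farW w ∈ Dl) (hh : holeFaceW w ∉ dom Dl) (hT : FarCellTurningW (dom Dl) w θ) :
    (vertexFunctional (printedWeights θ) tFiveEighths (ybCoeff θ) Dl (w.side .W) (farW w)).re = 0 := by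
  rw [vertexFunctional_printed_farCellW_eq_of_turning hθ Dl w hf hh hT (rootedFace_farW (show farW w ∈ dom Dl from hf) hh)]
  simp [Complex.mul_re]

/-- ★★ **Vanishing at the far cell ⟺ the two route masses agree** (modulo the turning rigidity), for every
`θ ∈ [π/3, 2π/3]` (there `v(θ) > 0`). [cite: GlazmanManolescu2019, Lemma 2.1 (statement, "in the form given in [Gl]")]
[cite: Glazman2015WeightedSAW, Lemma 3.1, eq. (1) (the weight v(θ))] -/
theorem vertexFunctional_printed_farCellW_eq_zero_iff_of_turning {θ : ℝ} (hθ : θ ∈ Set.Icc (π / 3) (2 * π / 3))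
    (Dl : List Face) (w : Face) (hf : farW w ∈ Dl) (hh : holeFaceW w ∉ dom Dl) (hT : FarCellTurningW (dom Dl) w θ)
    (hr : RootedFace (dom Dl) (w.side .W) (farW w)) :
    vertexFunctional (printedWeights θ) tFiveEighths (ybCoeff θ) Dl (w.side .W) (farW w) = 0 ↔
      ∑ ω ∈ ΩG.setB2a (dom Dl) (w.side .W) (farW w), ΩG.routeMassW θ hr .N ω =
        ∑ ω ∈ ΩG.setB2a (dom Dl) (w.side .W) (farW w), ΩG.routeMassW θ hr .S ω := by
  have hv : (weightV θ : ℂ) ≠ 0 := by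
    have hθ' : θ ∈ Set.Ioo 0 π := ⟨by linarith [hθ.1, Real.pi_pos], by linarith [hθ.2, Real.pi_pos]⟩
    exact_mod_cast (weightV_pos_of_mem_Ioo hθ').ne'
  rw [vertexFunctional_printed_farCellW_eq_of_turning hθ Dl w hf hh hT hr]
  constructor
  · intro h0
    rcases mul_eq_zero.1 h0 with h1 | h2
    · exact absurd h1 (mul_ne_zero Complex.I_ne_zero hv)
    · exact sub_eq_zero.1 (Complex.ofReal_eq_zero.1 h2)
  · intro h0; rw [h0, sub_self]; simp

/-- ★★ **A SUFFICIENT-HALF INSTANCE AT A NON-ROOT PLAQUETTE** (modulo the turning rigidity): on the open range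
`θ ∈ (π/3, 2π/3)` (all weights positive), if NO wound class-`B2a` walk at the far cell entered under the hole (from
`S`) while SOME wound walk entered over it (from `N`) — e.g. when the faces under the hole form a two-door corridor —
then the Yang–Baxter vertex identity FAILS at the far cell: `VF_D(w.side W, f) ≠ 0`. (The venture lane's table
`box54 = 5 × 4 ∖ (2,1)`, root `W` of `(3,1)`: `M_S = 0`, sixteen wound over-route walks.)
[cite: GlazmanManolescu2019, Lemma 2.1 (statement, "in the form given in [Gl]")] [cite: Glazman2015WeightedSAW, Lemma 3.1 (proof, pp. 6–7)] -/
theorem vertexFunctional_printed_farCellW_ne_zero_of_over_only {θ : ℝ} (hθ : θ ∈ Set.Ioo (π / 3) (2 * π / 3))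
    (Dl : List Face) (w : Face) (hf : farW w ∈ Dl) (hh : holeFaceW w ∉ dom Dl) (hT : FarCellTurningW (dom Dl) w θ)
    (hr : RootedFace (dom Dl) (w.side .W) (farW w))
    (hnoS : ∀ (ω : ΩG (dom Dl) (w.side .W) (farW w)) (h : ω.IsB2a), ω.2.firstSideG = .S →
      ω.WE (fun _ => θ) = excursionWinding θ ω.2.firstSideG (ω.z1 hr h) ω.1)
    (hN : ∃ (ω : ΩG (dom Dl) (w.side .W) (farW w)) (h : ω.IsB2a), ω.2.firstSideG = .N ∧
      ω.WE (fun _ => θ) ≠ excursionWinding θ ω.2.firstSideG (ω.z1 hr h) ω.1) :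
    vertexFunctional (printedWeights θ) tFiveEighths (ybCoeff θ) Dl (w.side .W) (farW w) ≠ 0 := by
  classical
  have hθ' := Set.Ioo_subset_Icc_self hθ
  rw [Ne, vertexFunctional_printed_farCellW_eq_zero_iff_of_turning hθ' Dl w hf hh hT hr]
  have hS0 : ∑ ω ∈ ΩG.setB2a (dom Dl) (w.side .W) (farW w), ΩG.routeMassW θ hr .S ω = 0 := by
    refine Finset.sum_eq_zero fun ω hω => ?_
    unfold ΩG.routeMassW
    split_ifs with h1 h2
    · exact absurd (hnoS ω h1 h2.1) h2.2
    · rfl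
    · rfl
  obtain ⟨ω₀, h₀, hz₀, hW₀⟩ := hN
  have hpos : 0 < ∑ ω ∈ ΩG.setB2a (dom Dl) (w.side .W) (farW w), ΩG.routeMassW θ hr .N ω := by
    have hmem : ω₀ ∈ ΩG.setB2a (dom Dl) (w.side .W) (farW w) := by
      simp only [ΩG.setB2a, Finset.mem_filter, Finset.mem_univ, true_and]; exact h₀
    refine lt_of_lt_of_le ?_ (Finset.single_le_sum (fun ω _ => ΩG.routeMassW_nonneg hθ' hr .N ω) hmem)
    unfold ΩG.routeMassW
    rw [dif_pos h₀, if_pos ⟨hz₀, hW₀⟩]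
    exact Finset.prod_pos fun g _ => ω₀.2.localWeight_kindsIn_pos' hθ g
  rw [hS0]
  exact hpos.ne'

end Literature.Barriers.CriticalPhenomena.PlaquetteWalk

/-! ## § Turning (b-step0 gen 17, CAR 2): Hopf's Umlaufsatz for lattice polygons built on a walk

Generic tools: squared distances and the acute-angle («subtended») test on `ℤ²`, and a CYCLIC form of the tree's
discrete Umlaufsatz `SAW.Hopf.hopf_closed` (base point moved to a lowest vertex internally). -/

namespace Literature.Probability.RandomPlanarGeometry.SAW.YangBaxter

open Real Complex

section LatticeTools

/-- Squared distance on `ℤ²`. [folklore] -/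
def dsq (p q : ℤ × ℤ) : ℤ := (p.1 - q.1) ^ 2 + (p.2 - q.2) ^ 2

/-- `dsq` is symmetric. [folklore] -/
private theorem dsq_comm (p q : ℤ × ℤ) : dsq p q = dsq q p := by unfold dsq; ring

/-- Polarization: `2·sdot A B v = |A − v|² + |B − v|² − |A − B|²`. [folklore] -/
private theorem two_mul_sdot (A B v : ℤ × ℤ) : 2 * sdot A B v = dsq A v + dsq B v - dsq A B := by
  unfold sdot dsq; ring

/-- Distinct lattice points are at squared distance `≥ 1`. [folklore] -/
private theorem one_le_dsq_of_ne {p q : ℤ × ℤ} (h : p ≠ q) : 1 ≤ dsq p q := by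
  unfold dsq
  by_contra hlt
  push Not at hlt
  have h1 : (p.1 - q.1) ^ 2 = 0 := by nlinarith [sq_nonneg (p.1 - q.1), sq_nonneg (p.2 - q.2)]
  have h2 : (p.2 - q.2) ^ 2 = 0 := by nlinarith [sq_nonneg (p.1 - q.1), sq_nonneg (p.2 - q.2)]
  exact h (Prod.ext (by nlinarith [pow_eq_zero_iff (n := 2) (a := p.1 - q.1) two_ne_zero])
    (by nlinarith [pow_eq_zero_iff (n := 2) (a := p.2 - q.2) two_ne_zero]))

/-- **The acute-angle test from distances**: if `|A − v|² + |B − v|² > |A − B|²` then `v` sees `[A, B]` under an angle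
`< π/2`. [folklore] -/
private theorem sdot_pos_of_dsq {A B v : ℤ × ℤ} (h : dsq A B < dsq A v + dsq B v) : 0 < sdot A B v := by
  have := two_mul_sdot A B v; omega

/-- `|x| ≥ 3 ⇒ x² ≥ 9`. [folklore] -/
private theorem nine_le_sq_of_three_le {x : ℤ} (h : 3 ≤ x ∨ x ≤ -3) : 9 ≤ x ^ 2 := by
  rcases h with h | h <;> nlinarith

end LatticeTools

section CyclicHopf

open Literature.Probability.RandomPlanarGeometry.SAW.Hopf

/-- The exterior angle of a lattice polyline `p` at its vertex `v + 1`. [cite: Hopf1935, Nr. 2 (Umlaufsatz, p. 53) and Nr. 4 eq. (22) (curves with corners, pp. 60–61)] -/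
def extAng (p : ℕ → ℤ × ℤ) (v : ℕ) : ℝ :=
  ((Complex.arg (toC (p (v + 2)) - toC (p (v + 1))) : Real.Angle) -
    (Complex.arg (toC (p (v + 1)) - toC (p v)) : Real.Angle)).toReal

/-- A periodic function on `ℕ`: values depend on the residue. [folklore] -/
private theorem periodic_mod {α : Type*} (p : ℕ → α) {N : ℕ} (hper : ∀ j, p (j + N) = p j) (j : ℕ) :
    p j = p (j % N) := by
  induction j using Nat.strong_induction_on with
  | _ j ih =>
    rcases Nat.lt_or_ge j N with hj | hj
    · rw [Nat.mod_eq_of_lt hj]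
    · rcases Nat.eq_zero_or_pos N with rfl | hN
      · simp
      · have e : j = (j - N) + N := by omega
        rw [e, hper, Nat.add_mod_right]
        exact ih _ (by omega)

/-- Shift invariance of a periodic sum. [folklore] -/
private theorem sum_range_shift {f : ℕ → ℝ} {N : ℕ} (hper : ∀ j, f (j + N) = f j) (j₀ : ℕ) :
    ∑ v ∈ Finset.range N, f (j₀ + v) = ∑ v ∈ Finset.range N, f v := by
  induction j₀ with
  | zero => simp
  | succ m ih =>
    rw [← ih]
    rcases Nat.eq_zero_or_pos N with rfl | hN
    · simp
    · obtain ⟨M, rfl⟩ : ∃ M, N = M + 1 := ⟨N - 1, by omega⟩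
      rw [Finset.sum_range_succ, Finset.sum_range_succ', show m + 1 + M = m + (M + 1) by ring, hper]
      refine congrArg₂ (· + ·) (Finset.sum_congr rfl fun v _ => by rw [show m + 1 + v = m + (v + 1) by ring]) ?_
      rw [add_zero]

/-- ★ **Cyclic discrete Umlaufsatz.** Let `p : ℕ → ℤ²` be `N`-periodic (`N ≥ 3`), injective on a period, and such that
every edge `[p k, p (k+1)]` is seen from every vertex off it under an angle `< π/2` (`sdot > 0`). Then the sum of the
`N` exterior angles is `2π` or `−2π`. (The tree's `hopf_closed` with its base point moved to a lowest vertex.)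
[cite: Hopf1935, Nr. 2 (Umlaufsatz, p. 53) and Nr. 4 eq. (22) (curves with corners, pp. 60–61)] -/
theorem hopf_cyclic_int (p : ℕ → ℤ × ℤ) {N : ℕ} (hN : 3 ≤ N) (hper : ∀ j, p (j + N) = p j)
    (hinj : ∀ i j, i < N → j < N → p i = p j → i = j)
    (hsub : ∀ k j, k < N → j < N → p j ≠ p k → p j ≠ p (k + 1) → 0 < sdot (p k) (p (k + 1)) (p j)) :
    ∑ v ∈ Finset.range N, extAng p v = 2 * π ∨ ∑ v ∈ Finset.range N, extAng p v = -(2 * π) := by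
  have hN0 : 0 < N := by omega
  have hmod : ∀ j, p j = p (j % N) := periodic_mod p hper
  -- a lowest vertex
  obtain ⟨j₀, hj₀, hlow⟩ := Finset.exists_min_image (Finset.range N) (fun j => (p j).2) ⟨0, Finset.mem_range.2 hN0⟩
  rw [Finset.mem_range] at hj₀
  set z : ℕ → ℂ := fun j => toC (p (j₀ + j)) with hz
  have hzN : z N = z 0 := by simp only [hz, add_zero, hper]
  have hzN1 : z (N + 1) = z 1 := by simp only [hz]; rw [show j₀ + (N + 1) = (j₀ + 1) + N by ring, hper]
  have hres : ∀ i, i < N → p (j₀ + i) = p ((j₀ + i) % N) := fun i _ => hmod _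
  have hinj' : ∀ i j : ℕ, i < N → j < N → z i = z j → i = j := by
    intro i j hi hj h
    have h' := toC_injective h
    rw [hres i hi, hres j hj] at h'
    have e := hinj _ _ (Nat.mod_lt _ hN0) (Nat.mod_lt _ hN0) h'
    have hm : (j₀ + i) ≡ (j₀ + j) [MOD N] := e
    exact Nat.ModEq.eq_of_lt_of_lt (Nat.ModEq.add_left_cancel' j₀ hm) hi hj
  have hsub' : ∀ k j : ℕ, k < N → j < N → z j ≠ z k → z j ≠ z (k + 1) →
      0 < ((z (k + 1) - z j) * (starRingEnd ℂ) (z k - z j)).re := by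
    intro k j hk hj h1 h2
    simp only [hz] at h1 h2 ⊢
    rw [re_seg]
    set k' := (j₀ + k) % N with hk'
    set j' := (j₀ + j) % N with hj'
    have hk'N : k' < N := Nat.mod_lt _ hN0
    have hj'N : j' < N := Nat.mod_lt _ hN0
    have ek : p (j₀ + k) = p k' := hmod _
    have ej : p (j₀ + j) = p j' := hmod _
    have hm : (j₀ + k) ≡ k' [MOD N] := (Nat.mod_modEq (j₀ + k) N).symm
    have hm1 : (j₀ + k + 1) ≡ k' + 1 [MOD N] := Nat.ModEq.add_right 1 hm
    have ek1 : p (j₀ + (k + 1)) = p (k' + 1) := by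
      rw [hmod (j₀ + (k + 1)), hmod (k' + 1), show j₀ + (k + 1) = j₀ + k + 1 by ring]
      exact congrArg p hm1
    rw [ek, ej] at h1
    rw [ek1, ej] at h2
    rw [ek, ek1, ej]
    exact_mod_cast hsub k' j' hk'N hj'N (fun e => h1 (by rw [e])) (fun e => h2 (by rw [e]))
  have hbot : ∀ j < N, 0 ≤ (z j - z 0).im := by
    intro j hj
    simp only [hz, add_zero, ← toC_sub, toC_im, Prod.snd_sub, Int.cast_sub, sub_nonneg, Int.cast_le]
    rw [hres j hj]
    exact hlow _ (Finset.mem_range.2 (Nat.mod_lt _ hN0))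
  have key := hopf_closed z hN hzN hzN1 hinj' hsub' hbot
  have hE : ∀ v, ((Complex.arg (z (v + 2) - z (v + 1)) : Real.Angle) - (Complex.arg (z (v + 1) - z v) : Real.Angle)).toReal =
      extAng p (j₀ + v) := by
    intro v; simp only [hz, extAng, add_assoc]
  simp only [hE] at key
  have hperE : ∀ v, extAng p (v + N) = extAng p v := by
    intro v; simp only [extAng, show v + N + 2 = (v + 2) + N by ring, show v + N + 1 = (v + 1) + N by ring, hper]
  rwa [sum_range_shift hperE j₀] at key

end CyclicHopf

end Literature.Probability.RandomPlanarGeometry.SAW.YangBaxter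

/-! ## § Turning, continued: the PREFIX POLYGON of a class-`B2a` walk at the far cell

`C` = the prefix of the walk (from the midpoint of the root `w.side W` to the midpoint of the first side `z₀` of the
far cell `f`, drawn through inner points in the mesh-`4` grid) closed by the lattice path
`midPt(f.side z₀) → ctr f → midPt(f.side E) → ctr h → midPt(w.side W)` through the far cell and the hole. It is a
simple lattice polygon (the prefix never enters `f` or `h`), its exterior angles at the four closing corners are
`0, ±π/2, 0, 0` and at the junctions `0`, so Hopf's Umlaufsatz pins the right-angle turning of the prefix to
TWO values: `3π/2` or `−5π/2` when `z₀ = N`, `5π/2` or `−3π/2` when `z₀ = S`. -/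

namespace Literature.Probability.RandomPlanarGeometry.SAW.YangBaxter

open Real Complex

section LatticeFacts

/-- The inner offsets lie in `{1, 2, 3}²`. [folklore] -/
private theorem inOff_bounds (s : Side) : 1 ≤ s.inOff.1 ∧ s.inOff.1 ≤ 3 ∧ 1 ≤ s.inOff.2 ∧ s.inOff.2 ≤ 3 := by
  cases s <;> simp [Side.inOff, Side.offset, Side.nIn]

/-- The inward normals are unit lattice vectors. [folklore] -/
private theorem nIn_bounds (s : Side) : -1 ≤ s.nIn.1 ∧ s.nIn.1 ≤ 1 ∧ -1 ≤ s.nIn.2 ∧ s.nIn.2 ≤ 1 ∧ s.nIn.1 ^ 2 + s.nIn.2 ^ 2 = 1 := by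
  cases s <;> simp [Side.nIn]

/-- Coordinates: an inner point of a face other than `f` and its `E`-neighbour is at squared distance `≥ 9` from the
three points `f.base + (2,2), (4,2), (6,2)` (the centre of `f`, the midpoint of its `E` side, the centre of its
`E`-neighbour). [folklore] -/
private theorem nine_le_of_coords {k j k' j' ox oy cx : ℤ} (hox : 1 ≤ ox ∧ ox ≤ 3) (hoy : 1 ≤ oy ∧ oy ≤ 3)
    (hcx : 2 ≤ cx ∧ cx ≤ 6) (hne : ¬(k = k' ∧ j = j')) (hne' : ¬(k = k' + 1 ∧ j = j')) :
    9 ≤ (4 * k + ox - (4 * k' + cx)) ^ 2 + (4 * j + oy - (4 * j' + 2)) ^ 2 := by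
  by_cases hj : j = j'
  · subst hj
    have hk : k ≠ k' := fun e => hne ⟨e, rfl⟩
    have hk' : k ≠ k' + 1 := fun e => hne' ⟨e, rfl⟩
    have h3 : 3 ≤ (4 * k + ox - (4 * k' + cx)) ∨ (4 * k + ox - (4 * k' + cx)) ≤ -3 := by omega
    nlinarith [nine_le_sq_of_three_le h3, sq_nonneg (4 * j + oy - (4 * j + 2))]
  · have h3 : 3 ≤ (4 * j + oy - (4 * j' + 2)) ∨ (4 * j + oy - (4 * j' + 2)) ≤ -3 := by omega
    nlinarith [nine_le_sq_of_three_le h3, sq_nonneg (4 * k + ox - (4 * k' + cx))]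

/-- ★ An inner point of a face `g ∉ {f, E-neighbour of f}` is at squared distance `≥ 9` from `f.base + (cx, 2)`,
`cx ∈ {2, 4, 6}`. [folklore] -/
private theorem nine_le_dsq_innerPt {g f : Face} (hg : g ≠ f) (hg' : g ≠ (f.1 + 1, f.2)) (s : Side) {cx : ℤ}
    (hcx : 2 ≤ cx ∧ cx ≤ 6) : 9 ≤ dsq (innerPt g s) (f.base + (cx, 2)) := by
  obtain ⟨k, j⟩ := g
  obtain ⟨k', j'⟩ := f
  have hb := inOff_bounds s
  have hne : ¬(k = k' ∧ j = j') := fun e => hg (Prod.ext e.1 e.2)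
  have hne' : ¬(k = k' + 1 ∧ j = j') := fun e => hg' (Prod.ext e.1 e.2)
  simp only [dsq, innerPt, Face.base, Prod.fst_add, Prod.snd_add]
  exact nine_le_of_coords ⟨hb.1, hb.2.1⟩ ⟨hb.2.2.1, hb.2.2.2⟩ hcx hne hne'

/-- Two faces sharing a side: the sides are opposite. [folklore] -/
private theorem side_eq_opp_of_side_eq {g f : Face} {s t : Side} (h : g.side s = f.side t) (hg : g ≠ f) : s = t.opp := by
  obtain ⟨k, j⟩ := g
  obtain ⟨k', j'⟩ := f
  have hne : ¬(k = k' ∧ j = j') := fun e => hg (Prod.ext e.1 e.2)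
  cases s <;> cases t <;>
    simp only [Face.side, MidEdge.vert.injEq, MidEdge.slant.injEq, reduceCtorEq, Side.opp] at h ⊢ <;> omega

/-- `dsq` is translation invariant. [folklore] -/
private theorem dsq_add_left (b u v : ℤ × ℤ) : dsq (b + u) (b + v) = dsq u v := by
  simp only [dsq, Prod.fst_add, Prod.snd_add]; ring

/-- Squared length of a step. [folklore] -/
private theorem dsq_self_add (m n : ℤ × ℤ) : dsq m (m + n) = n.1 ^ 2 + n.2 ^ 2 := by
  simp only [dsq, Prod.fst_add, Prod.snd_add]; ring

/-- Two inner offsets are at squared distance `≤ 4`. [folklore] -/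
private theorem dsq_inOff_le (s t : Side) : dsq s.inOff t.inOff ≤ 4 := by
  cases s <;> cases t <;> simp [dsq, Side.inOff, Side.offset, Side.nIn]

/-- Two inward normals are at squared distance `≤ 4`. [folklore] -/
private theorem dsq_nIn_le (s t : Side) : dsq s.nIn t.nIn ≤ 4 := by
  cases s <;> cases t <;> simp [dsq, Side.nIn]

/-- Opposite sides have opposite inward normals. [folklore] -/
private theorem nIn_opp (s : Side) : s.opp.nIn = -s.nIn := by
  cases s <;> simp [Side.opp, Side.nIn]

/-- The midpoint of a side other than `E` is at squared distance `≥ 4` from `(2,2), (4,2), (6,2)` (face coordinates).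
[folklore] -/
private theorem four_le_dsq_offset {s : Side} (hE : s ≠ .E) {cx : ℤ} (hcx : cx = 2 ∨ cx = 4 ∨ cx = 6) :
    4 ≤ dsq s.offset (cx, 2) := by
  cases s
  · rcases hcx with rfl | rfl | rfl <;> simp [dsq, Side.offset]
  · exact absurd rfl hE
  · rcases hcx with rfl | rfl | rfl <;> simp [dsq, Side.offset]
  · rcases hcx with rfl | rfl | rfl <;> simp [dsq, Side.offset]

/-- The root midpoint `(8,2)` is at squared distance `≥ 4` from `(2,2), (4,2), (6,2)`. [folklore] -/
private theorem four_le_dsq_root {cx : ℤ} (hcx : cx = 2 ∨ cx = 4 ∨ cx = 6) : 4 ≤ dsq ((8 : ℤ), (2 : ℤ)) (cx, 2) := by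
  rcases hcx with rfl | rfl | rfl <;> simp [dsq]

/-- `arg 2 = 0`, `arg 1 = 0` in `toC` form. [folklore] -/
private theorem arg_toC_pos_zero {x : ℤ} (hx : 0 < x) : Complex.arg (toC (x, 0)) = 0 := by
  rw [toC_mk]; push_cast; simp only [zero_mul, add_zero]
  exact_mod_cast Complex.arg_ofReal_of_nonneg (by exact_mod_cast hx.le)

/-- `arg (−y i) = −π/2` for `y > 0`. [folklore] -/
private theorem arg_toC_zero_neg {y : ℤ} (hy : 0 < y) : Complex.arg (toC (0, -y)) = -(π / 2) := by
  rw [toC_mk]; push_cast; simp only [zero_add]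
  rw [show -(y : ℂ) * Complex.I = ((y : ℝ) : ℂ) * (-Complex.I) by push_cast; ring,
    Complex.arg_real_mul _ (by exact_mod_cast hy), Complex.arg_neg_I]

/-- `arg (y i) = π/2` for `y > 0`. [folklore] -/
private theorem arg_toC_zero_pos {y : ℤ} (hy : 0 < y) : Complex.arg (toC (0, y)) = π / 2 := by
  rw [toC_mk]; push_cast; simp only [zero_add]
  rw [show (y : ℂ) * Complex.I = ((y : ℝ) : ℂ) * Complex.I by push_cast; ring,
    Complex.arg_real_mul _ (by exact_mod_cast hy), Complex.arg_I]

/-- Evaluation of an exterior angle from the two arguments. [folklore] -/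
private theorem toReal_sub_coe {x y r : ℝ} (h : x - y = r) (hr : -π < r ∧ r ≤ π) :
    ((x : Real.Angle) - (y : Real.Angle)).toReal = r := by
  rw [← Real.Angle.coe_sub, h]; exact Real.Angle.toReal_coe_eq_self_iff.2 hr

end LatticeFacts

/-! ### The hole and the far cell in the mesh-`4` grid -/

section FarCellCoords

variable (w : Face)

/-- The hole is the `E`-neighbour of the far cell. [cite: GlazmanManolescu2019, §1 (the lattice of rhombi and its mid-edges)] -/
theorem holeFaceW_eq : holeFaceW w = ((farW w).1 + 1, (farW w).2) := by
  obtain ⟨k, j⟩ := w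
  refine Prod.ext ?_ rfl
  show k - 1 = k - 2 + 1
  omega

/-- The root midpoint in far-cell coordinates: `midPt (w.side W) = (farW w).base + (8, 2)`. [folklore] -/
private theorem midPt_root_eq : midPt (w.side .W) = (farW w).base + (8, 2) := by
  obtain ⟨k, j⟩ := w
  refine Prod.ext ?_ ?_
  · show 4 * k = 4 * (k - 2) + 8
    omega
  · show 4 * j + 2 = 4 * j + 2
    rfl

/-- The first-side midpoint in far-cell coordinates. [folklore] -/
private theorem midPt_far_side_eq (s : Side) : midPt ((farW w).side s) = (farW w).base + s.offset := midPt_side _ _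

end FarCellCoords

namespace ΩG

variable {D : Set Face} {w : Face}

section PrefixPolygon

variable (ω : ΩG D (w.side .W) (farW w))

/-- The PREFIX of a class-`B2a` walk at the far cell: its first `firstHitG` arcs, a walk from the root to the first
side of the far cell. [cite: Glazman2015WeightedSAW, Lemma 3.1 (proof, pp. 6–7: the classes of walks through a rhombus)] -/
def pre (h : ω.IsB2a) : YBWalk D (w.side .W) (ω.2.nth ω.2.firstHitG) :=
  ω.2.take ω.2.firstHitG (ω.fh_lt h).le

variable {ω}

/-- The prefix has `firstHitG` arcs. [folklore] -/
private theorem pre_length (h : ω.IsB2a) : (ω.pre h).arcs.length = ω.2.firstHitG := YBWalk.take_length _ _ _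

/-- The mid-edges of the prefix. [folklore] -/
private theorem pre_nth (h : ω.IsB2a) {i : ℕ} (hi : i ≤ ω.2.firstHitG) : (ω.pre h).nth i = ω.2.nth i :=
  YBWalk.take_nth _ _ _ hi

/-- **The turning of the prefix is `WP`.** [cite: GlazmanManolescu2019, Lemma 2.1 (proof: [Gl])] -/
theorem pre_winding (h : ω.IsB2a) (Θ : ℤ → ℝ) : (ω.pre h).winding Θ = ω.WP Θ := by
  unfold YBWalk.winding ΩG.WP
  rw [pre, YBWalk.take_arcs]

/-- The prefix is not empty: the root is not a side of the far cell. [folklore] -/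
private theorem fh_pos (ω : ΩG D (w.side .W) (farW w)) : 0 < ω.2.firstHitG := by
  by_contra h0
  push Not at h0
  have e := ω.2.nth_firstHitG
  rw [Nat.le_zero.1 h0, ω.2.nth_zero] at e
  exact farW_side_ne_root w _ e.symm

/-- The faces of the prefix arcs lie in the domain and are neither the far cell nor the hole.
[cite: Glazman2015WeightedSAW, Lemma 3.1 (proof, pp. 6–7: the classes of walks through a rhombus)] -/
theorem pre_fc (hh : holeFaceW w ∉ D) (h : ω.IsB2a) {i : ℕ} (hi : i < ω.2.firstHitG) :
    (ω.pre h).fc i ∈ D ∧ (ω.pre h).fc i ≠ farW w ∧ (ω.pre h).fc i ≠ holeFaceW w := by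
  have hlen := pre_length (ω := ω) h
  have hD := (YBWalk.arcFace_arcAt (γ := ω.pre h) (i := i) (by rw [hlen]; exact hi)).2
  refine ⟨hD, fun e => ?_, fun e => hh (e ▸ hD)⟩
  have h1 := (ω.pre h).arcFace_nth_eq_some_fcFR (i := i) (by rw [hlen]; exact hi)
  rw [pre_nth h hi.le, pre_nth h hi, e] at h1
  exact ω.2.arcFace_ne_of_lt_firstHitG hi (by have := ω.fh_lt h; omega) h1

/-- The first arc of the prefix lies in the root plaquette `w`, entered from its `W` side.
[cite: Glazman2015WeightedSAW, Lemma 3.1 (proof, pp. 6–7)] -/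
theorem pre_fc_zero (hh : holeFaceW w ∉ D) (h : ω.IsB2a) : (ω.pre h).fc 0 = w ∧ (ω.pre h).sIn 0 = .W := by
  have hlen := pre_length (ω := ω) h
  have hfh := fh_pos ω
  obtain ⟨hs, -, -⟩ := YBWalk.side_sIn (γ := ω.pre h) (i := 0) (by rw [hlen]; exact hfh)
  rw [← (ω.pre h).nth_eq_getElem (by rw [(ω.pre h).length_eq, hlen]; omega), (ω.pre h).nth_zero] at hs
  have hD := (pre_fc hh h hfh).1
  have hcases := (Face.exists_side_eq_iff ((ω.pre h).fc 0) (w.side .W)).1 ⟨_, hs⟩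
  rw [root_faces_W] at hcases
  simp only at hcases
  rcases hcases with e | e
  · rw [e] at hD; exact absurd hD hh
  · refine ⟨e, ?_⟩
    rw [e] at hs
    exact Face.side_injective w hs

/-- The last arc of the prefix lies in the neighbour of the far cell across the first side `z₀`, and leaves it
through the side opposite to `z₀`. [cite: Glazman2015WeightedSAW, Lemma 3.1 (proof, pp. 6–7)] -/
theorem pre_sOut_last (hh : holeFaceW w ∉ D) (h : ω.IsB2a) :
    (ω.pre h).sOut (ω.2.firstHitG - 1) = ω.2.firstSideG.opp ∧
      ((ω.pre h).fc (ω.2.firstHitG - 1)).side ((ω.pre h).sOut (ω.2.firstHitG - 1)) = (farW w).side ω.2.firstSideG := by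
  have hlen := pre_length (ω := ω) h
  have hfh := fh_pos ω
  obtain ⟨-, ht, -⟩ := YBWalk.side_sIn (γ := ω.pre h) (i := ω.2.firstHitG - 1) (by rw [hlen]; omega)
  have e1 : ω.2.firstHitG - 1 + 1 = ω.2.firstHitG := by omega
  rw [← (ω.pre h).nth_eq_getElem (by rw [(ω.pre h).length_eq, hlen]; omega)] at ht
  simp only [e1] at ht
  rw [pre_nth h le_rfl] at ht
  have ht' := ht.trans ω.2.nth_firstHitG
  exact ⟨side_eq_opp_of_side_eq ht' (pre_fc hh h (by omega)).2.1, ht'⟩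

/-- The second vertex of the prefix polyline: one unit east of the root midpoint. [folklore] -/
private theorem pre_vtx_one (hh : holeFaceW w ∉ D) (h : ω.IsB2a) :
    (ω.pre h).vtx 1 = (farW w).base + (9, 2) := by
  have hlen := pre_length (ω := ω) h
  have hfh := fh_pos ω
  have e := YBWalk.vtx_odd (γ := ω.pre h) (i := 0) (by rw [hlen]; exact hfh)
  rw [show 2 * 0 + 1 = 1 from rfl] at e
  obtain ⟨hfc, hsIn⟩ := pre_fc_zero hh h
  rw [e, YBWalk.ptIn, hfc, hsIn, innerPt_eq, midPt_root_eq, add_assoc]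
  rfl

/-- The last-but-one vertex of the prefix polyline: one unit outside the first side of the far cell.
[folklore] -/
private theorem pre_vtx_penult (hh : holeFaceW w ∉ D) (h : ω.IsB2a) :
    (ω.pre h).vtx (2 * ω.2.firstHitG) = (farW w).base + ω.2.firstSideG.offset - ω.2.firstSideG.nIn := by
  have hlen := pre_length (ω := ω) h
  have hfh := fh_pos ω
  have e := YBWalk.vtx_even (γ := ω.pre h) (i := ω.2.firstHitG - 1) (by rw [hlen]; omega)
  rw [show 2 * (ω.2.firstHitG - 1) + 2 = 2 * ω.2.firstHitG by omega] at e
  obtain ⟨hs, ht⟩ := pre_sOut_last hh h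
  rw [e, YBWalk.ptOut, innerPt_eq, ht, hs, midPt_far_side_eq, nIn_opp, sub_eq_add_neg]

/-- The last vertex of the prefix polyline: the midpoint of the first side of the far cell. [folklore] -/
private theorem pre_vtx_last (h : ω.IsB2a) :
    (ω.pre h).vtx (2 * ω.2.firstHitG + 1) = (farW w).base + ω.2.firstSideG.offset := by
  have hlen := pre_length (ω := ω) h
  have e := YBWalk.vtx_last (γ := ω.pre h)
  rw [hlen] at e
  rw [e, ω.2.nth_firstHitG, midPt_far_side_eq]

/-- The first vertex of the prefix polyline: the root midpoint. [folklore] -/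
private theorem pre_vtx_zero (h : ω.IsB2a) : (ω.pre h).vtx 0 = (farW w).base + (8, 2) := by
  rw [YBWalk.vtx_zero, midPt_root_eq]

/-- The inner vertices of the prefix polyline are inner points of prefix faces. [folklore] -/
private theorem pre_vtx_inner (h : ω.IsB2a) {j : ℕ} (hj1 : 1 ≤ j) (hj2 : j ≤ 2 * ω.2.firstHitG) :
    ∃ i, i < ω.2.firstHitG ∧ ∃ s : Side, (ω.pre h).vtx j = innerPt ((ω.pre h).fc i) s := by
  have hlen := pre_length (ω := ω) h
  rcases YBWalk.index_cases (γ := ω.pre h) j (by rw [hlen]; omega) with h0 | ⟨i, hi, rfl⟩ | ⟨i, hi, rfl⟩ | h0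
  · omega
  · exact ⟨i, by rw [hlen] at hi; exact hi, _, YBWalk.vtx_odd hi⟩
  · exact ⟨i, by rw [hlen] at hi; exact hi, _, YBWalk.vtx_even hi⟩
  · rw [hlen] at h0; omega

/-- ★ **The prefix stays away from the closing path**: every vertex of the prefix polyline is at squared distance
`≥ 4` from the centre of the far cell, the midpoint of its dead side and the centre of the hole
(`(farW w).base + (2,2), (4,2), (6,2)`), provided the first side is not the dead side `E`. [folklore] -/
private theorem four_le_dsq_pre_vtx (hh : holeFaceW w ∉ D) (h : ω.IsB2a) (hE : ω.2.firstSideG ≠ .E) {j : ℕ}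
    (hj : j ≤ 2 * ω.2.firstHitG + 1) {cx : ℤ} (hcx : cx = 2 ∨ cx = 4 ∨ cx = 6) :
    4 ≤ dsq ((ω.pre h).vtx j) ((farW w).base + (cx, 2)) := by
  rcases Nat.eq_zero_or_pos j with rfl | hj0
  · rw [pre_vtx_zero h, dsq_add_left]
    exact four_le_dsq_root hcx
  rcases Nat.lt_or_ge j (2 * ω.2.firstHitG + 1) with hlt | hge
  · obtain ⟨i, hi, s, e⟩ := pre_vtx_inner h hj0 (by omega)
    rw [e]
    obtain ⟨-, hf, hh'⟩ := pre_fc hh h hi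
    rw [holeFaceW_eq] at hh'
    have := nine_le_dsq_innerPt hf hh' s (cx := cx) (by omega)
    omega
  · have hj' : j = 2 * ω.2.firstHitG + 1 := by omega
    subst hj'
    rw [pre_vtx_last h, dsq_add_left]
    exact four_le_dsq_offset hE hcx

/-- ★ **Consecutive vertices of a walk polyline are at squared distance `≤ 4`.** [folklore] -/
private theorem dsq_vtx_succ_le {D : Set Face} {a z : MidEdge} (γ : YBWalk D a z) {k : ℕ} (hk : k ≤ 2 * γ.arcs.length) :
    dsq (γ.vtx k) (γ.vtx (k + 1)) ≤ 4 := by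
  have hlen := γ.length_eq
  rcases YBWalk.index_cases (γ := γ) k (by omega) with rfl | ⟨i, hi, rfl⟩ | ⟨i, hi, rfl⟩ | h0
  · -- first half-segment
    rcases Nat.eq_zero_or_pos γ.arcs.length with h0 | hpos
    · rw [YBWalk.vtx_zero, show (0 : ℕ) + 1 = 2 * γ.arcs.length + 1 by omega, YBWalk.vtx_last]
      have : a = z := by
        have e := γ.nth_length; rw [h0, γ.nth_zero] at e; exact e
      subst this; simp [dsq]
    · rw [YBWalk.vtx_zero, show (0 : ℕ) + 1 = 2 * 0 + 1 from rfl, YBWalk.vtx_odd hpos, YBWalk.ptIn, innerPt_eq,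
        (YBWalk.side_sIn hpos).1, ← γ.nth_eq_getElem (by omega), γ.nth_zero, dsq_self_add]
      have hb := nIn_bounds (γ.sIn 0)
      omega
  · -- an arc chord
    rw [YBWalk.vtx_odd hi, show 2 * i + 1 + 1 = 2 * i + 2 by ring, YBWalk.vtx_even hi, YBWalk.ptIn, YBWalk.ptOut,
      innerPt, innerPt, dsq_add_left]
    exact dsq_inOff_le _ _
  · -- a crossing segment, or the last half-segment
    rcases Nat.lt_or_ge (i + 1) γ.arcs.length with hlt | hge
    · rw [YBWalk.vtx_even hi, show 2 * i + 2 + 1 = 2 * (i + 1) + 1 by ring, YBWalk.vtx_odd hlt, YBWalk.ptIn,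
        YBWalk.ptOut, innerPt_eq, innerPt_eq, (YBWalk.side_sIn hi).2.1, (YBWalk.side_sIn hlt).1, dsq_add_left]
      exact dsq_nIn_le _ _
    · have hi' : i + 1 = γ.arcs.length := by omega
      rw [YBWalk.vtx_even hi, show 2 * i + 2 + 1 = 2 * γ.arcs.length + 1 by omega, YBWalk.vtx_last, YBWalk.ptOut,
        innerPt_eq, (YBWalk.side_sIn hi).2.1, ← γ.nth_eq_getElem (by omega), hi', γ.nth_length, dsq_comm,
        dsq_self_add]
      have hb := nIn_bounds (γ.sOut i)
      omega
  · omega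

end PrefixPolygon

end ΩG

end Literature.Probability.RandomPlanarGeometry.SAW.YangBaxter

namespace Literature.Probability.RandomPlanarGeometry.SAW.YangBaxter

open Real Complex

namespace ΩG

variable {D : Set Face} {w : Face}

section PrefixHopf

variable (ω : ΩG D (w.side .W) (farW w))

/-- **The closed prefix polygon `C`** as a periodic sequence of lattice points (period `2·firstHitG + 5`): the
`2·firstHitG + 2` vertices of the prefix polyline, then the centre of the far cell, the midpoint of its dead side
`E`, and the centre of the hole. [cite: Hopf1935, Nr. 2 (Umlaufsatz, p. 53) and Nr. 4 eq. (22) (curves with corners, pp. 60–61)] -/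
def cycC (h : ω.IsB2a) (j : ℕ) : ℤ × ℤ :=
  if j % (2 * ω.2.firstHitG + 5) ≤ 2 * ω.2.firstHitG + 1 then (ω.pre h).vtx (j % (2 * ω.2.firstHitG + 5))
  else if j % (2 * ω.2.firstHitG + 5) = 2 * ω.2.firstHitG + 2 then (farW w).base + (2, 2)
  else if j % (2 * ω.2.firstHitG + 5) = 2 * ω.2.firstHitG + 3 then (farW w).base + (4, 2)
  else (farW w).base + (6, 2)

variable {ω}

/-- `C` is periodic. [folklore] -/
private theorem cycC_add (h : ω.IsB2a) (j : ℕ) : ω.cycC h (j + (2 * ω.2.firstHitG + 5)) = ω.cycC h j := by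
  unfold cycC; rw [Nat.add_mod_right]

/-- The walk part of `C`. [folklore] -/
private theorem cycC_of_le (h : ω.IsB2a) {j : ℕ} (hj : j ≤ 2 * ω.2.firstHitG + 1) : ω.cycC h j = (ω.pre h).vtx j := by
  unfold cycC; rw [Nat.mod_eq_of_lt (by omega), if_pos hj]

/-- The first closing vertex of `C`: the centre of the far cell. [folklore] -/
private theorem cycC_c₁ (h : ω.IsB2a) : ω.cycC h (2 * ω.2.firstHitG + 2) = (farW w).base + (2, 2) := by
  unfold cycC; rw [Nat.mod_eq_of_lt (by omega), if_neg (by omega), if_pos rfl]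

/-- The second closing vertex of `C`: the midpoint of the dead side. [folklore] -/
private theorem cycC_c₂ (h : ω.IsB2a) : ω.cycC h (2 * ω.2.firstHitG + 3) = (farW w).base + (4, 2) := by
  unfold cycC; rw [Nat.mod_eq_of_lt (by omega), if_neg (by omega), if_neg (by omega), if_pos rfl]

/-- The third closing vertex of `C`: the centre of the hole. [folklore] -/
private theorem cycC_c₃ (h : ω.IsB2a) : ω.cycC h (2 * ω.2.firstHitG + 4) = (farW w).base + (6, 2) := by
  unfold cycC; rw [Nat.mod_eq_of_lt (by omega), if_neg (by omega), if_neg (by omega), if_neg (by omega)]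

/-- After the closing vertices `C` returns to the root midpoint. [folklore] -/
private theorem cycC_N (h : ω.IsB2a) : ω.cycC h (2 * ω.2.firstHitG + 5) = (farW w).base + (8, 2) := by
  rw [show 2 * ω.2.firstHitG + 5 = 0 + (2 * ω.2.firstHitG + 5) by ring, cycC_add, cycC_of_le h (by omega),
    pre_vtx_zero]

/-- … and then to the second vertex of the prefix. [folklore] -/
private theorem cycC_N1 (hh : holeFaceW w ∉ D) (h : ω.IsB2a) : ω.cycC h (2 * ω.2.firstHitG + 6) = (farW w).base + (9, 2) := by
  rw [show 2 * ω.2.firstHitG + 6 = 1 + (2 * ω.2.firstHitG + 5) by ring, cycC_add, cycC_of_le h (by omega),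
    pre_vtx_one hh h]

/-- The three closing vertices (values). [folklore] -/
private theorem cycC_closing (h : ω.IsB2a) {i : ℕ} (hi1 : 2 * ω.2.firstHitG + 2 ≤ i) (hi2 : i < 2 * ω.2.firstHitG + 5) :
    ∃ cx : ℤ, (cx = 2 ∨ cx = 4 ∨ cx = 6) ∧ ω.cycC h i = (farW w).base + (cx, 2) ∧ cx = 2 * (i - 2 * ω.2.firstHitG - 1) := by
  rcases (show i = 2 * ω.2.firstHitG + 2 ∨ i = 2 * ω.2.firstHitG + 3 ∨ i = 2 * ω.2.firstHitG + 4 by omega) with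
    rfl | rfl | rfl
  · exact ⟨2, Or.inl rfl, cycC_c₁ h, by omega⟩
  · exact ⟨4, Or.inr (Or.inl rfl), cycC_c₂ h, by omega⟩
  · exact ⟨6, Or.inr (Or.inr rfl), cycC_c₃ h, by omega⟩

/-- ★ Every vertex of `C` off a closing vertex is at squared distance `≥ 4` from it. [folklore] -/
private theorem four_le_dsq_cycC_closing (hh : holeFaceW w ∉ D) (h : ω.IsB2a) (hE : ω.2.firstSideG ≠ .E) {i j : ℕ}
    (hi1 : 2 * ω.2.firstHitG + 2 ≤ i) (hi2 : i < 2 * ω.2.firstHitG + 5) (hj : j < 2 * ω.2.firstHitG + 5) (hij : i ≠ j) :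
    4 ≤ dsq (ω.cycC h j) (ω.cycC h i) := by
  obtain ⟨cx, hcx, ei, ecx⟩ := cycC_closing h hi1 hi2
  rw [ei]
  rcases Nat.lt_or_ge j (2 * ω.2.firstHitG + 2) with hjw | hjc
  · rw [cycC_of_le h (by omega)]
    exact four_le_dsq_pre_vtx hh h hE (by omega) hcx
  · obtain ⟨cx', hcx', ej, ecx'⟩ := cycC_closing h hjc hj
    rw [ej, dsq_add_left]
    have hne : cx ≠ cx' := by omega
    simp only [dsq]
    rcases hcx with rfl | rfl | rfl <;> rcases hcx' with rfl | rfl | rfl <;> first | exact absurd rfl hne | norm_num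

/-- ★ Consecutive vertices of `C` are at squared distance `≤ 4`. [folklore] -/
private theorem dsq_cycC_succ_le (h : ω.IsB2a) {k : ℕ} (hk : k < 2 * ω.2.firstHitG + 5) :
    dsq (ω.cycC h k) (ω.cycC h (k + 1)) ≤ 4 := by
  have hlen := pre_length (ω := ω) h
  rcases Nat.lt_or_ge k (2 * ω.2.firstHitG + 1) with hkw | hkc
  · rw [cycC_of_le h hkw.le, cycC_of_le h (by omega)]
    exact dsq_vtx_succ_le (ω.pre h) (by rw [hlen]; omega)
  · rcases (show k = 2 * ω.2.firstHitG + 1 ∨ k = 2 * ω.2.firstHitG + 2 ∨ k = 2 * ω.2.firstHitG + 3 ∨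
        k = 2 * ω.2.firstHitG + 4 by omega) with rfl | rfl | rfl | rfl
    · rw [cycC_of_le h le_rfl, pre_vtx_last h, cycC_c₁ h, dsq_add_left]
      cases ω.2.firstSideG <;> simp [dsq, Side.offset]
    · rw [cycC_c₁ h, show 2 * ω.2.firstHitG + 2 + 1 = 2 * ω.2.firstHitG + 3 by ring, cycC_c₂ h, dsq_add_left]
      simp [dsq]
    · rw [cycC_c₂ h, show 2 * ω.2.firstHitG + 3 + 1 = 2 * ω.2.firstHitG + 4 by ring, cycC_c₃ h, dsq_add_left]
      simp [dsq]
    · rw [cycC_c₃ h, show 2 * ω.2.firstHitG + 4 + 1 = 2 * ω.2.firstHitG + 5 by ring, cycC_N h, dsq_add_left]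
      simp [dsq]

/-- ★ `C` is injective on a period. [folklore] -/
private theorem cycC_injective (hh : holeFaceW w ∉ D) (h : ω.IsB2a) (hE : ω.2.firstSideG ≠ .E) {i j : ℕ}
    (hi : i < 2 * ω.2.firstHitG + 5) (hj : j < 2 * ω.2.firstHitG + 5) (e : ω.cycC h i = ω.cycC h j) : i = j := by
  have hlen := pre_length (ω := ω) h
  have hfh := fh_pos ω
  by_contra hij
  rcases Nat.lt_or_ge i (2 * ω.2.firstHitG + 2) with hiw | hic
  · rcases Nat.lt_or_ge j (2 * ω.2.firstHitG + 2) with hjw | hjc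
    · rw [cycC_of_le h (by omega), cycC_of_le h (by omega)] at e
      exact hij (YBWalk.vtx_injective (γ := ω.pre h) (by rw [hlen]; omega) (by rw [hlen]; omega) (by rw [hlen]; exact hfh) e)
    · have h4 := four_le_dsq_cycC_closing hh h hE hjc hj hi (Ne.symm hij)
      rw [e] at h4; simp [dsq] at h4
  · have h4 := four_le_dsq_cycC_closing hh h hE hic hi hj hij
    rw [e] at h4; simp [dsq] at h4

/-- ★ **Hopf's hypothesis for `C`**: every edge is seen from every vertex off it under an angle `< π/2` — walk
against walk by the tree's `YBWalk.subtended`, everything else by distances (`≥ 4` to a closing vertex, `≤ 4` along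
an edge). [cite: Hopf1935, Nr. 2 (Umlaufsatz, p. 53) and Nr. 4 eq. (22) (curves with corners, pp. 60–61)] -/
theorem cycC_subtended (hh : holeFaceW w ∉ D) (h : ω.IsB2a) (hE : ω.2.firstSideG ≠ .E) {k j : ℕ}
    (hk : k < 2 * ω.2.firstHitG + 5) (hj : j < 2 * ω.2.firstHitG + 5) (h1 : ω.cycC h j ≠ ω.cycC h k)
    (h2 : ω.cycC h j ≠ ω.cycC h (k + 1)) : 0 < sdot (ω.cycC h k) (ω.cycC h (k + 1)) (ω.cycC h j) := by
  have hlen := pre_length (ω := ω) h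
  have hfh := fh_pos ω
  by_cases hall : k + 1 ≤ 2 * ω.2.firstHitG + 1 ∧ j ≤ 2 * ω.2.firstHitG + 1
  · -- walk against walk
    have ek : ω.cycC h k = (ω.pre h).vtx k := cycC_of_le h (by omega)
    have ek1 : ω.cycC h (k + 1) = (ω.pre h).vtx (k + 1) := cycC_of_le h hall.1
    have ej : ω.cycC h j = (ω.pre h).vtx j := cycC_of_le h hall.2
    rw [ej, ek] at h1
    rw [ej, ek1] at h2
    rw [ek, ek1, ej]
    refine YBWalk.subtended (γ := ω.pre h) (by rw [hlen]; omega) (by rw [hlen]; omega) ?_ ?_ (by rw [hlen]; exact hfh)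
    · intro e; exact h1 (by rw [e])
    · intro e; exact h2 (by rw [e])
  · apply sdot_pos_of_dsq
    have hAB := dsq_cycC_succ_le h hk
    rcases Nat.lt_or_ge j (2 * ω.2.firstHitG + 2) with hjw | hjc
    · -- the vertex is on the walk, so the edge has a closing endpoint
      have hk1 : 2 * ω.2.firstHitG + 1 ≤ k := by omega
      rcases Nat.lt_or_ge k (2 * ω.2.firstHitG + 2) with hkw | hkc
      · -- k = m: edge [vtx m, c₁]
        have hkm : k = 2 * ω.2.firstHitG + 1 := by omega
        subst hkm
        have hB := four_le_dsq_cycC_closing hh h hE (i := 2 * ω.2.firstHitG + 1 + 1) (by omega) (by omega) hj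
          (fun e => h2 (by rw [e]))
        have hA := one_le_dsq_of_ne (Ne.symm h1)
        rw [dsq_comm] at hB
        linarith
      · rcases Nat.lt_or_ge k (2 * ω.2.firstHitG + 4) with hk4 | hk4
        · -- both endpoints closing
          have hA := four_le_dsq_cycC_closing hh h hE hkc hk hj (fun e => h1 (by rw [e]))
          have hB := four_le_dsq_cycC_closing hh h hE (i := k + 1) (by omega) (by omega) hj (fun e => h2 (by rw [e]))
          rw [dsq_comm] at hA hB
          linarith
        · -- k = m+3: edge [c₃, vtx 0]
          have hkm : k = 2 * ω.2.firstHitG + 4 := by omega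
          subst hkm
          have hA := four_le_dsq_cycC_closing hh h hE (i := 2 * ω.2.firstHitG + 4) (by omega) (by omega) hj
            (fun e => h1 (by rw [e]))
          have hB := one_le_dsq_of_ne (Ne.symm h2)
          rw [dsq_comm] at hA
          linarith
    · -- the vertex is a closing vertex: both endpoints are `≥ 4` away
      have hA := four_le_dsq_cycC_closing hh h hE hjc hj hk (fun e => h1 (by rw [e]))
      have hB' : 4 ≤ dsq (ω.cycC h (k + 1)) (ω.cycC h j) := by
        rcases Nat.lt_or_ge (k + 1) (2 * ω.2.firstHitG + 5) with hk5 | hk5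
        · exact four_le_dsq_cycC_closing hh h hE hjc hj hk5 (fun e => h2 (by rw [e]))
        · have hk' : k + 1 = 0 + (2 * ω.2.firstHitG + 5) := by omega
          rw [hk', cycC_add]
          exact four_le_dsq_cycC_closing hh h hE hjc hj (by omega) (fun e => h2 (by rw [hk', cycC_add, e]))
      linarith

/-- `toC` of the difference of two translates. [folklore] -/
private theorem toC_add_sub_add (b u v : ℤ × ℤ) : toC (b + u) - toC (b + v) = toC (u - v) := by
  rw [← toC_sub, add_sub_add_left_eq_sub]

/-- ★ **The exterior angles of `C` add up to `WP(π/2) + π/2`** (first side `N`) **or `WP(π/2) − π/2`** (first side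
`S`): the walk part is the tree's `YBWalk.sum_ext_angles_eq_winding`; the closing corners contribute `0, ±π/2, 0, 0, 0`.
[cite: Hopf1935, Nr. 2 (Umlaufsatz, p. 53) and Nr. 4 eq. (22) (curves with corners, pp. 60–61)] -/
theorem sum_extAng_cycC (hh : holeFaceW w ∉ D) (h : ω.IsB2a) (hz : ω.2.firstSideG = .N ∨ ω.2.firstSideG = .S) :
    ∑ v ∈ Finset.range (2 * ω.2.firstHitG + 5), extAng (ω.cycC h) v =
      ω.WP (fun _ => π / 2) + (if ω.2.firstSideG = .N then π / 2 else -(π / 2)) := by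
  have hlen := pre_length (ω := ω) h
  have hπ := Real.pi_pos
  -- the walk part
  have hwalk : ∑ v ∈ Finset.range (2 * ω.2.firstHitG), extAng (ω.cycC h) v = ω.WP (fun _ => π / 2) := by
    rw [← pre_winding h, ← YBWalk.sum_ext_angles_eq_winding (γ := ω.pre h), hlen]
    refine Finset.sum_congr rfl fun v hv => ?_
    rw [Finset.mem_range] at hv
    simp only [extAng, YBWalk.cvtx, cycC_of_le h (show v ≤ 2 * ω.2.firstHitG + 1 by omega),
      cycC_of_le h (show v + 1 ≤ 2 * ω.2.firstHitG + 1 by omega), cycC_of_le h (show v + 2 ≤ 2 * ω.2.firstHitG + 1 by omega)]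
  rw [show 2 * ω.2.firstHitG + 5 = 2 * ω.2.firstHitG + 1 + 1 + 1 + 1 + 1 by ring, Finset.sum_range_succ,
    Finset.sum_range_succ, Finset.sum_range_succ, Finset.sum_range_succ, Finset.sum_range_succ, hwalk]
  -- the five closing corners
  have e0 : ω.cycC h (2 * ω.2.firstHitG) = (farW w).base + (ω.2.firstSideG.offset - ω.2.firstSideG.nIn) := by
    rw [cycC_of_le h (by omega), pre_vtx_penult hh h, add_sub_assoc]
  have e1 : ω.cycC h (2 * ω.2.firstHitG + 1) = (farW w).base + ω.2.firstSideG.offset := by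
    rw [cycC_of_le h le_rfl, pre_vtx_last h]
  have e2 := cycC_c₁ (ω := ω) h
  have e3 := cycC_c₂ (ω := ω) h
  have e4 := cycC_c₃ (ω := ω) h
  have e5 := cycC_N (ω := ω) h
  have e6 := cycC_N1 (ω := ω) hh h
  simp only [extAng]
  rw [show 2 * ω.2.firstHitG + 1 + 1 = 2 * ω.2.firstHitG + 2 by ring, show 2 * ω.2.firstHitG + 2 + 1 = 2 * ω.2.firstHitG + 3 by ring,
    show 2 * ω.2.firstHitG + 3 + 1 = 2 * ω.2.firstHitG + 4 by ring, show 2 * ω.2.firstHitG + 4 + 1 = 2 * ω.2.firstHitG + 5 by ring,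
    show 2 * ω.2.firstHitG + 2 + 2 = 2 * ω.2.firstHitG + 4 by ring, show 2 * ω.2.firstHitG + 3 + 2 = 2 * ω.2.firstHitG + 5 by ring,
    show 2 * ω.2.firstHitG + 4 + 2 = 2 * ω.2.firstHitG + 6 by ring, show 2 * ω.2.firstHitG + 1 + 2 = 2 * ω.2.firstHitG + 3 by ring,
    show 2 * ω.2.firstHitG + 2 = 2 * ω.2.firstHitG + 2 from rfl,
    e0, e1, e2, e3, e4, e5, e6]
  simp only [toC_add_sub_add]
  have a20 : Complex.arg (toC (((2 : ℤ), (0 : ℤ)))) = 0 := arg_toC_pos_zero (by norm_num)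
  have a10 : Complex.arg (toC (((1 : ℤ), (0 : ℤ)))) = 0 := arg_toC_pos_zero (by norm_num)
  have v42 : ((4 : ℤ), (2 : ℤ)) - ((2 : ℤ), (2 : ℤ)) = (2, 0) := by simp
  have v64 : ((6 : ℤ), (2 : ℤ)) - ((4 : ℤ), (2 : ℤ)) = (2, 0) := by simp
  have v86 : ((8 : ℤ), (2 : ℤ)) - ((6 : ℤ), (2 : ℤ)) = (2, 0) := by simp
  have v98 : ((9 : ℤ), (2 : ℤ)) - ((8 : ℤ), (2 : ℤ)) = (1, 0) := by simp
  rw [v42, v64, v86, v98, a20, a10]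
  rcases hz with hz | hz <;> rw [hz] <;> simp only [Side.offset, Side.nIn, reduceCtorEq, if_true, if_false]
  · -- first side N: vectors (0,-1), (0,-2)
    have u1 : ((2 : ℤ), (4 : ℤ)) - (((2 : ℤ), (4 : ℤ)) - ((0 : ℤ), (-1 : ℤ))) = (0, -1) := by simp
    have u2 : ((2 : ℤ), (2 : ℤ)) - ((2 : ℤ), (4 : ℤ)) = (0, -2) := by simp
    rw [u1, u2, show ((0 : ℤ), (-1 : ℤ)) = (0, -(1 : ℤ)) from rfl, show ((0 : ℤ), (-2 : ℤ)) = (0, -(2 : ℤ)) from rfl,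
      arg_toC_zero_neg one_pos, arg_toC_zero_neg two_pos]
    have t2 : (((0 : ℝ) : Real.Angle) - (((-(π / 2)) : ℝ) : Real.Angle)).toReal = π / 2 :=
      toReal_sub_coe (by ring) ⟨by linarith, by linarith⟩
    rw [t2]
    simp only [sub_self, Real.Angle.toReal_zero]
    ring
  · -- first side S: vectors (0,1), (0,2)
    have u1 : ((2 : ℤ), (0 : ℤ)) - (((2 : ℤ), (0 : ℤ)) - ((0 : ℤ), (1 : ℤ))) = (0, 1) := by simp
    have u2 : ((2 : ℤ), (2 : ℤ)) - ((2 : ℤ), (0 : ℤ)) = (0, 2) := by simp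
    rw [u1, u2, arg_toC_zero_pos one_pos, arg_toC_zero_pos two_pos]
    have t2 : (((0 : ℝ) : Real.Angle) - (((π / 2) : ℝ) : Real.Angle)).toReal = -(π / 2) :=
      toReal_sub_coe (by ring) ⟨by linarith, by linarith⟩
    rw [t2]
    simp only [sub_self, Real.Angle.toReal_zero]
    ring

/-- ★★ **THE PREFIX TURNS BY ONE OF TWO VALUES** (Hopf's Umlaufsatz for the closed prefix polygon): for a class-`B2a`
walk at the far cell of the hole root `w.side W` whose first side is `N`, the right-angle turning of the prefix is
`3π/2` (over the hole) or `−5π/2` (under the hole and once around the far cell); first side `S`: `−3π/2` or `5π/2`.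
[cite: Hopf1935, Nr. 2 (Umlaufsatz, p. 53) and Nr. 4 eq. (22) (curves with corners, pp. 60–61)] [cite: GlazmanManolescu2019, Lemma 2.1 (proof: [Gl])] -/
theorem WP_pi_div_two_mem (hh : holeFaceW w ∉ D) (h : ω.IsB2a) (hE : ω.2.firstSideG ≠ .E)
    (hz : ω.2.firstSideG = .N ∨ ω.2.firstSideG = .S) :
    (ω.2.firstSideG = .N → ω.WP (fun _ => π / 2) = 3 * π / 2 ∨ ω.WP (fun _ => π / 2) = -(5 * π / 2)) ∧
      (ω.2.firstSideG = .S → ω.WP (fun _ => π / 2) = 5 * π / 2 ∨ ω.WP (fun _ => π / 2) = -(3 * π / 2)) := by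
  have key := hopf_cyclic_int (ω.cycC h) (N := 2 * ω.2.firstHitG + 5) (by omega) (cycC_add h)
    (fun i j hi hj e => cycC_injective hh h hE hi hj e) (fun k j hk hj h1 h2 => cycC_subtended hh h hE hk hj h1 h2)
  rw [sum_extAng_cycC hh h hz] at key
  constructor
  · intro hN; rw [hN] at key; simp only [if_true] at key
    rcases key with e | e
    · left; linarith
    · right; linarith
  · intro hS; rw [hS] at key; simp only [reduceCtorEq, if_false] at key
    rcases key with e | e
    · left; linarith
    · right; linarith

end PrefixHopf

end ΩG

end Literature.Probability.RandomPlanarGeometry.SAW.YangBaxter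

/-! ## § Turning, concluded: the WHOLE-WALK POLYGON `Π` and the selection of the short turning

For a WOUND class-`B2a` walk at the far cell with the corner pattern `(N, W, S)` or `(S, W, N)` (first side, exit
side, return side), the whole walk — prefix, the arc inside `f`, the excursion — drawn through inner points and closed
through the far cell and the hole by `midPt(f.side z₂) → (3, 2 ∓ 1) → midPt(f.side E) → ctr h → midPt(w.side W)` is a
second simple lattice polygon `Π`. Its turning is `WP + arcTurn(z₀ → W) + WE ∓ π/2`, and for a WOUND walk the tree's
winding law (the sign law of Part A at `θ = π/2`) gives `WE = excursionWinding ∓ 4π`; Hopf's Umlaufsatz for `Π`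
then leaves `WP ∈ {3π/2, 11π/2}` (resp. `{−3π/2, −11π/2}`), and intersecting with the two values allowed by the
prefix polygon `C` pins `WP(π/2) = 3π/2` (first side `N`) resp. `−3π/2` (first side `S`). The straight patterns
`(N, S, W)`, `(S, N, W)` follow by reversal (`WP`, the first side and woundness are reversal invariant), and the
angle transfer `WP(θ) = WP(π/2) + (θ − π/2)` gives the turnings `π + θ` and `θ − 2π` of `FarCellTurningW`. -/

namespace Literature.Probability.RandomPlanarGeometry.SAW.YangBaxter

open Real Complex

section LatticeFacts2

/-- `|x| ≥ 2 ⇒ x² ≥ 4`. [folklore] -/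
private theorem four_le_sq_of_two_le {x : ℤ} (h : 2 ≤ x ∨ x ≤ -2) : 4 ≤ x ^ 2 := by
  rcases h with h | h <;> nlinarith

/-- Coordinates: an inner point of a face other than `f` and its `E`-neighbour is at squared distance `≥ 4` from every
point `f.base + (cx, cy)` with `1 ≤ cx ≤ 7`, `1 ≤ cy ≤ 3`. [folklore] -/
private theorem four_le_of_coords {k j k' j' ox oy cx cy : ℤ} (hox : 1 ≤ ox ∧ ox ≤ 3) (hoy : 1 ≤ oy ∧ oy ≤ 3)
    (hcx : 1 ≤ cx ∧ cx ≤ 7) (hcy : 1 ≤ cy ∧ cy ≤ 3) (hne : ¬(k = k' ∧ j = j')) (hne' : ¬(k = k' + 1 ∧ j = j')) :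
    4 ≤ (4 * k + ox - (4 * k' + cx)) ^ 2 + (4 * j + oy - (4 * j' + cy)) ^ 2 := by
  by_cases hj : j = j'
  · subst hj
    have hk : k ≠ k' := fun e => hne ⟨e, rfl⟩
    have hk' : k ≠ k' + 1 := fun e => hne' ⟨e, rfl⟩
    have h3 : 2 ≤ (4 * k + ox - (4 * k' + cx)) ∨ (4 * k + ox - (4 * k' + cx)) ≤ -2 := by omega
    nlinarith [four_le_sq_of_two_le h3, sq_nonneg (4 * j + oy - (4 * j + cy))]
  · have h3 : 2 ≤ (4 * j + oy - (4 * j' + cy)) ∨ (4 * j + oy - (4 * j' + cy)) ≤ -2 := by omega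
    nlinarith [four_le_sq_of_two_le h3, sq_nonneg (4 * k + ox - (4 * k' + cx))]

/-- ★ An inner point of a face `g ∉ {f, E-neighbour of f}` is at squared distance `≥ 4` from every point of the box
`f.base + [1,7] × [1,3]`. [folklore] -/
private theorem four_le_dsq_innerPt {g f : Face} (hg : g ≠ f) (hg' : g ≠ (f.1 + 1, f.2)) (s : Side) {cx cy : ℤ}
    (hcx : 1 ≤ cx ∧ cx ≤ 7) (hcy : 1 ≤ cy ∧ cy ≤ 3) : 4 ≤ dsq (innerPt g s) (f.base + (cx, cy)) := by
  obtain ⟨k, j⟩ := g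
  obtain ⟨k', j'⟩ := f
  have hb := inOff_bounds s
  have hne : ¬(k = k' ∧ j = j') := fun e => hg (Prod.ext e.1 e.2)
  have hne' : ¬(k = k' + 1 ∧ j = j') := fun e => hg' (Prod.ext e.1 e.2)
  simp only [dsq, innerPt, Face.base, Prod.fst_add, Prod.snd_add]
  exact four_le_of_coords ⟨hb.1, hb.2.1⟩ ⟨hb.2.2.1, hb.2.2.2⟩ hcx hcy hne hne'

/-- `opp` is an involution. [folklore] -/
private theorem side_opp_opp (s : Side) : s.opp.opp = s := by cases s <;> rfl

/-- `arg (x + x i) = π/4`, `arg (x − x i) = −π/4` for `x = 1` in `toC` form. [folklore] -/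
private theorem arg_toC_one_one : Complex.arg (toC ((1 : ℤ), (1 : ℤ))) = π / 4 := by
  rw [toC_mk]; push_cast; rw [one_mul]; exact arg_one_add_I

/-- `arg (1 − i) = −π/4` in `toC` form. [folklore] -/
private theorem arg_toC_one_neg_one : Complex.arg (toC ((1 : ℤ), (-1 : ℤ))) = -(π / 4) := by
  rw [toC_mk]; push_cast; rw [show (1 : ℂ) + -1 * Complex.I = 1 - Complex.I by ring]; exact arg_one_sub_I

end LatticeFacts2

namespace ΩG

variable {D : Set Face} {w : Face}

section WholeWalk

variable {ω : ΩG D (w.side .W) (farW w)} {hr : RootedFace D (w.side .W) (farW w)}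

/-- In class `B2a` the walk has at least `firstHitG + 3` arcs. [cite: Glazman2015WeightedSAW, Lemma 3.1 (proof, pp. 6–7)] -/
theorem fh_add_three_le (hr : RootedFace D (w.side .W) (farW w)) (h : ω.IsB2a) :
    ω.2.firstHitG + 3 ≤ ω.2.arcs.length := by
  have := ω.2.firstHit_add_three_le_returnHitG hr h.1; rw [h.2] at this; exact this

/-- **The arc inside the far cell**: face `f`, entry side `z₀`, exit side `z₁`.
[cite: Glazman2015WeightedSAW, Lemma 3.1 (proof, pp. 6–7: the classes of walks through a rhombus)] -/
theorem fc_firstHit_far (hr : RootedFace D (w.side .W) (farW w)) (h : ω.IsB2a) :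
    ω.2.fc ω.2.firstHitG = farW w ∧ ω.2.sIn ω.2.firstHitG = ω.2.firstSideG ∧ ω.2.sOut ω.2.firstHitG = ω.z1 hr h := by
  have hfh := ω.fh_lt h
  obtain ⟨hz01, -, -⟩ := ω.firstSide_exit_return_distinct hr h
  have hlen := ω.2.length_eq
  obtain ⟨hs, ht, -⟩ := YBWalk.side_sIn (γ := ω.2) hfh
  rw [← ω.2.nth_eq_getElem (by omega), ω.2.nth_firstHitG] at hs
  rw [← ω.2.nth_eq_getElem (by omega), (ω.2.exitSide_specG hr hfh).1] at ht
  have hface : ω.2.fc ω.2.firstHitG = farW w := by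
    have h1 := ω.2.arcFace_nth_eq_some_fcFR hfh
    rw [ω.2.nth_firstHitG, (ω.2.exitSide_specG hr hfh).1,
      arcFace_side_side (farW w) ω.2.firstSideG (ω.2.exitSideG hr hfh) hz01] at h1
    exact (Option.some_injective _ h1).symm
  refine ⟨hface, ?_, ?_⟩
  · rw [hface] at hs; exact Face.side_injective _ hs
  · rw [hface] at ht; exact Face.side_injective _ ht

/-- **The total turning splits at the far cell**: `winding = WP + arcTurn(θ_f; z₀, z₁) + WE`.
[cite: GlazmanManolescu2019, Lemma 2.1 (proof: [Gl])] -/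
theorem winding_eq_WP_add (hr : RootedFace D (w.side .W) (farW w)) (h : ω.IsB2a) (Θ : ℤ → ℝ) :
    ω.2.winding Θ = ω.WP Θ + arcTurn (Θ (farW w).1) ω.2.firstSideG (ω.z1 hr h) + ω.WE Θ := by
  have hfh := ω.fh_lt h
  obtain ⟨hfc, hsIn, hsOut⟩ := fc_firstHit_far hr h
  have hsplit : ω.2.arcs = ω.2.arcs.take ω.2.firstHitG ++ (ω.2.arcAt ω.2.firstHitG :: ω.2.arcs.drop (ω.2.firstHitG + 1)) := by
    rw [YBWalk.arcAt, List.getD_eq_getElem' hfh, ← List.drop_eq_getElem_cons hfh, List.take_append_drop]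
  have e1 : (ω.2.fc ω.2.firstHitG).1 = (farW w).1 := by rw [hfc]
  have e2 : sideIn (ω.2.arcAt ω.2.firstHitG) = ω.2.firstSideG := hsIn
  have e3 : sideOut (ω.2.arcAt ω.2.firstHitG) = ω.z1 hr h := hsOut
  unfold YBWalk.winding ΩG.WP ΩG.WE
  conv_lhs => rw [hsplit]
  rw [List.map_append, List.map_cons, List.sum_append, List.sum_cons,
    arcTurnOf_eq_arcTurn (YBWalk.arcFace_arcAt (γ := ω.2) hfh).1, e1, e2, e3]
  ring

/-- The vertices of the whole-walk polyline other than its ends are inner points `innerPt (fc i) s`, `s` the entry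
or exit side of the arc `i`. [folklore] -/
private theorem vtx_inner_of (γ : YBWalk D (w.side .W) ((farW w).side ω.1)) {j : ℕ} (hj1 : 1 ≤ j) (hj2 : j ≤ 2 * γ.arcs.length) :
    ∃ i, i < γ.arcs.length ∧ (γ.vtx j = innerPt (γ.fc i) (γ.sIn i) ∨ γ.vtx j = innerPt (γ.fc i) (γ.sOut i)) := by
  rcases YBWalk.index_cases (γ := γ) j (by omega) with h0 | ⟨i, hi, rfl⟩ | ⟨i, hi, rfl⟩ | h0
  · omega
  · exact ⟨i, hi, Or.inl (YBWalk.vtx_odd hi)⟩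
  · exact ⟨i, hi, Or.inr (YBWalk.vtx_even hi)⟩
  · omega

/-- The faces of the arcs other than the one inside the far cell are neither the far cell nor the hole.
[cite: Glazman2015WeightedSAW, Lemma 3.1 (proof, pp. 6–7)] -/
theorem fc_ne_far (hh : holeFaceW w ∉ D) (hr : RootedFace D (w.side .W) (farW w)) (h : ω.IsB2a) {i : ℕ}
    (hi : i < ω.2.arcs.length) (hne : i ≠ ω.2.firstHitG) :
    ω.2.fc i ∈ D ∧ ω.2.fc i ≠ farW w ∧ ω.2.fc i ≠ holeFaceW w := by
  have hD := (YBWalk.arcFace_arcAt (γ := ω.2) hi).2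
  refine ⟨hD, fun e => ?_, fun e => hh (e ▸ hD)⟩
  have h1 := ω.2.arcFace_nth_eq_some_fcFR hi
  rw [e] at h1
  rcases Nat.lt_or_gt_of_ne hne with hlt | hgt
  · exact ω.2.arcFace_ne_of_lt_firstHitG hlt hi h1
  · exact ω.2.arcFace_ne_of_excursionG hr h.1 hgt (by rw [h.2]; exact hi) h1

/-- The second vertex of a walk from the hole root: one unit east of the root midpoint. [folklore] -/
private theorem vtx_one_eq (hh : holeFaceW w ∉ D) {z : MidEdge} (γ : YBWalk D (w.side .W) z) (hn : 0 < γ.arcs.length) :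
    γ.vtx 1 = (farW w).base + (9, 2) := by
  have hlen := γ.length_eq
  obtain ⟨hs, -, -⟩ := YBWalk.side_sIn (γ := γ) (i := 0) hn
  rw [← γ.nth_eq_getElem (by omega), γ.nth_zero] at hs
  have hD := (YBWalk.arcFace_arcAt (γ := γ) hn).2
  have hcases := (Face.exists_side_eq_iff (γ.fc 0) (w.side .W)).1 ⟨_, hs⟩
  rw [root_faces_W] at hcases
  simp only at hcases
  rcases hcases with e | e
  · rw [e] at hD; exact absurd hD hh
  · rw [e] at hs
    have hsIn := Face.side_injective w hs
    have ev := YBWalk.vtx_odd (γ := γ) (i := 0) hn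
    rw [show 2 * 0 + 1 = 1 from rfl] at ev
    rw [ev, YBWalk.ptIn, e, hsIn, innerPt_eq, midPt_root_eq, add_assoc]
    rfl

variable (ω)

/-- **The closed whole-walk polygon `Π`** (period `2·n + 5`, `n` the number of arcs): the `2n + 2` vertices of the
walk polyline, then `f.base + (3,2) + z₀.nIn` (a corner-type point of the far cell next to its `E` side, on the
return side's half), the midpoint of the dead side, and the centre of the hole. [cite: Hopf1935, Nr. 2 (Umlaufsatz, p. 53) and Nr. 4 eq. (22) (curves with corners, pp. 60–61)] -/
def cycP (_h : ω.IsB2a) (j : ℕ) : ℤ × ℤ :=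
  if j % (2 * ω.2.arcs.length + 5) ≤ 2 * ω.2.arcs.length + 1 then ω.2.vtx (j % (2 * ω.2.arcs.length + 5))
  else if j % (2 * ω.2.arcs.length + 5) = 2 * ω.2.arcs.length + 2 then (farW w).base + ((3, 2) + ω.2.firstSideG.nIn)
  else if j % (2 * ω.2.arcs.length + 5) = 2 * ω.2.arcs.length + 3 then (farW w).base + (4, 2)
  else (farW w).base + (6, 2)

variable {ω}

/-- `Π` is periodic. [folklore] -/
private theorem cycP_add (h : ω.IsB2a) (j : ℕ) : ω.cycP h (j + (2 * ω.2.arcs.length + 5)) = ω.cycP h j := by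
  unfold cycP; rw [Nat.add_mod_right]

/-- The walk part of `Π`. [folklore] -/
private theorem cycP_of_le (h : ω.IsB2a) {j : ℕ} (hj : j ≤ 2 * ω.2.arcs.length + 1) : ω.cycP h j = ω.2.vtx j := by
  unfold cycP; rw [Nat.mod_eq_of_lt (by omega), if_pos hj]

/-- The first closing vertex of `Π`. [folklore] -/
private theorem cycP_q (h : ω.IsB2a) : ω.cycP h (2 * ω.2.arcs.length + 2) = (farW w).base + ((3, 2) + ω.2.firstSideG.nIn) := by
  unfold cycP; rw [Nat.mod_eq_of_lt (by omega), if_neg (by omega), if_pos rfl]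

/-- The second closing vertex of `Π`. [folklore] -/
private theorem cycP_c₂ (h : ω.IsB2a) : ω.cycP h (2 * ω.2.arcs.length + 3) = (farW w).base + (4, 2) := by
  unfold cycP; rw [Nat.mod_eq_of_lt (by omega), if_neg (by omega), if_neg (by omega), if_pos rfl]

/-- The third closing vertex of `Π`. [folklore] -/
private theorem cycP_c₃ (h : ω.IsB2a) : ω.cycP h (2 * ω.2.arcs.length + 4) = (farW w).base + (6, 2) := by
  unfold cycP; rw [Nat.mod_eq_of_lt (by omega), if_neg (by omega), if_neg (by omega), if_neg (by omega)]

/-- `Π` returns to the root midpoint. [folklore] -/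
private theorem cycP_N (h : ω.IsB2a) : ω.cycP h (2 * ω.2.arcs.length + 5) = (farW w).base + (8, 2) := by
  rw [show 2 * ω.2.arcs.length + 5 = 0 + (2 * ω.2.arcs.length + 5) by ring, cycP_add, cycP_of_le h (by omega),
    YBWalk.vtx_zero, midPt_root_eq]

/-- … and then to the second vertex of the walk. [folklore] -/
private theorem cycP_N1 (hh : holeFaceW w ∉ D) (h : ω.IsB2a) : ω.cycP h (2 * ω.2.arcs.length + 6) = (farW w).base + (9, 2) := by
  rw [show 2 * ω.2.arcs.length + 6 = 1 + (2 * ω.2.arcs.length + 5) by ring, cycP_add, cycP_of_le h (by omega),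
    vtx_one_eq hh ω.2 (by have := ω.fh_lt h; omega)]

/-- The last walk vertex of `Π`: the midpoint of the return side. [folklore] -/
private theorem cycP_last (h : ω.IsB2a) : ω.cycP h (2 * ω.2.arcs.length + 1) = (farW w).base + (ω.1).offset := by
  rw [cycP_of_le h le_rfl, YBWalk.vtx_last, midPt_far_side_eq]

/-- The last-but-one walk vertex of `Π`: one unit outside the return side, when the return side is opposite to the
first side. [folklore] -/
private theorem cycP_penult (hh : holeFaceW w ∉ D) (hr : RootedFace D (w.side .W) (farW w)) (h : ω.IsB2a)
    (h2 : ω.1 = ω.2.firstSideG.opp) :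
    ω.cycP h (2 * ω.2.arcs.length) = (farW w).base + ((ω.1).offset + ω.2.firstSideG.nIn) := by
  have h3 := fh_add_three_le hr h
  have hlen := ω.2.length_eq
  rw [cycP_of_le h (by omega)]
  have e := YBWalk.vtx_even (γ := ω.2) (i := ω.2.arcs.length - 1) (by omega)
  rw [show 2 * (ω.2.arcs.length - 1) + 2 = 2 * ω.2.arcs.length by omega] at e
  obtain ⟨-, ht, -⟩ := YBWalk.side_sIn (γ := ω.2) (i := ω.2.arcs.length - 1) (by omega)
  rw [← ω.2.nth_eq_getElem (by omega)] at ht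
  simp only [show ω.2.arcs.length - 1 + 1 = ω.2.arcs.length by omega] at ht
  rw [ω.2.nth_length] at ht
  have hs := side_eq_opp_of_side_eq ht (fc_ne_far hh hr h (by omega) (by omega)).2.1
  have hopp : ∀ s : Side, ω.1 = s.opp → (ω.1).opp = s := fun s hs' => by rw [hs', side_opp_opp]
  rw [e, YBWalk.ptOut, innerPt_eq, ht, hs, midPt_far_side_eq, hopp _ h2, add_assoc]

/-- ★ **Distances in `Π`, walk vertices against the closing points `(4,2)` and `(6,2)`**: at least `4` (squared).
[folklore] -/
private theorem four_le_dsq_vtx_c (hh : holeFaceW w ∉ D) (hr : RootedFace D (w.side .W) (farW w)) (h : ω.IsB2a)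
    (hz : ω.2.firstSideG = .N ∨ ω.2.firstSideG = .S) (h1 : ω.z1 hr h = .W) (h2 : ω.1 = ω.2.firstSideG.opp)
    {j : ℕ} (hj : j ≤ 2 * ω.2.arcs.length + 1) {cx : ℤ} (hcx : cx = 4 ∨ cx = 6) :
    4 ≤ dsq (ω.2.vtx j) ((farW w).base + (cx, 2)) := by
  rcases Nat.eq_zero_or_pos j with rfl | hj0
  · rw [YBWalk.vtx_zero, midPt_root_eq, dsq_add_left]
    exact four_le_dsq_root (by omega)
  rcases Nat.lt_or_ge j (2 * ω.2.arcs.length + 1) with hlt | hge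
  · obtain ⟨i, hi, e⟩ := vtx_inner_of ω.2 hj0 (by omega)
    by_cases hif : i = ω.2.firstHitG
    · subst hif
      obtain ⟨hfc, hsIn, hsOut⟩ := fc_firstHit_far hr h
      rw [hfc, hsIn, hsOut, h1] at e
      rcases e with e | e <;> rw [e, innerPt, dsq_add_left]
      · rcases hz with hz | hz <;> rw [hz] <;> rcases hcx with rfl | rfl <;> simp [dsq, Side.inOff, Side.offset, Side.nIn]
      · rcases hcx with rfl | rfl <;> simp [dsq, Side.inOff, Side.offset, Side.nIn]
    · obtain ⟨-, hf, hh'⟩ := fc_ne_far hh hr h hi hif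
      rw [holeFaceW_eq] at hh'
      rcases e with e | e <;> rw [e] <;> exact four_le_dsq_innerPt hf hh' _ (by omega) (by omega)
  · have hj' : j = 2 * ω.2.arcs.length + 1 := by omega
    subst hj'
    have hoff : ∀ s : Side, ω.1 = s.opp → (ω.1).offset = s.opp.offset := fun s hs' => by rw [hs']
    rw [YBWalk.vtx_last, midPt_far_side_eq, dsq_add_left, hoff _ h2]
    rcases hz with hz | hz <;> rw [hz] <;> rcases hcx with rfl | rfl <;> simp [dsq, Side.opp, Side.offset]

/-- ★ **Distances in `Π`, walk vertices other than the last against the first closing point** `(3,2) + z₀.nIn`: at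
least `4` (squared). [folklore] -/
private theorem four_le_dsq_vtx_q (hh : holeFaceW w ∉ D) (hr : RootedFace D (w.side .W) (farW w)) (h : ω.IsB2a)
    (hz : ω.2.firstSideG = .N ∨ ω.2.firstSideG = .S) (h1 : ω.z1 hr h = .W)
    {j : ℕ} (hj : j ≤ 2 * ω.2.arcs.length) :
    4 ≤ dsq (ω.2.vtx j) ((farW w).base + ((3, 2) + ω.2.firstSideG.nIn)) := by
  rcases Nat.eq_zero_or_pos j with rfl | hj0
  · rw [YBWalk.vtx_zero, midPt_root_eq, dsq_add_left]
    rcases hz with hz | hz <;> rw [hz] <;> simp [dsq, Side.nIn]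
  · obtain ⟨i, hi, e⟩ := vtx_inner_of ω.2 hj0 hj
    by_cases hif : i = ω.2.firstHitG
    · subst hif
      obtain ⟨hfc, hsIn, hsOut⟩ := fc_firstHit_far hr h
      rw [hfc, hsIn, hsOut, h1] at e
      rcases e with e | e <;> rw [e, innerPt, dsq_add_left]
      · rcases hz with hz | hz <;> rw [hz] <;> simp [dsq, Side.inOff, Side.offset, Side.nIn]
      · rcases hz with hz | hz <;> rw [hz] <;> simp [dsq, Side.inOff, Side.offset, Side.nIn]
    · obtain ⟨-, hf, hh'⟩ := fc_ne_far hh hr h hi hif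
      rw [holeFaceW_eq] at hh'
      rcases hz with hz | hz <;> rw [hz] <;> rcases e with e | e <;> rw [e] <;>
        exact four_le_dsq_innerPt hf hh' _ (by simp [Side.nIn]) (by simp [Side.nIn])

/-- The last walk vertex against the first closing point: squared distance `2`. [folklore] -/
private theorem dsq_last_q (h : ω.IsB2a) (hz : ω.2.firstSideG = .N ∨ ω.2.firstSideG = .S) (h2 : ω.1 = ω.2.firstSideG.opp) :
    dsq (ω.cycP h (2 * ω.2.arcs.length + 1)) (ω.cycP h (2 * ω.2.arcs.length + 2)) = 2 := by
  have hoff : ∀ s : Side, ω.1 = s.opp → (ω.1).offset = s.opp.offset := fun s hs' => by rw [hs']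
  rw [cycP_last h, cycP_q h, dsq_add_left, hoff _ h2]
  rcases hz with hz | hz <;> rw [hz] <;> simp [dsq, Side.opp, Side.offset, Side.nIn]

/-- Index classification for `Π`. [folklore] -/
private theorem idxP {n i : ℕ} (hi : i < 2 * n + 5) :
    i ≤ 2 * n + 1 ∨ i = 2 * n + 2 ∨ i = 2 * n + 3 ∨ i = 2 * n + 4 := by omega

/-- ★ **Master distance table of `Π`**: two distinct vertices one of which is a closing vertex are at squared distance
`≥ 2`, and `≥ 4` unless they are the last walk vertex and the first closing vertex, or the first two closing
vertices. [folklore] -/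
private theorem dsq_cycP_closing (hh : holeFaceW w ∉ D) (hr : RootedFace D (w.side .W) (farW w)) (h : ω.IsB2a)
    (hz : ω.2.firstSideG = .N ∨ ω.2.firstSideG = .S) (h1 : ω.z1 hr h = .W) (h2 : ω.1 = ω.2.firstSideG.opp)
    {i j : ℕ} (hi1 : 2 * ω.2.arcs.length + 2 ≤ i) (hi2 : i < 2 * ω.2.arcs.length + 5)
    (hj : j < 2 * ω.2.arcs.length + 5) (hij : i ≠ j) :
    2 ≤ dsq (ω.cycP h j) (ω.cycP h i) ∧
      (¬((j = 2 * ω.2.arcs.length + 1 ∧ i = 2 * ω.2.arcs.length + 2) ∨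
          (j = 2 * ω.2.arcs.length + 3 ∧ i = 2 * ω.2.arcs.length + 2) ∨
          (j = 2 * ω.2.arcs.length + 2 ∧ i = 2 * ω.2.arcs.length + 3)) →
        4 ≤ dsq (ω.cycP h j) (ω.cycP h i)) := by
  set n := ω.2.arcs.length with hn
  rcases (show i = 2 * n + 2 ∨ i = 2 * n + 3 ∨ i = 2 * n + 4 by omega) with rfl | rfl | rfl
  · -- i = q
    rcases idxP hj with hjw | rfl | rfl | rfl
    · rcases Nat.lt_or_ge j (2 * n + 1) with hjl | hjl
      · rw [cycP_q h, cycP_of_le h hjw]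
        have := four_le_dsq_vtx_q hh hr h hz h1 (j := j) (by omega)
        exact ⟨by omega, fun _ => this⟩
      · have hj' : j = 2 * n + 1 := by omega
        subst hj'
        rw [dsq_last_q h hz h2]
        exact ⟨le_rfl, fun hno => absurd (Or.inl ⟨rfl, rfl⟩) hno⟩
    · exact absurd rfl hij
    · rw [cycP_c₂ h, cycP_q h, dsq_add_left]
      refine ⟨?_, fun hno => absurd (Or.inr (Or.inl ⟨rfl, rfl⟩)) hno⟩
      rcases hz with hz | hz <;> rw [hz] <;> simp [dsq, Side.nIn]
    · rw [cycP_c₃ h, cycP_q h, dsq_add_left]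
      rcases hz with hz | hz <;> rw [hz] <;> simp [dsq, Side.nIn]
  · -- i = (4,2)
    rcases idxP hj with hjw | rfl | rfl | rfl
    · rw [cycP_c₂ h, cycP_of_le h hjw]
      have := four_le_dsq_vtx_c hh hr h hz h1 h2 hjw (cx := 4) (Or.inl rfl)
      exact ⟨by omega, fun _ => this⟩
    · rw [cycP_q h, cycP_c₂ h, dsq_add_left]
      refine ⟨?_, fun hno => absurd (Or.inr (Or.inr ⟨rfl, rfl⟩)) hno⟩
      rcases hz with hz | hz <;> rw [hz] <;> simp [dsq, Side.nIn]
    · exact absurd rfl hij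
    · rw [cycP_c₃ h, cycP_c₂ h, dsq_add_left]; simp [dsq]
  · -- i = (6,2)
    rcases idxP hj with hjw | rfl | rfl | rfl
    · rw [cycP_c₃ h, cycP_of_le h hjw]
      have := four_le_dsq_vtx_c hh hr h hz h1 h2 hjw (cx := 6) (Or.inr rfl)
      exact ⟨by omega, fun _ => this⟩
    · rw [cycP_q h, cycP_c₃ h, dsq_add_left]
      rcases hz with hz | hz <;> rw [hz] <;> simp [dsq, Side.nIn]
    · rw [cycP_c₂ h, cycP_c₃ h, dsq_add_left]; simp [dsq]
    · exact absurd rfl hij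

/-- ★ Consecutive vertices of `Π` are at squared distance `≤ 4`. [folklore] -/
private theorem dsq_cycP_succ_le (h : ω.IsB2a) (hz : ω.2.firstSideG = .N ∨ ω.2.firstSideG = .S) (h2 : ω.1 = ω.2.firstSideG.opp)
    {k : ℕ} (hk : k < 2 * ω.2.arcs.length + 5) : dsq (ω.cycP h k) (ω.cycP h (k + 1)) ≤ 4 := by
  rcases Nat.lt_or_ge k (2 * ω.2.arcs.length + 1) with hkw | hkc
  · rw [cycP_of_le h hkw.le, cycP_of_le h (by omega)]
    exact dsq_vtx_succ_le ω.2 (by omega)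
  · rcases (show k = 2 * ω.2.arcs.length + 1 ∨ k = 2 * ω.2.arcs.length + 2 ∨ k = 2 * ω.2.arcs.length + 3 ∨
        k = 2 * ω.2.arcs.length + 4 by omega) with rfl | rfl | rfl | rfl
    · rw [dsq_last_q h hz h2]; norm_num
    · rw [cycP_q h, show 2 * ω.2.arcs.length + 2 + 1 = 2 * ω.2.arcs.length + 3 by ring, cycP_c₂ h, dsq_add_left]
      rcases hz with hz | hz <;> rw [hz] <;> simp [dsq, Side.nIn]
    · rw [cycP_c₂ h, show 2 * ω.2.arcs.length + 3 + 1 = 2 * ω.2.arcs.length + 4 by ring, cycP_c₃ h, dsq_add_left]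
      simp [dsq]
    · rw [cycP_c₃ h, show 2 * ω.2.arcs.length + 4 + 1 = 2 * ω.2.arcs.length + 5 by ring, cycP_N h, dsq_add_left]
      simp [dsq]

/-- ★ `Π` is injective on a period. [folklore] -/
private theorem cycP_injective (hh : holeFaceW w ∉ D) (hr : RootedFace D (w.side .W) (farW w)) (h : ω.IsB2a)
    (hz : ω.2.firstSideG = .N ∨ ω.2.firstSideG = .S) (h1 : ω.z1 hr h = .W) (h2 : ω.1 = ω.2.firstSideG.opp)
    {i j : ℕ} (hi : i < 2 * ω.2.arcs.length + 5) (hj : j < 2 * ω.2.arcs.length + 5) (e : ω.cycP h i = ω.cycP h j) :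
    i = j := by
  have hn : 0 < ω.2.arcs.length := by have := ω.fh_lt h; omega
  by_contra hij
  rcases Nat.lt_or_ge i (2 * ω.2.arcs.length + 2) with hiw | hic
  · rcases Nat.lt_or_ge j (2 * ω.2.arcs.length + 2) with hjw | hjc
    · rw [cycP_of_le h (by omega), cycP_of_le h (by omega)] at e
      exact hij (YBWalk.vtx_injective (γ := ω.2) (by omega) (by omega) hn e)
    · have h4 := (dsq_cycP_closing hh hr h hz h1 h2 hjc hj hi (Ne.symm hij)).1
      rw [e] at h4; simp [dsq] at h4
  · have h4 := (dsq_cycP_closing hh hr h hz h1 h2 hic hi hj hij).1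
    rw [e] at h4; simp [dsq] at h4

/-- ★ **Hopf's hypothesis for `Π`.** [cite: Hopf1935, Nr. 2 (Umlaufsatz, p. 53) and Nr. 4 eq. (22) (curves with corners, pp. 60–61)] -/
theorem cycP_subtended (hh : holeFaceW w ∉ D) (hr : RootedFace D (w.side .W) (farW w)) (h : ω.IsB2a)
    (hz : ω.2.firstSideG = .N ∨ ω.2.firstSideG = .S) (h1 : ω.z1 hr h = .W) (h2 : ω.1 = ω.2.firstSideG.opp)
    {k j : ℕ} (hk : k < 2 * ω.2.arcs.length + 5) (hj : j < 2 * ω.2.arcs.length + 5)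
    (hne1 : ω.cycP h j ≠ ω.cycP h k) (hne2 : ω.cycP h j ≠ ω.cycP h (k + 1)) :
    0 < sdot (ω.cycP h k) (ω.cycP h (k + 1)) (ω.cycP h j) := by
  set n := ω.2.arcs.length with hn
  have hn0 : 0 < n := by have := ω.fh_lt h; omega
  by_cases hall : k + 1 ≤ 2 * n + 1 ∧ j ≤ 2 * n + 1
  · have ek : ω.cycP h k = ω.2.vtx k := cycP_of_le h (by omega)
    have ek1 : ω.cycP h (k + 1) = ω.2.vtx (k + 1) := cycP_of_le h hall.1
    have ej : ω.cycP h j = ω.2.vtx j := cycP_of_le h hall.2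
    rw [ej, ek] at hne1
    rw [ej, ek1] at hne2
    rw [ek, ek1, ej]
    refine YBWalk.subtended (γ := ω.2) (by omega) (by omega) ?_ ?_ hn0
    · intro e; exact hne1 (by rw [e])
    · intro e; exact hne2 (by rw [e])
  · apply sdot_pos_of_dsq
    have hAB := dsq_cycP_succ_le h hz h2 hk
    -- both `(k, j)` and `(k+1, j)` pairs are at squared distance ≥ 1; we show their sum is ≥ 5
    have hidx : ∀ {i : ℕ}, i < 2 * n + 5 → ω.cycP h j ≠ ω.cycP h i → (2 * n + 2 ≤ i ∨ 2 * n + 2 ≤ j) →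
        2 ≤ dsq (ω.cycP h i) (ω.cycP h j) ∧
          (¬((j = 2 * n + 1 ∧ i = 2 * n + 2) ∨ (j = 2 * n + 3 ∧ i = 2 * n + 2) ∨ (j = 2 * n + 2 ∧ i = 2 * n + 3) ∨
              (i = 2 * n + 1 ∧ j = 2 * n + 2) ∨ (i = 2 * n + 3 ∧ j = 2 * n + 2) ∨ (i = 2 * n + 2 ∧ j = 2 * n + 3)) →
            4 ≤ dsq (ω.cycP h i) (ω.cycP h j)) := by
      intro i hi hne hc
      have hij : i ≠ j := fun e => hne (by rw [e])
      rcases hc with hic | hjc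
      · obtain ⟨a, b⟩ := dsq_cycP_closing hh hr h hz h1 h2 hic hi hj hij
        rw [dsq_comm] at a
        exact ⟨a, fun hno => by rw [dsq_comm]; exact b fun hh' => hno (by omega)⟩
      · obtain ⟨a, b⟩ := dsq_cycP_closing hh hr h hz h1 h2 hjc hj hi (Ne.symm hij)
        exact ⟨a, fun hno => b fun hh' => hno (by omega)⟩
    have hk1' : ω.cycP h (k + 1) = ω.cycP h ((k + 1) % (2 * n + 5)) := by
      rcases Nat.lt_or_ge (k + 1) (2 * n + 5) with hlt | hge
      · rw [Nat.mod_eq_of_lt hlt]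
      · rw [show k + 1 = 0 + (2 * n + 5) by omega, cycP_add, Nat.add_mod_right, Nat.zero_mod]
    have hk1lt : (k + 1) % (2 * n + 5) < 2 * n + 5 := Nat.mod_lt _ (by omega)
    rw [hk1'] at hne2 hAB ⊢
    have hA1 : 1 ≤ dsq (ω.cycP h k) (ω.cycP h j) := one_le_dsq_of_ne (Ne.symm hne1)
    have hB1 : 1 ≤ dsq (ω.cycP h ((k + 1) % (2 * n + 5))) (ω.cycP h j) := one_le_dsq_of_ne (Ne.symm hne2)
    -- case analysis on which of the three indices is a closing index
    rcases Nat.lt_or_ge j (2 * n + 2) with hjw | hjc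
    · -- vertex on the walk ⇒ the edge is not a walk edge
      have hkc : 2 * n + 1 ≤ k := by omega
      rcases (show k = 2 * n + 1 ∨ k = 2 * n + 2 ∨ k = 2 * n + 3 ∨ k = 2 * n + 4 by omega) with rfl | rfl | rfl | rfl
      · -- edge [last walk vertex, q]: q is ≥ 4 from every other walk vertex
        have hm : (2 * n + 1 + 1) % (2 * n + 5) = 2 * n + 2 := Nat.mod_eq_of_lt (by omega)
        rw [hm] at hne2 hB1 hAB ⊢
        have hjne : j ≠ 2 * n + 1 := fun e => hne1 (by rw [e])
        have hB := (hidx (i := 2 * n + 2) (by omega) hne2 (Or.inl le_rfl)).2 (by omega)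
        linarith
      · have hm : (2 * n + 2 + 1) % (2 * n + 5) = 2 * n + 3 := Nat.mod_eq_of_lt (by omega)
        rw [hm] at hne2 hB1 hAB ⊢
        have hA := (hidx (i := 2 * n + 2) (by omega) hne1 (Or.inl le_rfl)).1
        have hB := (hidx (i := 2 * n + 3) (by omega) hne2 (Or.inl (by omega))).2 (by omega)
        linarith
      · have hm : (2 * n + 3 + 1) % (2 * n + 5) = 2 * n + 4 := Nat.mod_eq_of_lt (by omega)
        rw [hm] at hne2 hB1 hAB ⊢
        have hA := (hidx (i := 2 * n + 3) (by omega) hne1 (Or.inl (by omega))).2 (by omega)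
        linarith
      · have hm : (2 * n + 4 + 1) % (2 * n + 5) = 0 := by rw [show 2 * n + 4 + 1 = 2 * n + 5 by ring, Nat.mod_self]
        rw [hm] at hne2 hB1 hAB ⊢
        have hA := (hidx (i := 2 * n + 4) (by omega) hne1 (Or.inl (by omega))).2 (by omega)
        linarith
    · -- the vertex is a closing vertex: both pairs are ≥ 2, and ≥ 4 unless exceptional; exceptional pairs never
      -- occur twice on one edge
      have hA := hidx (i := k) hk hne1 (Or.inr hjc)
      have hB := hidx (i := (k + 1) % (2 * n + 5)) hk1lt hne2 (Or.inr hjc)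
      rcases (show j = 2 * n + 2 ∨ j = 2 * n + 3 ∨ j = 2 * n + 4 by omega) with rfl | rfl | rfl
      · -- j = q: exceptional partners 2n+1 and 2n+3; an edge containing both would be [2n+1, 2n+2]∌… fine
        by_cases hka : k = 2 * n + 1 ∨ k = 2 * n + 3
        · rcases hka with rfl | rfl
          · have hm : (2 * n + 1 + 1) % (2 * n + 5) = 2 * n + 2 := Nat.mod_eq_of_lt (by omega)
            rw [hm] at hne2; exact absurd rfl hne2
          · have hm : (2 * n + 3 + 1) % (2 * n + 5) = 2 * n + 4 := Nat.mod_eq_of_lt (by omega)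
            rw [hm] at hB hB1 hAB ⊢
            have := hB.2 (by omega); have := hA.1; linarith
        · push Not at hka
          have hA4 := hA.2 (by omega)
          have := hB.1; linarith
      · -- j = (4,2): exceptional partner 2n+2 only
        by_cases hka : k = 2 * n + 2
        · subst hka
          have hm : (2 * n + 2 + 1) % (2 * n + 5) = 2 * n + 3 := Nat.mod_eq_of_lt (by omega)
          rw [hm] at hne2; exact absurd rfl hne2
        · have hA4 := hA.2 (by omega)
          have := hB.1; linarith
      · -- j = (6,2): no exceptional partner
        have hA4 := hA.2 (by omega)
        have := hB.1; linarith

/-- ★ **The exterior angles of `Π` add up to `winding(π/2) − π/2`** (pattern `(N, W, S)`) **or `+ π/2`** (pattern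
`(S, W, N)`). [cite: Hopf1935, Nr. 2 (Umlaufsatz, p. 53) and Nr. 4 eq. (22) (curves with corners, pp. 60–61)] -/
theorem sum_extAng_cycP (hh : holeFaceW w ∉ D) (hr : RootedFace D (w.side .W) (farW w)) (h : ω.IsB2a)
    (hz : ω.2.firstSideG = .N ∨ ω.2.firstSideG = .S) (h2 : ω.1 = ω.2.firstSideG.opp) :
    ∑ v ∈ Finset.range (2 * ω.2.arcs.length + 5), extAng (ω.cycP h) v =
      ω.2.winding (fun _ => π / 2) + (if ω.2.firstSideG = .N then -(π / 2) else π / 2) := by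
  have hπ := Real.pi_pos
  have hwalk : ∑ v ∈ Finset.range (2 * ω.2.arcs.length), extAng (ω.cycP h) v = ω.2.winding (fun _ => π / 2) := by
    rw [← YBWalk.sum_ext_angles_eq_winding (γ := ω.2)]
    refine Finset.sum_congr rfl fun v hv => ?_
    rw [Finset.mem_range] at hv
    simp only [extAng, YBWalk.cvtx, cycP_of_le h (show v ≤ 2 * ω.2.arcs.length + 1 by omega),
      cycP_of_le h (show v + 1 ≤ 2 * ω.2.arcs.length + 1 by omega),
      cycP_of_le h (show v + 2 ≤ 2 * ω.2.arcs.length + 1 by omega)]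
  rw [show 2 * ω.2.arcs.length + 5 = 2 * ω.2.arcs.length + 1 + 1 + 1 + 1 + 1 by ring, Finset.sum_range_succ,
    Finset.sum_range_succ, Finset.sum_range_succ, Finset.sum_range_succ, Finset.sum_range_succ, hwalk]
  have e0 := cycP_penult hh hr h h2
  have e1 := cycP_last (ω := ω) h
  have e2 := cycP_q (ω := ω) h
  have e3 := cycP_c₂ (ω := ω) h
  have e4 := cycP_c₃ (ω := ω) h
  have e5 := cycP_N (ω := ω) h
  have e6 := cycP_N1 (ω := ω) hh h
  simp only [extAng]
  rw [show 2 * ω.2.arcs.length + 1 + 1 = 2 * ω.2.arcs.length + 2 by ring,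
    show 2 * ω.2.arcs.length + 2 + 1 = 2 * ω.2.arcs.length + 3 by ring,
    show 2 * ω.2.arcs.length + 3 + 1 = 2 * ω.2.arcs.length + 4 by ring,
    show 2 * ω.2.arcs.length + 4 + 1 = 2 * ω.2.arcs.length + 5 by ring,
    show 2 * ω.2.arcs.length + 2 + 2 = 2 * ω.2.arcs.length + 4 by ring,
    show 2 * ω.2.arcs.length + 3 + 2 = 2 * ω.2.arcs.length + 5 by ring,
    show 2 * ω.2.arcs.length + 4 + 2 = 2 * ω.2.arcs.length + 6 by ring,
    show 2 * ω.2.arcs.length + 1 + 2 = 2 * ω.2.arcs.length + 3 by ring,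
    e0, e1, e2, e3, e4, e5, e6]
  have hoff : ∀ s : Side, ω.1 = s.opp → (ω.1).offset = s.opp.offset := fun s hs' => by rw [hs']
  rw [hoff _ h2]
  simp only [toC_add_sub_add]
  have a20 : Complex.arg (toC (((2 : ℤ), (0 : ℤ)))) = 0 := arg_toC_pos_zero (by norm_num)
  have a10 : Complex.arg (toC (((1 : ℤ), (0 : ℤ)))) = 0 := arg_toC_pos_zero (by norm_num)
  have v64 : ((6 : ℤ), (2 : ℤ)) - ((4 : ℤ), (2 : ℤ)) = (2, 0) := by simp
  have v86 : ((8 : ℤ), (2 : ℤ)) - ((6 : ℤ), (2 : ℤ)) = (2, 0) := by simp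
  have v98 : ((9 : ℤ), (2 : ℤ)) - ((8 : ℤ), (2 : ℤ)) = (1, 0) := by simp
  rw [v64, v86, v98, a20, a10]
  rcases hz with hz | hz <;> rw [hz] <;> simp only [Side.opp, Side.offset, Side.nIn, reduceCtorEq, if_true, if_false]
  · -- pattern (N, W, S): in (0,1), then (1,1), (1,1), (2,0), (2,0), (1,0)
    have u1 : ((2 : ℤ), (0 : ℤ)) - (((2 : ℤ), (0 : ℤ)) + ((0 : ℤ), (-1 : ℤ))) = (0, 1) := by simp
    have u2 : ((3 : ℤ), (2 : ℤ)) + ((0 : ℤ), (-1 : ℤ)) - ((2 : ℤ), (0 : ℤ)) = (1, 1) := by simp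
    have u3 : ((4 : ℤ), (2 : ℤ)) - (((3 : ℤ), (2 : ℤ)) + ((0 : ℤ), (-1 : ℤ))) = (1, 1) := by simp
    rw [u1, u2, u3, arg_toC_zero_pos one_pos, arg_toC_one_one]
    have t1 : (((π / 4 : ℝ) : Real.Angle) - (((π / 2) : ℝ) : Real.Angle)).toReal = -(π / 4) :=
      toReal_sub_coe (by ring) ⟨by linarith, by linarith⟩
    have t3 : (((0 : ℝ) : Real.Angle) - (((π / 4) : ℝ) : Real.Angle)).toReal = -(π / 4) :=
      toReal_sub_coe (by ring) ⟨by linarith, by linarith⟩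
    rw [t1, t3]
    simp only [sub_self, Real.Angle.toReal_zero]
    ring
  · -- pattern (S, W, N): in (0,-1), then (1,-1), (1,-1), (2,0), (2,0), (1,0)
    have u1 : ((2 : ℤ), (4 : ℤ)) - (((2 : ℤ), (4 : ℤ)) + ((0 : ℤ), (1 : ℤ))) = (0, -(1 : ℤ)) := by simp
    have u2 : ((3 : ℤ), (2 : ℤ)) + ((0 : ℤ), (1 : ℤ)) - ((2 : ℤ), (4 : ℤ)) = (1, -1) := by simp
    have u3 : ((4 : ℤ), (2 : ℤ)) - (((3 : ℤ), (2 : ℤ)) + ((0 : ℤ), (1 : ℤ))) = (1, -1) := by simp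
    rw [u1, u2, u3, arg_toC_zero_neg one_pos, arg_toC_one_neg_one]
    have t1 : (((-(π / 4) : ℝ) : Real.Angle) - (((-(π / 2)) : ℝ) : Real.Angle)).toReal = π / 4 :=
      toReal_sub_coe (by ring) ⟨by linarith, by linarith⟩
    have t3 : (((0 : ℝ) : Real.Angle) - (((-(π / 4)) : ℝ) : Real.Angle)).toReal = π / 4 :=
      toReal_sub_coe (by ring) ⟨by linarith, by linarith⟩
    rw [t1, t3]
    simp only [sub_self, Real.Angle.toReal_zero]
    ring

/-- ★★ **Hopf for `Π`**: for the corner patterns, `winding(π/2) ∓ π/2 = ±2π`. [cite: Hopf1935, Nr. 2 (Umlaufsatz, p. 53) and Nr. 4 eq. (22) (curves with corners, pp. 60–61)] -/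
theorem winding_pi_div_two_corner (hh : holeFaceW w ∉ D) (hr : RootedFace D (w.side .W) (farW w)) (h : ω.IsB2a)
    (hz : ω.2.firstSideG = .N ∨ ω.2.firstSideG = .S) (h1 : ω.z1 hr h = .W) (h2 : ω.1 = ω.2.firstSideG.opp) :
    ω.2.winding (fun _ => π / 2) + (if ω.2.firstSideG = .N then -(π / 2) else π / 2) = 2 * π ∨
      ω.2.winding (fun _ => π / 2) + (if ω.2.firstSideG = .N then -(π / 2) else π / 2) = -(2 * π) := by
  have key := hopf_cyclic_int (ω.cycP h) (N := 2 * ω.2.arcs.length + 5) (by omega) (cycP_add h)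
    (fun i j hi hj e => cycP_injective hh hr h hz h1 h2 hi hj e)
    (fun k j hk hj hne1 hne2 => cycP_subtended hh hr h hz h1 h2 hk hj hne1 hne2)
  rwa [sum_extAng_cycP hh hr h hz h2] at key

/-- ★★★ **THE SHORT TURNING IS FORCED (corner patterns).** For a WOUND class-`B2a` walk at the far cell of the hole
root `w.side W` with pattern `(N, W, S)`: `WP(π/2) = 3π/2`; with pattern `(S, W, N)`: `WP(π/2) = −3π/2`.
[cite: Hopf1935, Nr. 2 (Umlaufsatz, p. 53) and Nr. 4 eq. (22) (curves with corners, pp. 60–61)] [cite: GlazmanManolescu2019, Lemma 2.1 (proof: [Gl])]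
[cite: DuminilCopinSmirnov2012, proof of Lemma 1 (the winding bookkeeping)] -/
theorem WP_pi_div_two_eq_corner (hh : holeFaceW w ∉ D) (hr : RootedFace D (w.side .W) (farW w)) (h : ω.IsB2a)
    (hz : ω.2.firstSideG = .N ∨ ω.2.firstSideG = .S) (h1 : ω.z1 hr h = .W) (h2 : ω.1 = ω.2.firstSideG.opp)
    (hW : ω.WE (fun _ => π / 2) ≠ excursionWinding (π / 2) ω.2.firstSideG (ω.z1 hr h) ω.1) :
    (ω.2.firstSideG = .N → ω.WP (fun _ => π / 2) = 3 * π / 2) ∧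
      (ω.2.firstSideG = .S → ω.WP (fun _ => π / 2) = -(3 * π / 2)) := by
  have hE : ω.2.firstSideG ≠ .E := by rcases hz with hz | hz <;> rw [hz] <;> decide
  obtain ⟨hCN, hCS⟩ := WP_pi_div_two_mem hh h hE hz
  have hP := winding_pi_div_two_corner hh hr h hz h1 h2
  rw [winding_eq_WP_add hr h] at hP
  -- the excursion winding of a wound walk, from the sign law
  have hWE : ω.WE (fun _ => π / 2) - excursionWinding (π / 2) ω.2.firstSideG (ω.z1 hr h) ω.1 =
      4 * π * chordSign ω.2.firstSideG (ω.z1 hr h) ω.1 := by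
    rcases ω.sign_law hr h (π / 2) with ⟨hWE, -⟩ | ⟨hWE, -⟩
    · exact absurd hWE hW
    · exact hWE
  rw [h1] at hWE hP
  constructor
  · intro hN
    have hω1 : ω.1 = .S := by rw [h2, hN]; rfl
    rw [hN] at hWE hP
    rw [hω1] at hWE
    simp only [excursionWinding, arcTurn, if_true, show (chordSign .N .W .S : ℤ) = -1 by decide] at hWE hP
    push_cast at hWE
    rcases hCN hN with hC | hC
    · exact hC
    · exfalso; rcases hP with e | e <;> linarith [Real.pi_pos]
  · intro hS
    have hω1 : ω.1 = .N := by rw [h2, hS]; rfl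
    rw [hS] at hWE hP
    rw [hω1] at hWE
    simp only [excursionWinding, arcTurn, reduceCtorEq, if_false, show (chordSign .S .W .N : ℤ) = 1 by decide]
      at hWE hP
    push_cast at hWE
    rcases hCS hS with hC | hC
    · exfalso; rcases hP with e | e <;> linarith [Real.pi_pos]
    · exact hC

end WholeWalk

end ΩG

end Literature.Probability.RandomPlanarGeometry.SAW.YangBaxter

namespace Literature.Probability.RandomPlanarGeometry.SAW.YangBaxter

open Real Complex

namespace ΩG

variable {D : Set Face} {w : Face} {ω : ΩG D (w.side .W) (farW w)}

section Assembly

/-- Side bookkeeping: a side other than `z₀ ∈ {N, S}`, `W` and `E` is the side opposite to `z₀`. [folklore] -/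
private theorem side_eq_opp_of_ne {z₀ s : Side} (hz : z₀ = .N ∨ z₀ = .S) (h0 : s ≠ z₀) (hW : s ≠ .W) (hE : s ≠ .E) :
    s = z₀.opp := by
  rcases hz with rfl | rfl <;> cases s <;> simp_all [Side.opp]

/-- Side bookkeeping: a side other than `z₀ ∈ {N, S}`, its opposite and `E` is `W`. [folklore] -/
private theorem side_eq_W_of_ne {z₀ s : Side} (hz : z₀ = .N ∨ z₀ = .S) (h0 : s ≠ z₀) (h1 : s ≠ z₀.opp) (hE : s ≠ .E) :
    s = .W := by
  rcases hz with rfl | rfl <;> cases s <;> simp_all [Side.opp]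

/-- **Woundness does not depend on the angle**: `WE(θ) − excursionWinding(θ; z₀, z₁, z₂)` is the same number at
every constant angle. [cite: GlazmanManolescu2019, Lemma 2.1 (proof: [Gl])] -/
theorem WE_sub_excursionWinding_const (hr : RootedFace D (w.side .W) (farW w)) (h : ω.IsB2a) (θ : ℝ) :
    ω.WE (fun _ => θ) - excursionWinding θ ω.2.firstSideG (ω.z1 hr h) ω.1 =
      ω.WE (fun _ => π / 2) - excursionWinding (π / 2) ω.2.firstSideG (ω.z1 hr h) ω.1 := by
  obtain ⟨hz01, hz02, hz12⟩ := ω.firstSide_exit_return_distinct hr h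
  have e1 := ω.WE_eq_WE_pi_div_two_add hr h (fun _ => θ)
  have e2 := excursionWinding_theta θ hz01 hz02 hz12
  unfold ΩG.z1 at e2 ⊢
  rw [e1, e2]; ring

/-- **The prefix turning at a general angle**: `WP(θ) = WP(π/2) + (θ − π/2)` when the first side is `N` or `S`
(the root is a vertical mid-edge, the first side a slanted one). [cite: GlazmanManolescu2019, Lemma 2.1 (proof: [Gl])] -/
theorem WP_const_eq (h : ω.IsB2a) (θ : ℝ) (hz : ω.2.firstSideG = .N ∨ ω.2.firstSideG = .S) :
    ω.WP (fun _ => θ) = ω.WP (fun _ => π / 2) + (θ - π / 2) := by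
  have e : slantPot (fun _ => θ) (ω.2.nth ω.2.firstHitG) = θ - π / 2 := by
    rw [ω.2.nth_firstHitG, slantPot_side]
    rcases hz with hz | hz <;> rw [hz] <;> simp [Side.slantInd]
  have e0 : slantPot (fun _ : ℤ => θ) (w.side .W) = 0 := by rw [slantPot_side]; simp [Side.slantInd]
  rw [← pre_winding h, ← pre_winding h, YBWalk.winding_eq_winding_pi_div_two_add (fun _ => θ) (ω.pre h), e, e0]
  ring

/-- ★★★ **THE SHORT TURNING IS FORCED (every wound walk).** For every WOUND class-`B2a` walk at the far cell of the
hole root `w.side W` (hole not in the domain): first side `N` ⇒ `WP(π/2) = 3π/2`, first side `S` ⇒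
`WP(π/2) = −3π/2`; the straight patterns are reduced to the corner patterns by reversal.
[cite: Hopf1935, Nr. 2 (Umlaufsatz, p. 53) and Nr. 4 eq. (22) (curves with corners, pp. 60–61)] [cite: GlazmanManolescu2019, Lemma 2.1 (proof: [Gl])]
[cite: DuminilCopinSmirnov2012, proof of Lemma 1 (the winding bookkeeping)] -/
theorem WP_pi_div_two_eq_of_wound (hh : holeFaceW w ∉ D) (hr : RootedFace D (w.side .W) (farW w)) (h : ω.IsB2a)
    (hW : ω.WE (fun _ => π / 2) ≠ excursionWinding (π / 2) ω.2.firstSideG (ω.z1 hr h) ω.1) :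
    (ω.2.firstSideG = .N → ω.WP (fun _ => π / 2) = 3 * π / 2) ∧
      (ω.2.firstSideG = .S → ω.WP (fun _ => π / 2) = -(3 * π / 2)) := by
  -- (R1): the first side is lateral
  have hNS : ω.2.firstSideG = .N ∨ ω.2.firstSideG = .S := by
    rcases ω.AJ_ne_zero_or_rev_of_wound hr h (π / 2) hW with hA | hA
    · exact firstSide_eq_N_or_S_of_wound hh ω hr h hA
    · have h'' := ω.rev_isB2a hr h
      have hNS := firstSide_eq_N_or_S_of_wound hh (ω.rev hr) hr h'' hA
      rwa [ω.rev_firstSide hr h] at hNS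
  obtain ⟨hz01, hz02, hz12⟩ := ω.firstSide_exit_return_distinct hr h
  have hdoors := ω.exit_return_doors hr h
  have hE1 : ω.z1 hr h ≠ .E := by
    intro e; rw [e, farW_side_E_faces] at hdoors; exact hh hdoors.1.2
  have hE2 : ω.1 ≠ .E := by
    intro e; rw [e, farW_side_E_faces] at hdoors; exact hh hdoors.2.2
  by_cases hc : ω.z1 hr h = .W
  · -- corner pattern
    have h2 : ω.1 = ω.2.firstSideG.opp :=
      side_eq_opp_of_ne hNS (Ne.symm hz02) (fun e => hz12 (hc.trans e.symm)) hE2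
    exact WP_pi_div_two_eq_corner hh hr h hNS hc h2 hW
  · -- straight pattern: the reversed companion has the corner pattern
    have hz1 : ω.z1 hr h = ω.2.firstSideG.opp := side_eq_opp_of_ne hNS (Ne.symm hz01) hc hE1
    have h1' : ω.1 = .W := side_eq_W_of_ne hNS (Ne.symm hz02) (fun e => hz12 (hz1.trans e.symm)) hE2
    have h'' := ω.rev_isB2a hr h
    have e1 : (ω.rev hr).z1 hr h'' = ω.1 := by unfold ΩG.z1; exact ω.rev_exitSide hr h
    have e2 : (ω.rev hr).1 = ω.z1 hr h := ω.rev_fst hr h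
    have e0 : (ω.rev hr).2.firstSideG = ω.2.firstSideG := ω.rev_firstSide hr h
    have hWr : (ω.rev hr).WE (fun _ => π / 2) ≠
        excursionWinding (π / 2) (ω.rev hr).2.firstSideG ((ω.rev hr).z1 hr h'') (ω.rev hr).1 := by
      rw [ω.rev_WE (fun _ => π / 2) hr h, e0, e1, e2, excursionWinding_swap]
      intro e; apply hW; linarith
    have key := WP_pi_div_two_eq_corner (ω := ω.rev hr) hh hr h'' (by rw [e0]; exact hNS) (by rw [e1]; exact h1')
      (by rw [e0, e2]; exact hz1) hWr
    rw [ω.rev_WP (fun _ => π / 2) hr h, e0] at key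
    exact key

/-- ★★★ **(R2) THE TURNING RIGIDITY OF THE PREFIX IS A THEOREM**: `FarCellTurningW D w θ` holds for every finite
face domain `D` not containing the hole `(w.1 − 1, w.2)` and every angle `θ` — a wound class-`B2a` walk at the far
cell entering from `N` has prefix turning `π + θ`, from `S` turning `θ − 2π`.
[cite: Hopf1935, Nr. 2 (Umlaufsatz, p. 53) and Nr. 4 eq. (22) (curves with corners, pp. 60–61)] [cite: GlazmanManolescu2019, Lemma 2.1 (proof: [Gl])]
[cite: DuminilCopinSmirnov2012, proof of Lemma 1 («we used the fact that a is on the boundary and Ω is simply connected»)] -/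
theorem farCellTurningW_holds (hh : holeFaceW w ∉ D) (θ : ℝ) : FarCellTurningW D w θ := by
  intro hr ω h hW
  have hW' : ω.WE (fun _ => π / 2) ≠ excursionWinding (π / 2) ω.2.firstSideG (ω.z1 hr h) ω.1 := by
    intro e; apply hW
    have := WE_sub_excursionWinding_const (ω := ω) hr h θ
    linarith
  have hNS : ω.2.firstSideG = .N ∨ ω.2.firstSideG = .S := by
    rcases ω.AJ_ne_zero_or_rev_of_wound hr h (π / 2) hW' with hA | hA
    · exact firstSide_eq_N_or_S_of_wound hh ω hr h hA
    · have h'' := ω.rev_isB2a hr h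
      have hNS := firstSide_eq_N_or_S_of_wound hh (ω.rev hr) hr h'' hA
      rwa [ω.rev_firstSide hr h] at hNS
  obtain ⟨hN, hS⟩ := WP_pi_div_two_eq_of_wound hh hr h hW'
  have htr := WP_const_eq (ω := ω) h θ hNS
  constructor
  · intro hz; rw [htr, hN hz]; ring
  · intro hz; rw [htr, hS hz]; ring

end Assembly

end ΩG

end Literature.Probability.RandomPlanarGeometry.SAW.YangBaxter

/-! ## § The far-cell law, UNCONDITIONAL -/

namespace Literature.Barriers.CriticalPhenomena.PlaquetteWalk

open Literature.Probability.RandomPlanarGeometry.SAW.YangBaxter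
open Real Complex

/-- ★★★★ **THE FAR-CELL LAW.** For every `θ ∈ [π/3, 2π/3]`, every finite face list `Dl`, every plaquette `w` whose
`W`-neighbour (the hole) is not in the domain while the face beyond it (the far cell `f`) is: the Yang–Baxter vertex
functional of the hole root `w.side W` at the far cell is `VF_D(w.side W, f) = i·v(θ)·(M_N − M_S)`, where
`M_N, M_S ≥ 0` are the total exterior weights of the WOUND class-`B2a` walks at `f` entering over resp. under the hole.
(Unconditional: the turning rigidity (R2) is `ΩG.farCellTurningW_holds`.) [cite: GlazmanManolescu2019, Lemma 2.1 (statement, "in the form given in [Gl]")]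
[cite: Glazman2015WeightedSAW, Lemma 3.1 (proof, pp. 6–7: the classes of walks through a rhombus)] [cite: DuminilCopinSmirnov2012, proof of Lemma 1]
[cite: Hopf1935, Nr. 2 (Umlaufsatz, p. 53) and Nr. 4 eq. (22) (curves with corners, pp. 60–61)] -/
theorem vertexFunctional_printed_farCellW_eq {θ : ℝ} (hθ : θ ∈ Set.Icc (π / 3) (2 * π / 3))
    (Dl : List Face) (w : Face) (hf : farW w ∈ Dl) (hh : holeFaceW w ∉ dom Dl)
    (hr : RootedFace (dom Dl) (w.side .W) (farW w)) :
    vertexFunctional (printedWeights θ) tFiveEighths (ybCoeff θ) Dl (w.side .W) (farW w) =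
      Complex.I * (weightV θ : ℂ) *
        (((∑ ω ∈ ΩG.setB2a (dom Dl) (w.side .W) (farW w), ΩG.routeMassW θ hr .N ω) -
          ∑ ω ∈ ΩG.setB2a (dom Dl) (w.side .W) (farW w), ΩG.routeMassW θ hr .S ω : ℝ) : ℂ) :=
  vertexFunctional_printed_farCellW_eq_of_turning hθ Dl w hf hh (ΩG.farCellTurningW_holds hh θ) hr

/-- ★★★ **THE FAR-CELL HALF LAW (H1), unconditional**: the Yang–Baxter vertex functional of a hole root at its far
cell is purely imaginary — the component of Glazman–Manolescu's vertex relation along the dead side's coefficient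
`c_E = 1` SURVIVES at the far cell of a hole root, for every `θ ∈ [π/3, 2π/3]` and every finite face domain (whereas
the relation itself fails there as soon as the two route masses differ). [cite: GlazmanManolescu2019, Lemma 2.1 (statement, "in the form given in [Gl]")]
[cite: Glazman2015WeightedSAW, Lemma 3.1 (proof, pp. 6–7)] [cite: Hopf1935, Nr. 2 (Umlaufsatz, p. 53) and Nr. 4 eq. (22) (curves with corners, pp. 60–61)] -/
theorem vertexFunctional_printed_farCellW_re_eq_zero {θ : ℝ} (hθ : θ ∈ Set.Icc (π / 3) (2 * π / 3))
    (Dl : List Face) (w : Face) (hf : farW w ∈ Dl) (hh : holeFaceW w ∉ dom Dl) :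
    (vertexFunctional (printedWeights θ) tFiveEighths (ybCoeff θ) Dl (w.side .W) (farW w)).re = 0 :=
  vertexFunctional_printed_farCellW_re_eq_zero_of_turning hθ Dl w hf hh (ΩG.farCellTurningW_holds hh θ)

/-- ★★★ **Vanishing at the far cell ⟺ equal route masses**, unconditional. [cite: GlazmanManolescu2019, Lemma 2.1 (statement, "in the form given in [Gl]")]
[cite: Glazman2015WeightedSAW, Lemma 3.1, eq. (1) (the weight v(θ))] [cite: Hopf1935, Nr. 2 (Umlaufsatz, p. 53) and Nr. 4 eq. (22) (curves with corners, pp. 60–61)] -/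
theorem vertexFunctional_printed_farCellW_eq_zero_iff {θ : ℝ} (hθ : θ ∈ Set.Icc (π / 3) (2 * π / 3))
    (Dl : List Face) (w : Face) (hf : farW w ∈ Dl) (hh : holeFaceW w ∉ dom Dl)
    (hr : RootedFace (dom Dl) (w.side .W) (farW w)) :
    vertexFunctional (printedWeights θ) tFiveEighths (ybCoeff θ) Dl (w.side .W) (farW w) = 0 ↔
      ∑ ω ∈ ΩG.setB2a (dom Dl) (w.side .W) (farW w), ΩG.routeMassW θ hr .N ω =
        ∑ ω ∈ ΩG.setB2a (dom Dl) (w.side .W) (farW w), ΩG.routeMassW θ hr .S ω :=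
  vertexFunctional_printed_farCellW_eq_zero_iff_of_turning hθ Dl w hf hh (ΩG.farCellTurningW_holds hh θ) hr

/-- ★★★ **A SUFFICIENT-HALF INSTANCE OF THE ENCIRCLING CRITERION AT A NON-ROOT PLAQUETTE, unconditional**: on the
open range `θ ∈ (π/3, 2π/3)`, if no wound class-`B2a` walk at the far cell entered under the hole while some wound
walk entered over it, the Yang–Baxter vertex identity FAILS at the far cell.
[cite: GlazmanManolescu2019, Lemma 2.1 (statement, "in the form given in [Gl]")] [cite: Glazman2015WeightedSAW, Lemma 3.1 (proof, pp. 6–7)]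
[cite: Hopf1935, Nr. 2 (Umlaufsatz, p. 53) and Nr. 4 eq. (22) (curves with corners, pp. 60–61)] -/
theorem vertexFunctional_printed_farCellW_ne_zero_of_over {θ : ℝ} (hθ : θ ∈ Set.Ioo (π / 3) (2 * π / 3))
    (Dl : List Face) (w : Face) (hf : farW w ∈ Dl) (hh : holeFaceW w ∉ dom Dl)
    (hr : RootedFace (dom Dl) (w.side .W) (farW w))
    (hnoS : ∀ (ω : ΩG (dom Dl) (w.side .W) (farW w)) (h : ω.IsB2a), ω.2.firstSideG = .S →
      ω.WE (fun _ => θ) = excursionWinding θ ω.2.firstSideG (ω.z1 hr h) ω.1)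
    (hN : ∃ (ω : ΩG (dom Dl) (w.side .W) (farW w)) (h : ω.IsB2a), ω.2.firstSideG = .N ∧
      ω.WE (fun _ => θ) ≠ excursionWinding θ ω.2.firstSideG (ω.z1 hr h) ω.1) :
    vertexFunctional (printedWeights θ) tFiveEighths (ybCoeff θ) Dl (w.side .W) (farW w) ≠ 0 :=
  vertexFunctional_printed_farCellW_ne_zero_of_over_only hθ Dl w hf hh (ΩG.farCellTurningW_holds hh θ) hr hnoS hN

end Literature.Barriers.CriticalPhenomena.PlaquetteWalk

/-! ## § The three doors of a wound walk at the far cell (b-step0 gen 17): the two-door zeros from the route masses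

A wound class-`B2a` walk at the far cell enters through `N` or `S` ((R1)), exits through a second side and returns
through a third, all three distinct and none of them the dead side `E`; each of these sides must have its OTHER face in
the domain (the tree's door lemmas `ΩG.firstSide_ne_dead`, `ΩG.exit_return_doors`). Hence `{z₀, z₁, z₂} = {N, S, W}`
and ALL THREE live neighbours of the far cell — `farNW w = (w.1 − 2, w.2 + 1)`, `farSW w = (w.1 − 2, w.2 − 1)`,
`farWW w = (w.1 − 3, w.2)` — lie in the domain (`ΩG.doors_of_wound_far`). If any one of them is absent, no class-`B2a`
walk at the far cell is wound, both route masses vanish and the printed vertex relation HOLDS at the far cell: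
`VF_D(a, far) = 0` for every `θ ∈ [π/3, 2π/3]` (`…_eq_zero_of_farNW_not_mem` / `_farSW_` / `_farWW_`). This recovers,
from the route-mass law, the catalogue's two-door zeros (`PlaquetteWalk.vertexFunctional_printed_eq_zero_of_two_doors`
in `YangBaxterSAWUnwoundPlaquette`) at these cells; new here is only the bookkeeping «a wound walk at the far cell uses
all three live doors». -/

namespace Literature.Probability.RandomPlanarGeometry.SAW.YangBaxter

open Real Complex

section FarCellNeighbours

/-- The cell SOUTH of the far cell (behind the far cell's door `S`, the under route's entrance).
[cite: GlazmanManolescu2019, §1 (the lattice of rhombi and its mid-edges)] -/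
def farSW (w : Face) : Face := (w.1 - 2, w.2 - 1)

/-- The cell NORTH of the far cell (behind the door `N`, the over route's entrance).
[cite: GlazmanManolescu2019, §1 (the lattice of rhombi and its mid-edges)] -/
def farNW (w : Face) : Face := (w.1 - 2, w.2 + 1)

/-- The cell WEST of the far cell (behind the door `W`). [cite: GlazmanManolescu2019, §1 (the lattice of rhombi and its mid-edges)] -/
def farWW (w : Face) : Face := (w.1 - 3, w.2)

/-- `farSW.N = far.S`. [cite: GlazmanManolescu2019, §1 (the lattice of rhombi and its mid-edges)] -/
theorem farSW_side_N (w : Face) : (farSW w).side .N = (farW w).side .S := by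
  obtain ⟨k, j⟩ := w; simp [farSW, farW, Face.side]

/-- `farNW.S = far.N`. [cite: GlazmanManolescu2019, §1 (the lattice of rhombi and its mid-edges)] -/
theorem farNW_side_S (w : Face) : (farNW w).side .S = (farW w).side .N := by
  obtain ⟨k, j⟩ := w; simp [farNW, farW, Face.side]

/-- The faces of the far cell's door `N`. [cite: GlazmanManolescu2019, §1 (the lattice of rhombi and its mid-edges)] -/
theorem farW_side_N_faces (w : Face) : ((farW w).side .N).faces = (farW w, farNW w) := by
  obtain ⟨k, j⟩ := w; simp [farNW, farW, Face.side, MidEdge.faces]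

/-- The faces of the far cell's door `S`. [cite: GlazmanManolescu2019, §1 (the lattice of rhombi and its mid-edges)] -/
theorem farW_side_S_faces (w : Face) : ((farW w).side .S).faces = (farSW w, farW w) := by
  obtain ⟨k, j⟩ := w; simp [farSW, farW, Face.side, MidEdge.faces]

/-- The faces of the far cell's door `W`. [cite: GlazmanManolescu2019, §1 (the lattice of rhombi and its mid-edges)] -/
theorem farW_side_W_faces (w : Face) : ((farW w).side .W).faces = (farWW w, farW w) := by
  obtain ⟨k, j⟩ := w
  simp only [farWW, farW, Face.side, MidEdge.faces, Prod.mk.injEq, and_true]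
  ring

end FarCellNeighbours

/-- Side bookkeeping: three distinct sides, the first in `{N, S}`, none of the other two `E`, fill `{N, S, W}`. [folklore] -/
private theorem three_doors_far {z0 z1 z2 : Side} (h0 : z0 = .N ∨ z0 = .S) (h01 : z0 ≠ z1) (h02 : z0 ≠ z2)
    (h12 : z1 ≠ z2) (h1E : z1 ≠ .E) (h2E : z2 ≠ .E) :
    (z1 = .W ∨ z2 = .W) ∧ (z0 = .N ∨ z1 = .N ∨ z2 = .N) ∧ (z0 = .S ∨ z1 = .S ∨ z2 = .S) := by
  rcases h0 with rfl | rfl <;> cases z1 <;> cases z2 <;> simp_all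

namespace ΩG

section FarCellDoors

variable {D : Set Face} {w : Face}

/-- ★ **Door `S` closed**: if the cell south of the far cell is not in the domain, no class-`B2a` walk at the far cell
entered it from `S`. [cite: GlazmanManolescu2019, Lemma 2.1 (proof: [Gl])] [cite: Glazman2015WeightedSAW, Lemma 3.1 (proof, pp. 6–7)] -/
theorem firstSide_ne_S_of_farSW (hg : farSW w ∉ D) (ω : ΩG D (w.side .W) (farW w))
    (hr : RootedFace D (w.side .W) (farW w)) (h : ω.IsB2a) : ω.2.firstSideG ≠ .S :=
  ω.firstSide_ne_deadFR hr h hg (farSW_side_N w) (farW_side_ne_root w)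

/-- ★ **Door `N` closed**: if the cell north of the far cell is not in the domain, no class-`B2a` walk at the far cell
entered it from `N`. [cite: GlazmanManolescu2019, Lemma 2.1 (proof: [Gl])] [cite: Glazman2015WeightedSAW, Lemma 3.1 (proof, pp. 6–7)] -/
theorem firstSide_ne_N_of_farNW (hg : farNW w ∉ D) (ω : ΩG D (w.side .W) (farW w))
    (hr : RootedFace D (w.side .W) (farW w)) (h : ω.IsB2a) : ω.2.firstSideG ≠ .N :=
  ω.firstSide_ne_deadFR hr h hg (farNW_side_S w) (farW_side_ne_root w)

/-- A wound class-`B2a` walk at the far cell entered it from `N` or from `S` ((R1), both orientations).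
[cite: GlazmanManolescu2019, Lemma 2.1 (proof: [Gl])] [cite: Glazman2015WeightedSAW, Lemma 3.1 (proof, pp. 6–7)] -/
theorem firstSide_eq_N_or_S_of_WE_ne (hh : holeFaceW w ∉ D) (ω : ΩG D (w.side .W) (farW w))
    (hr : RootedFace D (w.side .W) (farW w)) (h : ω.IsB2a) {θ : ℝ}
    (hW : ω.WE (fun _ => θ) ≠ excursionWinding θ ω.2.firstSideG (ω.z1 hr h) ω.1) :
    ω.2.firstSideG = .N ∨ ω.2.firstSideG = .S := by
  rcases ω.AJ_ne_zero_or_rev_of_wound hr h θ hW with hA | hA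
  · exact firstSide_eq_N_or_S_of_wound hh ω hr h hA
  · have h' := firstSide_eq_N_or_S_of_wound hh (ω.rev hr) hr (ω.rev_isB2a hr h) hA
    rwa [ω.rev_firstSide hr h] at h'

/-- ★★ **THREE-DOOR NECESSITY at the far cell.** A wound class-`B2a` walk at the far cell uses all three live doors:
the cells north, south and west of the far cell all lie in the domain.
[cite: GlazmanManolescu2019, Lemma 2.1 (proof: [Gl])] [cite: Glazman2015WeightedSAW, Lemma 3.1 (proof, pp. 6–7: the classes of walks through a rhombus)] -/
theorem doors_of_wound_far (hh : holeFaceW w ∉ D) (ω : ΩG D (w.side .W) (farW w))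
    (hr : RootedFace D (w.side .W) (farW w)) (h : ω.IsB2a) {θ : ℝ}
    (hW : ω.WE (fun _ => θ) ≠ excursionWinding θ ω.2.firstSideG (ω.z1 hr h) ω.1) :
    farNW w ∈ D ∧ farSW w ∈ D ∧ farWW w ∈ D := by
  obtain ⟨hz01, hz02, hz12⟩ := ω.firstSide_exit_return_distinct hr h
  have hdoors := ω.exit_return_doors hr h
  have hz0 := firstSide_eq_N_or_S_of_WE_ne hh ω hr h hW
  have h1E : ω.z1 hr h ≠ .E := by
    intro e; rw [e, farW_side_E_faces] at hdoors; exact hh hdoors.1.2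
  have h2E : ω.1 ≠ .E := by
    intro e; rw [e, farW_side_E_faces] at hdoors; exact hh hdoors.2.2
  obtain ⟨hWd, hNd, hSd⟩ := three_doors_far hz0 hz01 hz02 hz12 h1E h2E
  refine ⟨?_, ?_, ?_⟩
  · rcases hNd with e | e | e
    · by_contra hg; exact firstSide_ne_N_of_farNW hg ω hr h e
    · have t := hdoors.1.2; rw [e, farW_side_N_faces] at t; exact t
    · have t := hdoors.2.2; rw [e, farW_side_N_faces] at t; exact t
  · rcases hSd with e | e | e
    · by_contra hg; exact firstSide_ne_S_of_farSW hg ω hr h e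
    · have t := hdoors.1.1; rw [e, farW_side_S_faces] at t; exact t
    · have t := hdoors.2.1; rw [e, farW_side_S_faces] at t; exact t
  · rcases hWd with e | e
    · have t := hdoors.1.1; rw [e, farW_side_W_faces] at t; exact t
    · have t := hdoors.2.1; rw [e, farW_side_W_faces] at t; exact t

/-- With a door closed every route mass vanishes. [cite: GlazmanManolescu2019, Lemma 2.1 (proof: [Gl])] -/
theorem routeMassW_eq_zero_of_door_closed (hh : holeFaceW w ∉ D) (hg : farNW w ∉ D ∨ farSW w ∉ D ∨ farWW w ∉ D)
    (θ : ℝ) (hr : RootedFace D (w.side .W) (farW w)) (s : Side) (ω : ΩG D (w.side .W) (farW w)) :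
    routeMassW θ hr s ω = 0 := by
  unfold routeMassW
  split_ifs with h H
  · obtain ⟨h1, h2, h3⟩ := doors_of_wound_far hh ω hr h H.2
    rcases hg with hg | hg | hg
    · exact absurd h1 hg
    · exact absurd h2 hg
    · exact absurd h3 hg
  · rfl
  · rfl

end FarCellDoors

end ΩG

end Literature.Probability.RandomPlanarGeometry.SAW.YangBaxter

namespace Literature.Barriers.CriticalPhenomena.PlaquetteWalk

open Literature.Probability.RandomPlanarGeometry.SAW.YangBaxter
open Real Complex

/-- ★★ **A CLOSED DOOR KILLS THE FAR-CELL DEFECT.** If any of the three live neighbours of the far cell (north,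
south, west) is not in the domain, the printed Yang–Baxter vertex relation HOLDS at the far cell of the hole root, for
every `θ ∈ [π/3, 2π/3]` — the catalogue's two-door zero, recovered from the route masses.
[cite: GlazmanManolescu2019, Lemma 2.1 (statement, "in the form given in [Gl]")] [cite: Glazman2015WeightedSAW, Lemma 3.1 (proof, pp. 6–7)] -/
theorem vertexFunctional_printed_farCellW_eq_zero_of_door_closed {θ : ℝ} (hθ : θ ∈ Set.Icc (π / 3) (2 * π / 3))
    (Dl : List Face) (w : Face) (hf : farW w ∈ Dl) (hh : holeFaceW w ∉ dom Dl)
    (hg : farNW w ∉ dom Dl ∨ farSW w ∉ dom Dl ∨ farWW w ∉ dom Dl)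
    (hr : RootedFace (dom Dl) (w.side .W) (farW w)) :
    vertexFunctional (printedWeights θ) tFiveEighths (ybCoeff θ) Dl (w.side .W) (farW w) = 0 := by
  rw [vertexFunctional_printed_farCellW_eq_zero_iff hθ Dl w hf hh hr,
    Finset.sum_eq_zero (fun ω _ => ΩG.routeMassW_eq_zero_of_door_closed hh hg θ hr .N ω),
    Finset.sum_eq_zero (fun ω _ => ΩG.routeMassW_eq_zero_of_door_closed hh hg θ hr .S ω)]

/-- The far-cell defect vanishes when the cell NORTH of the far cell is absent. [cite: GlazmanManolescu2019, Lemma 2.1 (statement, "in the form given in [Gl]")] -/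
theorem vertexFunctional_printed_farCellW_eq_zero_of_farNW_not_mem {θ : ℝ} (hθ : θ ∈ Set.Icc (π / 3) (2 * π / 3))
    (Dl : List Face) (w : Face) (hf : farW w ∈ Dl) (hh : holeFaceW w ∉ dom Dl) (hg : farNW w ∉ dom Dl)
    (hr : RootedFace (dom Dl) (w.side .W) (farW w)) :
    vertexFunctional (printedWeights θ) tFiveEighths (ybCoeff θ) Dl (w.side .W) (farW w) = 0 :=
  vertexFunctional_printed_farCellW_eq_zero_of_door_closed hθ Dl w hf hh (Or.inl hg) hr

/-- The far-cell defect vanishes when the cell SOUTH of the far cell is absent. [cite: GlazmanManolescu2019, Lemma 2.1 (statement, "in the form given in [Gl]")] -/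
theorem vertexFunctional_printed_farCellW_eq_zero_of_farSW_not_mem {θ : ℝ} (hθ : θ ∈ Set.Icc (π / 3) (2 * π / 3))
    (Dl : List Face) (w : Face) (hf : farW w ∈ Dl) (hh : holeFaceW w ∉ dom Dl) (hg : farSW w ∉ dom Dl)
    (hr : RootedFace (dom Dl) (w.side .W) (farW w)) :
    vertexFunctional (printedWeights θ) tFiveEighths (ybCoeff θ) Dl (w.side .W) (farW w) = 0 :=
  vertexFunctional_printed_farCellW_eq_zero_of_door_closed hθ Dl w hf hh (Or.inr (Or.inl hg)) hr

/-- The far-cell defect vanishes when the cell WEST of the far cell is absent. [cite: GlazmanManolescu2019, Lemma 2.1 (statement, "in the form given in [Gl]")] -/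
theorem vertexFunctional_printed_farCellW_eq_zero_of_farWW_not_mem {θ : ℝ} (hθ : θ ∈ Set.Icc (π / 3) (2 * π / 3))
    (Dl : List Face) (w : Face) (hf : farW w ∈ Dl) (hh : holeFaceW w ∉ dom Dl) (hg : farWW w ∉ dom Dl)
    (hr : RootedFace (dom Dl) (w.side .W) (farW w)) :
    vertexFunctional (printedWeights θ) tFiveEighths (ybCoeff θ) Dl (w.side .W) (farW w) = 0 :=
  vertexFunctional_printed_farCellW_eq_zero_of_door_closed hθ Dl w hf hh (Or.inr (Or.inr hg)) hr

end Literature.Barriers.CriticalPhenomena.PlaquetteWalk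

/-! ## The HONEYCOMB POINT `θ = π/3` (edition 6; venture lane «pcv-sawmu», b-step0 gen 18)

At `θ = π/3` the printed weights are `(u₁, u₂, v, w₁, w₂) = (x_c, x_c², x_c², x_c², 0)`, `x_c = 1/√(2+√2)` (tree:
`weightU1_pi_div_three`, `weightU2/V/W1_pi_div_three`, `weightW2_pi_div_three`): «As explained in [Gl], if θ = π/3, then
w₂ = 0 and v = w₁ = u₂ = u₁². … The self-avoiding walk model described above becomes that on the hexagonal lattice dual to
the triangular one» [cite: GlazmanManolescu2019, §1 (the paragraph of Fig. 2)], «SAW on H(π/3) is identical to that on the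
hexagonal lattice with the weight of a path γ given by (√(2+√2))^{−|γ|}» [cite: GlazmanManolescu2019, §4 (first paragraph)] —
the self-avoiding walk of [cite: DuminilCopinSmirnov2012, §1 (x_c = 1/√(2+√2))] at its critical fugacity. A corner arc is ONE
honeycomb edge, a co-corner or straight arc TWO («the lengths of an arc spanning an angle θ is θ·3/π and the length of any
straight segment traversing a rhombus is 2. Notice that this definition is such that, when Θ is constant equal to π/3, the
length of a walk is the number of edges in its representation on the hexagonal lattice» [cite: GlazmanManolescu2019, §1 (before (4))]),
two corner arcs TWO, and a rhombus with two co-corner arcs is NOT a hexagonal self-avoiding walk (weight `w₂ = 0`).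
Specialising THE FAR-CELL LAW there:

* `YBWalk.W2FreeOff γ r` (no rhombus other than `r` carries two co-corner arcs), `YBWalk.hexEdgesOff γ r` (the number of
  honeycomb edges of `γ` off `r`, counted with the tree's `ArcKind.cost` of `YangBaxterSAWHexBridges` — whose
  `localWeight_pi_div_three` / `weight_hex_eq` are the weight half of the dictionary for the WHOLE walk; here the rhombus
  `r` is excluded), `YBWalk.extWeight_pi_div_three_eq_pow` / `_eq_zero` (the exterior weight at `π/3` is `x_c ^ hexEdgesOff`
  for a `w₂`-free walk and `0` otherwise), `ΩG.hexRouteMassW`, `ΩG.routeMassW_pi_div_three_eq`;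
* ★★★ `PlaquetteWalk.vertexFunctional_printed_farCellW_pi_div_three_eq` — **THE HONEYCOMB FAR-CELL LAW**: at `θ = π/3`
  the Yang–Baxter (there: Duminil-Copin–Smirnov) vertex functional of the hole root `w.side W` at its far cell is
  `i · x_c² · (Σ_over x_c^{ℓ(ω)} − Σ_under x_c^{ℓ(ω)})`, the sums running over the `w₂`-free WOUND class-`B2a` walks at
  the far cell entering it over (`N`) resp. under (`S`) the hole, `ℓ` = honeycomb length off the far cell;
* ★★ the **ROUTE KILL at the honeycomb point**: if every wound walk of ONE route passes a rhombus twice through its two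
  `(π − θ)`-corners (e.g. a width-one passage crossed by the prefix and again by the excursion) while the other route has a
  `w₂`-free wound walk, then `VF ≠ 0` at `θ = π/3` (`…_pi_div_three_ne_zero_of_under_killed` / `_of_over_killed`) — a
  sufficient-half instance of the encircling criterion with BOTH routes wound (venture lane, exact enumeration:
  `6 × 5 ∖ {(3,2), (0,4), (5,0), (1,0)}`, root `W` of `(4,2)`: 256 over / 320 under wound walks, ALL 320 under-walks carry a
  double co-corner rhombus; `6 × 5 ∖ {(2,2), (0,0), (4,2)}`, root `W` of `(3,2)`: 256 / 256, all under-walks marked);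
* ★★ the **HONEYCOMB ZERO**: if NO wound walk at the far cell is `w₂`-free, the vertex relation HOLDS at the far cell at
  `θ = π/3` (`…_pi_div_three_eq_zero_of_killed`) — a third species of exact zero of the hole-root defect beside the
  catalogue's two-door-cut zeros (`PlaquetteWalkHoleRootConfinement`) and mirror zeros (`PlaquetteWalkMirrorDuality`),
  specific to the angle `π/3` (lane datum: `6 × 5 ∖ {(3,2), (3,4), (5,3)}`, root `W` of `(4,2)`: no over-route, 288
  under-route wound walks all marked ⇒ `VF(π/3) = 0` while `VF(2π/3) ≠ 0`);
* the mirror statements at the DUAL HONEYCOMB POINT `θ = 2π/3` (`w₁ = 0`, `u₂ = x_c`, `u₁ = v = w₂ = x_c²`, tree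
  `weightW1_pi_sub` …): `YBWalk.W1FreeOff`, `…_two_pi_div_three_ne_zero_of_under_killed` / `_of_over_killed` /
  `…_two_pi_div_three_eq_zero_of_killed`;
* and the one-route twin of `…_ne_zero_of_over`: ★ `…_ne_zero_of_under` (no wound over-walk, some wound under-walk ⇒
  `VF ≠ 0` on the whole open range).
-/

namespace Literature.Probability.RandomPlanarGeometry.SAW.YangBaxter

open Real

section HoneycombPoint

/-- At `θ = π/3` the weight of every walk configuration of one rhombus other than the double co-corner one is `x_c` to
the number of honeycomb edges (the tree's `ArcKind.cost`: a corner arc ONE, a co-corner or straight arc TWO — «the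
lengths of an arc spanning an angle θ is θ·3/π and the length of any straight segment traversing a rhombus is 2 … when
Θ is constant equal to π/3, the length of a walk is the number of edges in its representation on the hexagonal
lattice»; the definite case of the tree's disjunction `localWeight_pi_div_three`). [cite: GlazmanManolescu2019, §1 (before (4))]
[cite: GlazmanManolescu2019, §1 (the paragraph of Fig. 2: «if θ = π/3, then w₂ = 0 and v = w₁ = u₂ = u₁²»)] -/
theorem localWeight_pi_div_three_eq_pow {l : List ArcKind}
    (hl : l = [] ∨ l = [.corner] ∨ l = [.coCorner] ∨ l = [.straight] ∨ l = [.corner, .corner]) :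
    localWeight (π / 3) l = hexCriticalFugacity ^ (l.map ArcKind.cost).sum := by
  rcases hl with rfl | rfl | rfl | rfl | rfl
  · simp [localWeight]
  · simp [localWeight, ArcKind.cost, weightU1_pi_div_three]
  · simp [localWeight, ArcKind.cost, weightU2_pi_div_three]
  · simp [localWeight, ArcKind.cost, weightV_pi_div_three]
  · simp [localWeight, ArcKind.cost, weightW1_pi_div_three]

/-- `2π/3 = π − π/3`. [folklore] -/
private theorem two_pi_div_three_eq_H : (2 * π / 3 : ℝ) = π - π / 3 := by ring

/-- At the dual honeycomb point `θ = 2π/3` the double corner configuration has weight `w₁(2π/3) = w₂(π/3) = 0`.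
[cite: GlazmanManolescu2019, §1, remark after eq. (1) («Replacing θ by π−θ, effectively exchanges u₁ with u₂ and w₁ with w₂, but does not affect v»)] -/
theorem localWeight_two_pi_div_three_two_corner : localWeight (2 * π / 3) [.corner, .corner] = 0 := by
  simp [localWeight, two_pi_div_three_eq_H, weightW1_pi_sub, weightW2_pi_div_three]

/-- At the dual honeycomb point `θ = 2π/3` every walk configuration of one rhombus other than the double corner one has
POSITIVE weight (`u₂ = x_c`, `u₁ = v = w₂ = x_c²`).
[cite: GlazmanManolescu2019, §1, remark after eq. (1) («Replacing θ by π−θ, effectively exchanges u₁ with u₂ and w₁ with w₂, but does not affect v»)] -/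
theorem localWeight_two_pi_div_three_pos {l : List ArcKind}
    (hl : l = [] ∨ l = [.corner] ∨ l = [.coCorner] ∨ l = [.straight] ∨ l = [.coCorner, .coCorner]) :
    0 < localWeight (2 * π / 3) l := by
  have hx : 0 < hexCriticalFugacity := hexCriticalFugacity_pos_lt_one.1
  rcases hl with rfl | rfl | rfl | rfl | rfl
  · simp [localWeight]
  · simp [localWeight, two_pi_div_three_eq_H, weightU1_pi_sub, weightU2_pi_div_three, hx]
  · simp [localWeight, two_pi_div_three_eq_H, weightU2_pi_sub, weightU1_pi_div_three, hx]
  · simp [localWeight, two_pi_div_three_eq_H, weightV_pi_sub, weightV_pi_div_three, hx]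
  · simp [localWeight, two_pi_div_three_eq_H, weightW2_pi_sub, weightW1_pi_div_three, hx]

namespace YBWalk

variable {D : Set Face} {a z : MidEdge}

/-- **`w₂`-free off `r`**: no rhombus other than `r` carries two co-corner arcs of the walk — at `θ = π/3`, the walk is a
genuine self-avoiding walk of the hexagonal lattice outside `r`. [cite: GlazmanManolescu2019, §1 (the paragraph of Fig. 2)] -/
def W2FreeOff (γ : YBWalk D a z) (r : Face) : Prop :=
  ∀ g ∈ γ.facesVisited, g ≠ r → γ.kindsIn g ≠ [.coCorner, .coCorner]

/-- **`w₁`-free off `r`**: no rhombus other than `r` carries two corner arcs of the walk (the dual condition, for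
`θ = 2π/3`). [cite: GlazmanManolescu2019, §1, remark after eq. (1)] -/
def W1FreeOff (γ : YBWalk D a z) (r : Face) : Prop :=
  ∀ g ∈ γ.facesVisited, g ≠ r → γ.kindsIn g ≠ [.corner, .corner]

/-- The honeycomb length of the walk off the rhombus `r`: the number of hexagonal-lattice edges of its arcs outside `r`.
[cite: GlazmanManolescu2019, §1 (before (4))] -/
def hexEdgesOff (γ : YBWalk D a z) (r : Face) : ℕ :=
  ∑ g ∈ γ.facesVisited.erase r, ((γ.kindsIn g).map ArcKind.cost).sum

/-- The six local configurations of a Yang–Baxter walk in a rhombus (the tree's `kindsL_shape`, restated for `kindsIn`).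
[cite: GlazmanManolescu2019, §1, Fig. 1] -/
theorem kindsIn_shape (γ : YBWalk D a z) (g : Face) :
    γ.kindsIn g = [] ∨ γ.kindsIn g = [.corner] ∨ γ.kindsIn g = [.coCorner] ∨ γ.kindsIn g = [.straight] ∨
      γ.kindsIn g = [.corner, .corner] ∨ γ.kindsIn g = [.coCorner, .coCorner] :=
  Literature.Barriers.CriticalPhenomena.PlaquetteWalk.kindsL_shape γ g

/-- At the honeycomb point a walk with a double co-corner rhombus off `r` has exterior weight `0`.
[cite: GlazmanManolescu2019, §1 (the paragraph of Fig. 2: «if θ = π/3, then w₂ = 0»)] -/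
theorem extWeight_pi_div_three_eq_zero (γ : YBWalk D a z) (r : Face) (h : ¬γ.W2FreeOff r) :
    γ.extWeight (fun _ => π / 3) r = 0 := by
  unfold W2FreeOff at h
  push Not at h
  obtain ⟨g, hg, hgr, hk⟩ := h
  unfold extWeight
  exact Finset.prod_eq_zero (Finset.mem_erase.2 ⟨hgr, hg⟩) (by rw [hk]; exact localWeight_pi_div_three_eq_zero (by simp))

/-- ★ At the honeycomb point the exterior weight of a `w₂`-free walk is `x_c` to its honeycomb length off `r`.
[cite: GlazmanManolescu2019, §4 (first paragraph: «SAW on H(π/3) is identical to that on the hexagonal lattice with the weight of a path γ given by (√(2+√2))^{−|γ|}»)] -/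
theorem extWeight_pi_div_three_eq_pow (γ : YBWalk D a z) (r : Face) (h : γ.W2FreeOff r) :
    γ.extWeight (fun _ => π / 3) r = hexCriticalFugacity ^ γ.hexEdgesOff r := by
  unfold extWeight hexEdgesOff
  rw [← Finset.prod_pow_eq_pow_sum]
  refine Finset.prod_congr rfl fun g hg => ?_
  obtain ⟨hgr, hgv⟩ := Finset.mem_erase.1 hg
  apply localWeight_pi_div_three_eq_pow
  rcases γ.kindsIn_shape g with e | e | e | e | e | e
  · exact Or.inl e
  · exact Or.inr (Or.inl e)
  · exact Or.inr (Or.inr (Or.inl e))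
  · exact Or.inr (Or.inr (Or.inr (Or.inl e)))
  · exact Or.inr (Or.inr (Or.inr (Or.inr e)))
  · exact absurd e (h g hgv hgr)

/-- At the honeycomb point a `w₂`-free walk has POSITIVE exterior weight. [cite: GlazmanManolescu2019, §4 (first paragraph)] -/
theorem extWeight_pi_div_three_pos (γ : YBWalk D a z) (r : Face) (h : γ.W2FreeOff r) :
    0 < γ.extWeight (fun _ => π / 3) r := by
  rw [γ.extWeight_pi_div_three_eq_pow r h]
  exact pow_pos hexCriticalFugacity_pos_lt_one.1 _

/-- At the dual honeycomb point `θ = 2π/3` a walk with a double corner rhombus off `r` has exterior weight `0`.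
[cite: GlazmanManolescu2019, §1, remark after eq. (1)] -/
theorem extWeight_two_pi_div_three_eq_zero (γ : YBWalk D a z) (r : Face) (h : ¬γ.W1FreeOff r) :
    γ.extWeight (fun _ => 2 * π / 3) r = 0 := by
  unfold W1FreeOff at h
  push Not at h
  obtain ⟨g, hg, hgr, hk⟩ := h
  unfold extWeight
  exact Finset.prod_eq_zero (Finset.mem_erase.2 ⟨hgr, hg⟩) (by rw [hk]; exact localWeight_two_pi_div_three_two_corner)

/-- At the dual honeycomb point `θ = 2π/3` a `w₁`-free walk has POSITIVE exterior weight.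
[cite: GlazmanManolescu2019, §1, remark after eq. (1)] -/
theorem extWeight_two_pi_div_three_pos (γ : YBWalk D a z) (r : Face) (h : γ.W1FreeOff r) :
    0 < γ.extWeight (fun _ => 2 * π / 3) r := by
  unfold extWeight
  refine Finset.prod_pos fun g hg => ?_
  obtain ⟨hgr, hgv⟩ := Finset.mem_erase.1 hg
  apply localWeight_two_pi_div_three_pos
  rcases γ.kindsIn_shape g with e | e | e | e | e | e
  · exact Or.inl e
  · exact Or.inr (Or.inl e)
  · exact Or.inr (Or.inr (Or.inl e))
  · exact Or.inr (Or.inr (Or.inr (Or.inl e)))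
  · exact absurd e (h g hgv hgr)
  · exact Or.inr (Or.inr (Or.inr (Or.inr e)))

end YBWalk

namespace ΩG

variable {D : Set Face} {w : Face}

open Classical in
/-- **The honeycomb route mass** of a walk at the far cell: `x_c ^ (honeycomb length off the far cell)` if the walk is of
class `B2a`, WOUND, first entered the far cell from the side `s` and is `w₂`-free off the far cell; else `0`.
[cite: GlazmanManolescu2019, §4 (first paragraph)] [cite: Glazman2015WeightedSAW, Lemma 3.1 (proof, pp. 6–7: the classes of walks through a rhombus)] -/
noncomputable def hexRouteMassW (hr : RootedFace D (w.side .W) (farW w)) (s : Side)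
    (ω : ΩG D (w.side .W) (farW w)) : ℝ :=
  if h : ω.IsB2a then
    (if ω.2.firstSideG = s ∧ ω.WE (fun _ => π / 3) ≠ excursionWinding (π / 3) ω.2.firstSideG (ω.z1 hr h) ω.1 ∧
        ω.2.W2FreeOff (farW w) then hexCriticalFugacity ^ ω.2.hexEdgesOff (farW w) else 0)
  else 0

/-- ★ At `θ = π/3` the route mass IS the honeycomb route mass. [cite: GlazmanManolescu2019, §4 (first paragraph)] -/
theorem routeMassW_pi_div_three_eq (hr : RootedFace D (w.side .W) (farW w)) (s : Side)
    (ω : ΩG D (w.side .W) (farW w)) : routeMassW (π / 3) hr s ω = hexRouteMassW hr s ω := by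
  unfold routeMassW hexRouteMassW
  by_cases h : ω.IsB2a
  · simp only [dif_pos h]
    by_cases hab : ω.2.firstSideG = s ∧
        ω.WE (fun _ => π / 3) ≠ excursionWinding (π / 3) ω.2.firstSideG (ω.z1 hr h) ω.1
    · rw [if_pos hab]
      by_cases hc : ω.2.W2FreeOff (farW w)
      · rw [if_pos ⟨hab.1, hab.2, hc⟩, ω.2.extWeight_pi_div_three_eq_pow _ hc]
      · rw [if_neg fun h3 => hc h3.2.2, ω.2.extWeight_pi_div_three_eq_zero _ hc]
    · rw [if_neg hab, if_neg fun h3 => hab ⟨h3.1, h3.2.1⟩]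
  · simp only [dif_neg h]

/-- The honeycomb route masses are non-negative. [cite: GlazmanManolescu2019, §4 (first paragraph)] -/
theorem hexRouteMassW_nonneg (hr : RootedFace D (w.side .W) (farW w)) (s : Side)
    (ω : ΩG D (w.side .W) (farW w)) : 0 ≤ hexRouteMassW hr s ω := by
  have hθ : (π / 3 : ℝ) ∈ Set.Icc (π / 3) (2 * π / 3) := ⟨le_rfl, by linarith [Real.pi_pos]⟩
  rw [← routeMassW_pi_div_three_eq]
  exact routeMassW_nonneg hθ hr s ω

/-- A route all of whose wound walks are `w₂`-marked has route mass ZERO at `θ = π/3`.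
[cite: GlazmanManolescu2019, §1 (the paragraph of Fig. 2: «if θ = π/3, then w₂ = 0»)] -/
theorem sum_routeMassW_pi_div_three_eq_zero_of_killed [Finite D] (hr : RootedFace D (w.side .W) (farW w)) (s : Side)
    (hK : ∀ (ω : ΩG D (w.side .W) (farW w)) (h : ω.IsB2a), ω.2.firstSideG = s →
      ω.WE (fun _ => π / 3) ≠ excursionWinding (π / 3) ω.2.firstSideG (ω.z1 hr h) ω.1 → ¬ω.2.W2FreeOff (farW w)) :
    ∑ ω ∈ setB2a D (w.side .W) (farW w), routeMassW (π / 3) hr s ω = 0 := by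
  classical
  refine Finset.sum_eq_zero fun ω _ => ?_
  unfold routeMassW
  split_ifs with h1 h2
  · exact ω.2.extWeight_pi_div_three_eq_zero _ (hK ω h1 h2.1 h2.2)
  · rfl
  · rfl

/-- A route with a `w₂`-free wound walk has POSITIVE route mass at `θ = π/3`. [cite: GlazmanManolescu2019, §4 (first paragraph)] -/
theorem sum_routeMassW_pi_div_three_pos_of_free [Finite D] (hr : RootedFace D (w.side .W) (farW w)) (s : Side)
    (hF : ∃ (ω : ΩG D (w.side .W) (farW w)) (h : ω.IsB2a), ω.2.firstSideG = s ∧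
      ω.WE (fun _ => π / 3) ≠ excursionWinding (π / 3) ω.2.firstSideG (ω.z1 hr h) ω.1 ∧ ω.2.W2FreeOff (farW w)) :
    0 < ∑ ω ∈ setB2a D (w.side .W) (farW w), routeMassW (π / 3) hr s ω := by
  classical
  have hθ : (π / 3 : ℝ) ∈ Set.Icc (π / 3) (2 * π / 3) := ⟨le_rfl, by linarith [Real.pi_pos]⟩
  obtain ⟨ω₀, h₀, hz₀, hW₀, hF₀⟩ := hF
  have hmem : ω₀ ∈ setB2a D (w.side .W) (farW w) := by
    simp only [setB2a, Finset.mem_filter, Finset.mem_univ, true_and]; exact h₀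
  refine lt_of_lt_of_le ?_ (Finset.single_le_sum (fun ω _ => routeMassW_nonneg hθ hr s ω) hmem)
  unfold routeMassW
  rw [dif_pos h₀, if_pos ⟨hz₀, hW₀⟩]
  exact ω₀.2.extWeight_pi_div_three_pos _ hF₀

/-- A route all of whose wound walks are `w₁`-marked has route mass ZERO at `θ = 2π/3`.
[cite: GlazmanManolescu2019, §1, remark after eq. (1)] -/
theorem sum_routeMassW_two_pi_div_three_eq_zero_of_killed [Finite D] (hr : RootedFace D (w.side .W) (farW w)) (s : Side)
    (hK : ∀ (ω : ΩG D (w.side .W) (farW w)) (h : ω.IsB2a), ω.2.firstSideG = s →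
      ω.WE (fun _ => 2 * π / 3) ≠ excursionWinding (2 * π / 3) ω.2.firstSideG (ω.z1 hr h) ω.1 →
        ¬ω.2.W1FreeOff (farW w)) :
    ∑ ω ∈ setB2a D (w.side .W) (farW w), routeMassW (2 * π / 3) hr s ω = 0 := by
  classical
  refine Finset.sum_eq_zero fun ω _ => ?_
  unfold routeMassW
  split_ifs with h1 h2
  · exact ω.2.extWeight_two_pi_div_three_eq_zero _ (hK ω h1 h2.1 h2.2)
  · rfl
  · rfl

/-- A route with a `w₁`-free wound walk has POSITIVE route mass at `θ = 2π/3`.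
[cite: GlazmanManolescu2019, §1, remark after eq. (1)] -/
theorem sum_routeMassW_two_pi_div_three_pos_of_free [Finite D] (hr : RootedFace D (w.side .W) (farW w)) (s : Side)
    (hF : ∃ (ω : ΩG D (w.side .W) (farW w)) (h : ω.IsB2a), ω.2.firstSideG = s ∧
      ω.WE (fun _ => 2 * π / 3) ≠ excursionWinding (2 * π / 3) ω.2.firstSideG (ω.z1 hr h) ω.1 ∧
        ω.2.W1FreeOff (farW w)) :
    0 < ∑ ω ∈ setB2a D (w.side .W) (farW w), routeMassW (2 * π / 3) hr s ω := by
  classical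
  have hθ : (2 * π / 3 : ℝ) ∈ Set.Icc (π / 3) (2 * π / 3) := ⟨by linarith [Real.pi_pos], le_rfl⟩
  obtain ⟨ω₀, h₀, hz₀, hW₀, hF₀⟩ := hF
  have hmem : ω₀ ∈ setB2a D (w.side .W) (farW w) := by
    simp only [setB2a, Finset.mem_filter, Finset.mem_univ, true_and]; exact h₀
  refine lt_of_lt_of_le ?_ (Finset.single_le_sum (fun ω _ => routeMassW_nonneg hθ hr s ω) hmem)
  unfold routeMassW
  rw [dif_pos h₀, if_pos ⟨hz₀, hW₀⟩]
  exact ω₀.2.extWeight_two_pi_div_three_pos _ hF₀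

end ΩG

end HoneycombPoint

end Literature.Probability.RandomPlanarGeometry.SAW.YangBaxter

namespace Literature.Barriers.CriticalPhenomena.PlaquetteWalk

open Literature.Probability.RandomPlanarGeometry.SAW.YangBaxter
open Literature.Probability.RandomPlanarGeometry.SAW (hexCriticalFugacity)
open Real Complex

/-- `π/3` lies in the printed range. [folklore] -/
private theorem pi_div_three_mem_Icc_H : (π / 3 : ℝ) ∈ Set.Icc (π / 3) (2 * π / 3) :=
  ⟨le_rfl, by linarith [Real.pi_pos]⟩

/-- `2π/3` lies in the printed range. [folklore] -/
private theorem two_pi_div_three_mem_Icc_H : (2 * π / 3 : ℝ) ∈ Set.Icc (π / 3) (2 * π / 3) :=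
  ⟨by linarith [Real.pi_pos], le_rfl⟩

/-- ★★★ **THE HONEYCOMB FAR-CELL LAW.** At `θ = π/3` — where the Yang–Baxter walk is the self-avoiding walk of the
hexagonal lattice at `x_c = 1/√(2+√2)` and the vertex relation is Duminil-Copin–Smirnov's — the vertex functional of the
hole root `w.side W` at its far cell is `i · x_c² · (Σ_over x_c^{ℓ(ω)} − Σ_under x_c^{ℓ(ω)})`, the sums running over the
`w₂`-free WOUND class-`B2a` walks at the far cell that entered it over (`N`) resp. under (`S`) the hole, `ℓ(ω)` the
number of honeycomb edges of `ω` off the far cell. [cite: GlazmanManolescu2019, §4 (first paragraph: «SAW on H(π/3) is identical to that on the hexagonal lattice with the weight of a path γ given by (√(2+√2))^{−|γ|}»)]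
[cite: DuminilCopinSmirnov2012, proof of Lemma 1 («we used the fact that a is on the boundary and Ω is simply connected»)]
[cite: Glazman2015WeightedSAW, Lemma 3.1 (proof, pp. 6–7)] [cite: Hopf1935, Nr. 2 (Umlaufsatz, p. 53) and Nr. 4 eq. (22) (curves with corners, pp. 60–61)] -/
theorem vertexFunctional_printed_farCellW_pi_div_three_eq (Dl : List Face) (w : Face) (hf : farW w ∈ Dl)
    (hh : holeFaceW w ∉ dom Dl) (hr : RootedFace (dom Dl) (w.side .W) (farW w)) :
    vertexFunctional (printedWeights (π / 3)) tFiveEighths (ybCoeff (π / 3)) Dl (w.side .W) (farW w) =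
      Complex.I * ((hexCriticalFugacity ^ 2 : ℝ) : ℂ) *
        (((∑ ω ∈ ΩG.setB2a (dom Dl) (w.side .W) (farW w), ΩG.hexRouteMassW hr .N ω) -
          ∑ ω ∈ ΩG.setB2a (dom Dl) (w.side .W) (farW w), ΩG.hexRouteMassW hr .S ω : ℝ) : ℂ) := by
  rw [vertexFunctional_printed_farCellW_eq pi_div_three_mem_Icc_H Dl w hf hh hr, weightV_pi_div_three]
  simp only [ΩG.routeMassW_pi_div_three_eq]

/-- ★★ **ROUTE KILL AT THE HONEYCOMB POINT (under-route killed).** If every wound class-`B2a` walk entering the far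
cell under the hole (from `S`) passes some other rhombus twice through its two `(π − θ)`-corners, while some wound walk
entering over the hole (from `N`) does not, then at `θ = π/3` the Yang–Baxter vertex identity FAILS at the far cell:
`VF ≠ 0` — although BOTH routes carry wound walks. (Venture lane, exact enumeration: `6 × 5 ∖ {(3,2),(0,4),(5,0),(1,0)}`,
root `W` of `(4,2)`: 256 over / 320 under wound walks, every under-walk marked.)
[cite: GlazmanManolescu2019, Lemma 2.1 (statement, "in the form given in [Gl]")] [cite: GlazmanManolescu2019, §1 (the paragraph of Fig. 2)] -/
theorem vertexFunctional_printed_farCellW_pi_div_three_ne_zero_of_under_killed (Dl : List Face) (w : Face)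
    (hf : farW w ∈ Dl) (hh : holeFaceW w ∉ dom Dl) (hr : RootedFace (dom Dl) (w.side .W) (farW w))
    (hS : ∀ (ω : ΩG (dom Dl) (w.side .W) (farW w)) (h : ω.IsB2a), ω.2.firstSideG = .S →
      ω.WE (fun _ => π / 3) ≠ excursionWinding (π / 3) ω.2.firstSideG (ω.z1 hr h) ω.1 → ¬ω.2.W2FreeOff (farW w))
    (hN : ∃ (ω : ΩG (dom Dl) (w.side .W) (farW w)) (h : ω.IsB2a), ω.2.firstSideG = .N ∧
      ω.WE (fun _ => π / 3) ≠ excursionWinding (π / 3) ω.2.firstSideG (ω.z1 hr h) ω.1 ∧ ω.2.W2FreeOff (farW w)) :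
    vertexFunctional (printedWeights (π / 3)) tFiveEighths (ybCoeff (π / 3)) Dl (w.side .W) (farW w) ≠ 0 := by
  rw [Ne, vertexFunctional_printed_farCellW_eq_zero_iff pi_div_three_mem_Icc_H Dl w hf hh hr,
    ΩG.sum_routeMassW_pi_div_three_eq_zero_of_killed hr .S hS]
  exact (ΩG.sum_routeMassW_pi_div_three_pos_of_free hr .N hN).ne'

/-- ★★ **ROUTE KILL AT THE HONEYCOMB POINT (over-route killed).** The mirror case: every wound over-walk marked by a
double co-corner rhombus, some wound under-walk `w₂`-free ⇒ `VF ≠ 0` at `θ = π/3`.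
[cite: GlazmanManolescu2019, Lemma 2.1 (statement, "in the form given in [Gl]")] [cite: GlazmanManolescu2019, §1 (the paragraph of Fig. 2)] -/
theorem vertexFunctional_printed_farCellW_pi_div_three_ne_zero_of_over_killed (Dl : List Face) (w : Face)
    (hf : farW w ∈ Dl) (hh : holeFaceW w ∉ dom Dl) (hr : RootedFace (dom Dl) (w.side .W) (farW w))
    (hN : ∀ (ω : ΩG (dom Dl) (w.side .W) (farW w)) (h : ω.IsB2a), ω.2.firstSideG = .N →
      ω.WE (fun _ => π / 3) ≠ excursionWinding (π / 3) ω.2.firstSideG (ω.z1 hr h) ω.1 → ¬ω.2.W2FreeOff (farW w))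
    (hS : ∃ (ω : ΩG (dom Dl) (w.side .W) (farW w)) (h : ω.IsB2a), ω.2.firstSideG = .S ∧
      ω.WE (fun _ => π / 3) ≠ excursionWinding (π / 3) ω.2.firstSideG (ω.z1 hr h) ω.1 ∧ ω.2.W2FreeOff (farW w)) :
    vertexFunctional (printedWeights (π / 3)) tFiveEighths (ybCoeff (π / 3)) Dl (w.side .W) (farW w) ≠ 0 := by
  rw [Ne, vertexFunctional_printed_farCellW_eq_zero_iff pi_div_three_mem_Icc_H Dl w hf hh hr,
    ΩG.sum_routeMassW_pi_div_three_eq_zero_of_killed hr .N hN]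
  exact (ΩG.sum_routeMassW_pi_div_three_pos_of_free hr .S hS).ne

/-- ★★ **THE HONEYCOMB ZERO.** If NO wound class-`B2a` walk at the far cell is `w₂`-free (each passes some other rhombus
twice through its two `(π − θ)`-corners — not a hexagonal self-avoiding walk), the Yang–Baxter vertex relation HOLDS at
the far cell at `θ = π/3`, whatever the routes. (Venture lane: `6 × 5 ∖ {(3,2),(3,4),(5,3)}`, root `W` of `(4,2)`: no
over-route and 288 marked under-route wound walks ⇒ `VF(π/3) = 0`, whereas `VF(2π/3) ≠ 0`.)
[cite: GlazmanManolescu2019, Lemma 2.1 (statement, "in the form given in [Gl]")] [cite: GlazmanManolescu2019, §1 (the paragraph of Fig. 2: «if θ = π/3, then w₂ = 0»)] -/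
theorem vertexFunctional_printed_farCellW_pi_div_three_eq_zero_of_killed (Dl : List Face) (w : Face)
    (hf : farW w ∈ Dl) (hh : holeFaceW w ∉ dom Dl) (hr : RootedFace (dom Dl) (w.side .W) (farW w))
    (hK : ∀ (ω : ΩG (dom Dl) (w.side .W) (farW w)) (h : ω.IsB2a),
      ω.WE (fun _ => π / 3) ≠ excursionWinding (π / 3) ω.2.firstSideG (ω.z1 hr h) ω.1 → ¬ω.2.W2FreeOff (farW w)) :
    vertexFunctional (printedWeights (π / 3)) tFiveEighths (ybCoeff (π / 3)) Dl (w.side .W) (farW w) = 0 := by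
  rw [vertexFunctional_printed_farCellW_eq_zero_iff pi_div_three_mem_Icc_H Dl w hf hh hr,
    ΩG.sum_routeMassW_pi_div_three_eq_zero_of_killed hr .N fun ω h _ hW => hK ω h hW,
    ΩG.sum_routeMassW_pi_div_three_eq_zero_of_killed hr .S fun ω h _ hW => hK ω h hW]

/-- ★ **ROUTE KILL AT THE DUAL HONEYCOMB POINT `θ = 2π/3` (under-route killed by `w₁`).** Every wound under-walk
passes some other rhombus twice through its two `θ`-corners, some wound over-walk does not ⇒ `VF ≠ 0` at `θ = 2π/3`.
[cite: GlazmanManolescu2019, Lemma 2.1 (statement, "in the form given in [Gl]")] [cite: GlazmanManolescu2019, §1, remark after eq. (1)] -/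
theorem vertexFunctional_printed_farCellW_two_pi_div_three_ne_zero_of_under_killed (Dl : List Face) (w : Face)
    (hf : farW w ∈ Dl) (hh : holeFaceW w ∉ dom Dl) (hr : RootedFace (dom Dl) (w.side .W) (farW w))
    (hS : ∀ (ω : ΩG (dom Dl) (w.side .W) (farW w)) (h : ω.IsB2a), ω.2.firstSideG = .S →
      ω.WE (fun _ => 2 * π / 3) ≠ excursionWinding (2 * π / 3) ω.2.firstSideG (ω.z1 hr h) ω.1 →
        ¬ω.2.W1FreeOff (farW w))
    (hN : ∃ (ω : ΩG (dom Dl) (w.side .W) (farW w)) (h : ω.IsB2a), ω.2.firstSideG = .N ∧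
      ω.WE (fun _ => 2 * π / 3) ≠ excursionWinding (2 * π / 3) ω.2.firstSideG (ω.z1 hr h) ω.1 ∧
        ω.2.W1FreeOff (farW w)) :
    vertexFunctional (printedWeights (2 * π / 3)) tFiveEighths (ybCoeff (2 * π / 3)) Dl (w.side .W) (farW w) ≠ 0 := by
  rw [Ne, vertexFunctional_printed_farCellW_eq_zero_iff two_pi_div_three_mem_Icc_H Dl w hf hh hr,
    ΩG.sum_routeMassW_two_pi_div_three_eq_zero_of_killed hr .S hS]
  exact (ΩG.sum_routeMassW_two_pi_div_three_pos_of_free hr .N hN).ne'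

/-- ★ **ROUTE KILL AT THE DUAL HONEYCOMB POINT `θ = 2π/3` (over-route killed by `w₁`).**
[cite: GlazmanManolescu2019, Lemma 2.1 (statement, "in the form given in [Gl]")] [cite: GlazmanManolescu2019, §1, remark after eq. (1)] -/
theorem vertexFunctional_printed_farCellW_two_pi_div_three_ne_zero_of_over_killed (Dl : List Face) (w : Face)
    (hf : farW w ∈ Dl) (hh : holeFaceW w ∉ dom Dl) (hr : RootedFace (dom Dl) (w.side .W) (farW w))
    (hN : ∀ (ω : ΩG (dom Dl) (w.side .W) (farW w)) (h : ω.IsB2a), ω.2.firstSideG = .N →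
      ω.WE (fun _ => 2 * π / 3) ≠ excursionWinding (2 * π / 3) ω.2.firstSideG (ω.z1 hr h) ω.1 →
        ¬ω.2.W1FreeOff (farW w))
    (hS : ∃ (ω : ΩG (dom Dl) (w.side .W) (farW w)) (h : ω.IsB2a), ω.2.firstSideG = .S ∧
      ω.WE (fun _ => 2 * π / 3) ≠ excursionWinding (2 * π / 3) ω.2.firstSideG (ω.z1 hr h) ω.1 ∧
        ω.2.W1FreeOff (farW w)) :
    vertexFunctional (printedWeights (2 * π / 3)) tFiveEighths (ybCoeff (2 * π / 3)) Dl (w.side .W) (farW w) ≠ 0 := by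
  rw [Ne, vertexFunctional_printed_farCellW_eq_zero_iff two_pi_div_three_mem_Icc_H Dl w hf hh hr,
    ΩG.sum_routeMassW_two_pi_div_three_eq_zero_of_killed hr .N hN]
  exact (ΩG.sum_routeMassW_two_pi_div_three_pos_of_free hr .S hS).ne

/-- ★ **THE DUAL HONEYCOMB ZERO**: no `w₁`-free wound walk at the far cell ⇒ the vertex relation holds there at
`θ = 2π/3`. [cite: GlazmanManolescu2019, Lemma 2.1 (statement, "in the form given in [Gl]")] [cite: GlazmanManolescu2019, §1, remark after eq. (1)] -/
theorem vertexFunctional_printed_farCellW_two_pi_div_three_eq_zero_of_killed (Dl : List Face) (w : Face)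
    (hf : farW w ∈ Dl) (hh : holeFaceW w ∉ dom Dl) (hr : RootedFace (dom Dl) (w.side .W) (farW w))
    (hK : ∀ (ω : ΩG (dom Dl) (w.side .W) (farW w)) (h : ω.IsB2a),
      ω.WE (fun _ => 2 * π / 3) ≠ excursionWinding (2 * π / 3) ω.2.firstSideG (ω.z1 hr h) ω.1 →
        ¬ω.2.W1FreeOff (farW w)) :
    vertexFunctional (printedWeights (2 * π / 3)) tFiveEighths (ybCoeff (2 * π / 3)) Dl (w.side .W) (farW w) = 0 := by
  rw [vertexFunctional_printed_farCellW_eq_zero_iff two_pi_div_three_mem_Icc_H Dl w hf hh hr,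
    ΩG.sum_routeMassW_two_pi_div_three_eq_zero_of_killed hr .N fun ω h _ hW => hK ω h hW,
    ΩG.sum_routeMassW_two_pi_div_three_eq_zero_of_killed hr .S fun ω h _ hW => hK ω h hW]

/-- ★ **The one-route twin: UNDER ONLY.** On the open range `θ ∈ (π/3, 2π/3)`, if no wound class-`B2a` walk at the far
cell entered over the hole while some wound walk entered under it, the Yang–Baxter vertex identity FAILS at the far
cell (`VF = −i·v(θ)·M_S ≠ 0`). [cite: GlazmanManolescu2019, Lemma 2.1 (statement, "in the form given in [Gl]")]
[cite: Glazman2015WeightedSAW, Lemma 3.1 (proof, pp. 6–7)] -/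
theorem vertexFunctional_printed_farCellW_ne_zero_of_under {θ : ℝ} (hθ : θ ∈ Set.Ioo (π / 3) (2 * π / 3))
    (Dl : List Face) (w : Face) (hf : farW w ∈ Dl) (hh : holeFaceW w ∉ dom Dl)
    (hr : RootedFace (dom Dl) (w.side .W) (farW w))
    (hnoN : ∀ (ω : ΩG (dom Dl) (w.side .W) (farW w)) (h : ω.IsB2a), ω.2.firstSideG = .N →
      ω.WE (fun _ => θ) = excursionWinding θ ω.2.firstSideG (ω.z1 hr h) ω.1)
    (hS : ∃ (ω : ΩG (dom Dl) (w.side .W) (farW w)) (h : ω.IsB2a), ω.2.firstSideG = .S ∧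
      ω.WE (fun _ => θ) ≠ excursionWinding θ ω.2.firstSideG (ω.z1 hr h) ω.1) :
    vertexFunctional (printedWeights θ) tFiveEighths (ybCoeff θ) Dl (w.side .W) (farW w) ≠ 0 := by
  classical
  have hθ' := Set.Ioo_subset_Icc_self hθ
  rw [Ne, vertexFunctional_printed_farCellW_eq_zero_iff hθ' Dl w hf hh hr]
  have hN0 : ∑ ω ∈ ΩG.setB2a (dom Dl) (w.side .W) (farW w), ΩG.routeMassW θ hr .N ω = 0 := by
    refine Finset.sum_eq_zero fun ω hω => ?_
    unfold ΩG.routeMassW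
    split_ifs with h1 h2
    · exact absurd (hnoN ω h1 h2.1) h2.2
    · rfl
    · rfl
  obtain ⟨ω₀, h₀, hz₀, hW₀⟩ := hS
  have hpos : 0 < ∑ ω ∈ ΩG.setB2a (dom Dl) (w.side .W) (farW w), ΩG.routeMassW θ hr .S ω := by
    have hmem : ω₀ ∈ ΩG.setB2a (dom Dl) (w.side .W) (farW w) := by
      simp only [ΩG.setB2a, Finset.mem_filter, Finset.mem_univ, true_and]; exact h₀
    refine lt_of_lt_of_le ?_ (Finset.single_le_sum (fun ω _ => ΩG.routeMassW_nonneg hθ' hr .S ω) hmem)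
    unfold ΩG.routeMassW
    rw [dif_pos h₀, if_pos ⟨hz₀, hW₀⟩]
    exact Finset.prod_pos fun g _ => ω₀.2.localWeight_kindsIn_pos' hθ g
  rw [hN0]
  exact hpos.ne

end Literature.Barriers.CriticalPhenomena.PlaquetteWalk
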